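import Mathlib
import HarnessLib
import Summits.PneNP.PneNP.Theses.CnfIdealGenLength
import Summits.PneNP.PneNP.Theorems.CnfIdealGenLengthRankCount
import Summits.PneNP.PneNP.Theorems.CnfIdealGenLengthRankStability
import Literature.Computability.MetaComplexity.NCIPSFormulaCertificate
import Summits.PneNP.PneNP.Theorems.CnfIdealGenLengthRankDefectRepresentationsTseitinTransfer
import Summits.PneNP.PneNP.Theorems.CnfIdealGenLengthRankDefectRepresentationsIffTautologyInstability
import Summits.PneNP.PneNP.Theorems.CnfIdealGenLengthRankDefectRepresentationsExactification
import Literature.Computability.AlgebraicComplexity.MignonRessayreBound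
import Summits.PneNP.PneNP.Theorems.CnfIdealGenLengthRankDefectRepresentationsSortingLemma
import Summits.PneNP.PneNP.Theorems.CnfIdealGenLengthRankDefectRepresentationsLinearInstability
import Summits.PneNP.PneNP.Theorems.CnfIdealGenLengthRankDefectRepresentationsUniformStability
import Summits.PneNP.PneNP.Theorems.CnfIdealGenLengthRankDefectRepresentationsCutLemmaMonotoneCuts
import Summits.PneNP.PneNP.Theorems.CnfIdealGenLengthRankDefectRepresentationsNumberOperator
import Summits.PneNP.PneNP.Theorems.CnfIdealGenLengthRankDefectRepresentationsNumberOperatorCompression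
import Summits.PneNP.PneNP.Theorems.CnfIdealGenLengthRankDefectRepresentationsWeightDecomposition
import Summits.PneNP.PneNP.Theorems.CnfIdealGenLengthRankDefectRepresentationsFiniteStability
import Summits.PneNP.PneNP.Theorems.CnfIdealGenLengthRankDefectRepresentationsCutLemmaExtension
import Summits.PneNP.PneNP.Theorems.CnfIdealGenLengthRankDefectRepresentationsUniformStabilityFinite
import Summits.PneNP.PneNP.Theorems.CnfIdealGenLengthRankDefectRepresentationsCutLemmaHybridCuts
import Summits.PneNP.PneNP.Theorems.CnfIdealGenLengthRankDefectRepresentationsCutLemmaReciprocal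
import Summits.PneNP.PneNP.Theorems.CnfIdealGenLengthRankDefectRepresentationsCutLemmaCharacterCover
import Summits.PneNP.PneNP.Theorems.CnfIdealGenLengthRankDefectRepresentationsCutLemma
import Summits.PneNP.PneNP.Theorems.CnfIdealGenLengthRankDefectRepresentationsTwoFamilyCutDomination
import Summits.PneNP.PneNP.Theorems.CnfIdealGenLengthRankDefectRepresentationsDoubleMaxCutTwoClasses
import Summits.PneNP.PneNP.Theorems.CnfIdealGenLengthRankDefectRepresentationsSimBoundQuasiPoly
import Summits.PneNP.PneNP.Theorems.CnfIdealGenLengthRankDefectRepresentationsSimBoundMono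
import Summits.PneNP.PneNP.Theorems.CnfIdealGenLengthRankDefectRepresentationsAnchorExtrapolation
import Summits.PneNP.PneNP.Theorems.CnfIdealGenLengthRankDefectRepresentationsStripCompletion
import Summits.PneNP.PneNP.Theorems.CnfIdealGenLengthRankDefectRepresentationsCoreReduction
import Summits.PneNP.PneNP.Theorems.CnfIdealGenLengthRankDefectRepresentationsMergeReduction
import Summits.PneNP.PneNP.Theorems.CnfIdealGenLengthRankDefectRepresentationsQuadrantCapture
import Summits.PneNP.PneNP.Theorems.CnfIdealGenLengthRankDefectRepresentationsSharpAntipodal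
import Summits.PneNP.PneNP.Theorems.CnfIdealGenLengthRankDefectRepresentationsHalvesBudget
import Summits.PneNP.PneNP.Theorems.CnfIdealGenLengthRankDefectRepresentationsSplitReduction
import Summits.PneNP.PneNP.Theorems.CnfIdealGenLengthRankDefectRepresentationsAdjacentInterval
import Summits.PneNP.PneNP.Theorems.CnfIdealGenLengthRankDefectRepresentationsHalvesDiscount
import Summits.PneNP.PneNP.Theorems.CnfIdealGenLengthRankDefectRepresentationsOneSidedSlack
import Summits.PneNP.PneNP.Theorems.CnfIdealGenLengthRankDefectRepresentationsLocalCut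
import Summits.PneNP.PneNP.Theorems.CnfIdealGenLengthRankDefectRepresentationsAverageCut
import Summits.PneNP.PneNP.Theorems.CnfIdealGenLengthRankDefectRepresentationsAverageCapture
import Summits.PneNP.PneNP.Theorems.CnfIdealGenLengthRankDefectRepresentationsStaircaseCap
import Summits.PneNP.PneNP.Theorems.CnfIdealGenLengthRankDefectRepresentationsAvgAdditive
import Summits.PneNP.PneNP.Theorems.CnfIdealGenLengthRankDefectRepresentationsAvgMonotone
import Summits.PneNP.PneNP.Theorems.CnfIdealGenLengthRankDefectRepresentationsOneSidedPair
import Summits.PneNP.PneNP.Theorems.CnfIdealGenLengthRankDefectRepresentationsSharpLocalCut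
import Summits.PneNP.PneNP.Theorems.CnfIdealGenLengthRankDefectRepresentationsSharpAverageCut
import Summits.PneNP.PneNP.Theorems.CnfIdealGenLengthRankDefectRepresentationsRatioWitness
import Summits.PneNP.PneNP.Theorems.CnfIdealGenLengthRankDefectRepresentationsDoubleMaxCutFour
import Summits.PneNP.PneNP.Theorems.CnfIdealGenLengthRankDefectRepresentationsCloseFour
import Summits.PneNP.PneNP.Theorems.CnfIdealGenLengthRankDefectRepresentationsBandAveraging
import Summits.PneNP.PneNP.Theorems.CnfIdealGenLengthRankDefectRepresentationsBandCompletion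
import Summits.PneNP.PneNP.Theorems.CnfIdealGenLengthRankDefectRepresentationsSimLowerBound
import Summits.PneNP.PneNP.Theorems.CnfIdealGenLengthRankDefectRepresentationsOneSidedSim
import Summits.PneNP.PneNP.Theorems.CnfIdealGenLengthRankDefectRepresentationsSigmaSimThree
import Summits.PneNP.PneNP.Theorems.CnfIdealGenLengthRankDefectRepresentationsObliviousNoGo
import Summits.PneNP.PneNP.Theorems.CnfIdealGenLengthRankDefectRepresentationsTwoStepLink
import Summits.PneNP.PneNP.Theorems.CnfIdealGenLengthRankDefectRepresentationsDefectShallow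

/-!
# Line `rank-dehn-ladder` for the crux `RankDefectRepresentations` (stmt-PneNP-18923, route `CnfIdealGenLength`)

Crux (verbatim target, concluded BY NAME by `RankDefectRepresentations_of` below):
`Summit.PneNP.PneNP.Theses.CnfIdealGenLength.RankDefectRepresentations` — a polynomial-size unsatisfiable CNF
family `φ_n` and, for every `c`, eventually matrices `M` under which every Boolean/commutator axiom has rank `≤ t`
but the clause product `P_{φ_n}(M)` has rank `> n^c · t`.

## The ladder (idea card `Ideas/rank-dehn-ladder.md`, sharpened by TRIAGE-r1-1/2)

Three currencies for "how non-genuine is an almost-representation `M` (axiom ranks `≤ t`)":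
* DISTANCE  `D(M)` = least `max_i rank (M_i - M'_i)` over commuting idempotent ("genuine") tuples `M'`;
* CERTIFIED `rank 𝔉(M)` for a polynomial-size non-commutative FORMULA `𝔉` whose polynomial vanishes on `{0,1}^n`
  (i.e. lies in the two-sided ideal `I` of the axioms);
* DETECTED  `rank P_φ(M)` for a polynomial-size unsatisfiable CNF `φ` (the crux's currency).
Always `certified ≤ size · distance` (telescoping `rank_aeval_sub_le` + the folklore `eval_eq_zero_of_cubeVanishing`,
both PROVED here), so the crux factors as

  `t —[rung 2: SuperpolyInstability]→ D —[duality T2a, residual, not filed]→ certified —[CnfUniversality]→ detected`.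

Registered stubs (every `sorry` of this file sits in one of them):
* `stub_superlinearInstability`  — RUNG 1 (first open positive rung): distance `≥ C · n · t` for every `C`, eventually.
  Known: `Θ(n) · t` (pair-block gadget of dead line ref-1: `t = 2`, `D ≥ (n-1)/8`; direct sums of bounded gadgets stay `O_k(n) · t`).
* `stub_superpolyInstability`    — RUNG 2 = the card's lever T1: distance `> n^c · t` for every `c`, eventually.
  KILL: polynomial rank-stability of the Boolean/commutator presentation ("ST-poly") refutes it
  (`not_superpolyInstability_of_polyStable`, same hypothesis shape as the landed
  `not_rankDefectRepresentations_of_polyStable`, p542939); known stability modulus is `2^{O(n)} · t` [arXiv:2401.04676, Thm 5.1].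
* (former) `stub_certifiedInstability` — RUNG 3 = T1⁺ (now a defined rung only, see RESHAPE below): the construction comes WITH a polynomial-size
  cube-vanishing formula certificate of superpolynomial rank. NECESSARY: `certifiedInstability_of_rdr` (RDR ⇒ T1⁺ ⇒ T1 ⇒ rung 1,
  all proved here, sorry-free: `ladder_necessity`).
* (former) `stub_cnfUniversality` — T2b (dropped by the RESHAPE below; definition kept): CNF-universality WITH EXTENSION ROOM: at an almost-representation on `n`
  letters, the certified rank of a small cube-vanishing ARITHMETIC formula is polynomially dominated by the clause-product rank
  of a small unsatisfiable CNF on `N ≥ n + size` variables at an almost-representation `M'` with `t' ≤ poly · t` (typically `M`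
  extended by matrices for auxiliary variables) — a finite, syntactic normal-form statement; replaces the card's universal
  `CnfDetection` (see the line card for the why-easier).
* `stub_tseitinTransfer`         — RUNG of T2b — CLOSED (p595555): the same transfer for BOOLEAN certificates
  `NCIPS.tr T` (`T` a tautology): Tseitin CNF + truth-value extension matrices, whose almost-idempotence / almost-centrality
  defects are `≤ size² · t` by the derivation expansion of commutators.
* `stub_cutLemma`                — NEGATIVE RUNG N1 (the prover's cut lemma of `Lines/dead-RDR-analysis-v2.md`, in block /
  colouring form): if it holds, the two-step-extension (`Ext¹`) mechanism cannot amplify and rung 1 must come from elsewhere.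
Tools PROVED here (no stub): `rank_aeval_sub_le` (telescoping over formula leaves) and `eval_eq_zero_of_cubeVanishing`
(a cube-vanishing polynomial dies at every commuting idempotent matrix tuple — generalises the landed
`eval_clauseProduct_eq_zero_of_commute` from clause products to the whole ideal; point-indicator expansion `lift_eq_sum_pind`).

RESHAPE (lead g2, 2026-08-28, after landing `stub_tseitinTransfer` p595555 and the equivalence
`rankDefectRepresentations_iff_tautologyInstability` p597485): the two load-bearing stubs `stub_certifiedInstability` +
`stub_cnfUniversality` are REPLACED by the single stub `stub_tautologyInstability` (RUNG 3♭: a polynomial-size propositional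
TAUTOLOGY `T` with `rank tr(T)(M) > n^c · t` at a `t`-almost-representation), which is EQUIVALENT to the crux (both directions
kernel-checked in `Theorems/…IffTautologyInstability.lean`); `CnfUniversality` (arithmetic-formula universality) is no longer
needed and is kept only as a definition; `CertifiedInstability` stays a DEFINED rung, implied by the crux (`ladder_necessity`).
Registered stubs after the reshape: `stub_superlinearInstability`, `stub_superpolyInstability`, `stub_tautologyInstability`
(load-bearing, crux-equivalent), `stub_cutLemma` (negative rung N1; PROVED in the rank-one and formula-separable regimes:
`Theorems/…CutLemmaRankOneCuts`, `…CutLemmaFormulaCuts`).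
New composition: `RankDefectRepresentations_of : stub_tautologyInstability → RankDefectRepresentations`.
Former composition (kept, sorry-free, hypotheses now plain): `RankDefectRepresentations_of_certified :
CertifiedInstability → CnfUniversality → RankDefectRepresentations`
(kernel-checked, no sorry: rung 3 is invoked on `n = ⌊N^{1/e}⌋` letters (`exists_root_fun`) so that the extension fits into
`N` variables, exponent bookkeeping `e · (c + 4a + 2)`; the diagonal bookkeeping "pointwise in `c` ⇒ one CNF family" is
PROVED: `rankDefectRepresentations_iff_pointwise`), and the NECESSITY of the ladder is PROVED sorry-free: `ladder_necessity :
(RDR → CertifiedInstability) ∧ (CertifiedInstability → SuperpolyInstability) ∧ (SuperpolyInstability → SuperlinearInstability)`;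
the kill path `not_superpolyInstability_of_polyStable` / `not_certifiedInstability_of_polyStable` (ST-poly ⇒ ¬rung 2 ⇒ ¬rung 3).
P ≠ NP is not moved by any of this; the crux is a FRONTIER formal rung (F-N2).

RESHAPE 2–4 (leads g5–g7, 2026-08-28; full text in `Lines/rank-dehn-ladder-g6*.md`, `-g7-final.md`, `-N1-proof.md` and earlier commits of this file):
`stub_sortingLemma` (N0a, p606832), `stub_uniformStability` (N0b, OPEN, item-deciding: `not_RankDefectRepresentations_of_uniformStability`, p607059),
`stub_linearInstability` (p606622), `stub_weightDecomposition` (p613302), `stub_finiteStability` (N(−1), p618152; `finiteStability_almostRep`),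
`cutLemmaCharZero_iff_extensionStep` (p620038), `uniformStability_finite` (p621531), and `stub_cutLemma` (N1) CLOSED by lead g7 (p642852: cut domination
p641768/p642076 + max-cut decomposition p642504; constants `C = 4`, `a = 1`; hence `ExtensionStep`).  P ≠ NP is not moved; F-N2 is a FRONTIER formal rung.

RESHAPE 5–10b (leads g9–g15, 2026-08-28/29; full text in the memos `Lines/rank-dehn-ladder-g9.md` … `-g15.md` and in earlier commits of this file):
the depth-2 core SIM of N0b (`…SimReduction`, halving step `simBound_sum` p652532) — tool stubs `stub_doubleMaxCutDecomposition`, `stub_simBoundQuasiPoly`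
(p658299), `stub_simBoundMono` (p658480), the ANCHOR METHOD (`stub_anchorExtrapolation` p677763, `stub_stripCompletion` p677961, `doubleMaxCut_quadratic_of_stubs`),
CORE-LINEAR (de-registered in RESHAPE 9, kept as `def CoreLinear`), the MERGE form (`stub_merge` ≡ the registered 2D decomposition, `…MergeReduction` p702065;
`stub_quadrantCapture` p703363), the BUDGET lane (`stub_halvesBudget` p708144, `stub_sharpAntipodal` p708234, `stub_adjacentSplitting`, `stub_splitReduction`,
`stub_adjacentInterval`, `stub_halvesDiscount`) — ALL CLOSED by g16 (constant-4 decomposition).  `stub_superlinearInstability` is DERIVED from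
`stub_superpolyInstability` since RESHAPE 10.  P ≠ NP is not moved; F-N2 is a FRONTIER formal rung.
RESHAPE 11–16 (leads g15–g16): see the section docstrings below (`## RESHAPE 13`, `## RESHAPE 14–16`): every tool stub of the MERGE / CORE-LINEAR
lane is a theorem (constant-4 two-family decomposition, sharp one-family constant 2, SIM quasi-polynomial unconditionally).
RESHAPE 17 (lead g17, 2026-08-29): the Σ-CURRENCY lane (section `## RESHAPE 17` at the end of the file).  `SimBound`'s constant is ≥ (n−1)/2
(`Theorems/…SimLowerBound`, p722109); NEW registered stubs `stub_sigmaSim` (OPEN, the lead's: Σ-SIM with a polynomial constant ⟹ POLYNOMIAL SIM,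
`simBound_poly_of_stub`), `stub_oneSidedSim` (TRUE, worker), `stub_sigmaSimThree` (TRUE, worker), RESHAPE 17b `stub_obliviousNoGo` (TRUE, worker: no
colour-oblivious linear gluing rule is polynomial; CLOSED p724983), RESHAPE 17c `stub_twoStepLink`, `stub_defectShallow` (TRUE, workers); tool `rank_tripleCut_le` / `rank_eqMask_le` (cocycle mask bound) proved.  Open registered stubs:
superpoly/tautologyInstability, uniformStability (crux-sized), sigmaSim; TRUE worker stubs oneSidedSim, sigmaSimThree, obliviousNoGo.  P ≠ NP is not moved; F-N2 is a FRONTIER formal rung.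
-/

set_option linter.dupNamespace false
set_option linter.unusedVariables false

namespace Summit.PneNP.PneNP.Cruxes.RankDefectRepresentations.RankDehnLadder

open Filter
open Literature.Computability.Complexity
open Literature.Computability.MetaComplexity
open Literature.Computability.MetaComplexity.NCIPS
open Literature.Barriers.ValiantsHypothesis (NCFormula)
open Summit.PneNP.PneNP.Theorems.CnfIdealGenLength
open Literature.Computability.AlgebraicComplexity (rank_add_le rank_smul_le)

/-! ## Definitions (the three currencies) -/

section Defs

variable {K : Type} [Field K] {n d : ℕ}

/-- Evaluation `g ↦ g(M)` of a non-commutative polynomial at a matrix tuple (the crux's `MonoidAlgebra.lift …` term). -/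
noncomputable abbrev ev (M : Fin n → Matrix (Fin d) (Fin d) K) (g : MonoidAlgebra K (FreeMonoid (Fin n))) :
    Matrix (Fin d) (Fin d) K :=
  MonoidAlgebra.lift K (Matrix (Fin d) (Fin d) K) (FreeMonoid (Fin n)) (FreeMonoid.lift M) g

/-- `M` is a `t`-almost-representation: every Boolean/commutator axiom has rank `≤ t` under `M`
(literally the crux's hypothesis on `M`). -/
def AlmostRep (M : Fin n → Matrix (Fin d) (Fin d) K) (t : ℕ) : Prop :=
  ∀ g : MonoidAlgebra K (FreeMonoid (Fin n)), IsAxiom g → (ev M g).rank ≤ t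

/-- A genuine representation: pairwise commuting idempotent matrices. -/
def Genuine (M' : Fin n → Matrix (Fin d) (Fin d) K) : Prop :=
  (∀ i, M' i * M' i = M' i) ∧ ∀ i j, M' i * M' j = M' j * M' i

/-- `M` is at (coordinatewise rank-)distance `> D` from every genuine representation of the same size. -/
def FarFromGenuine (M : Fin n → Matrix (Fin d) (Fin d) K) (D : ℕ) : Prop :=
  ∀ M' : Fin n → Matrix (Fin d) (Fin d) K, Genuine M' → ∃ i, D < (M i - M' i).rank

variable (K) in
/-- `u` vanishes on the Boolean cube `{0,1}^n` — i.e. `u` lies in the two-sided ideal generated by the axioms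
(`2^n` scalar evaluations; the semantic-free membership test). -/
def CubeVanishing (u : MonoidAlgebra K (FreeMonoid (Fin n))) : Prop :=
  ∀ σ : Fin n → Bool, boolEval K σ u = 0

omit [Field K] in
/-- Monotonicity of `FarFromGenuine` in the distance parameter. -/
theorem FarFromGenuine.mono [Field K] {M : Fin n → Matrix (Fin d) (Fin d) K} {D D' : ℕ}
    (h : FarFromGenuine M D) (hD : D' ≤ D) : FarFromGenuine M D' := fun M' hM' =>
  let ⟨i, hi⟩ := h M' hM'
  ⟨i, lt_of_le_of_lt hD hi⟩

/-- Sanity (non-vacuity of the currencies): a genuine representation is a `0`-almost-representation. -/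
theorem almostRep_zero_of_genuine {M' : Fin n → Matrix (Fin d) (Fin d) K} (hM' : Genuine M') :
    AlmostRep M' 0 := by
  intro g hg
  rcases hg with ⟨i, rfl⟩ | ⟨i, j, -, rfl⟩
  · have : ev M' (X K i * X K i - X K i) = 0 := by
      simp [X, hM'.1 i]
    rw [this, Matrix.rank_zero]
  · have : ev M' (X K i * X K j - X K j * X K i) = 0 := by
      simp [X, hM'.2 i j]
    rw [this, Matrix.rank_zero]

end Defs

/-! ## The statements of the ladder -/

/-- RUNG 1 (first open positive rung): superlinear DISTANCE instability of the Boolean/commutator presentation. -/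
def SuperlinearInstability : Prop :=
  ∀ C : ℕ, ∀ᶠ n : ℕ in atTop, ∃ (K : Type) (_ : Field K) (_ : CharZero K) (d t : ℕ)
    (M : Fin n → Matrix (Fin d) (Fin d) K), AlmostRep M t ∧ FarFromGenuine M (C * n * t)

/-- RUNG 2 = T1 (the card's lever): superpolynomial DISTANCE instability. -/
def SuperpolyInstability : Prop :=
  ∀ c : ℕ, ∀ᶠ n : ℕ in atTop, ∃ (K : Type) (_ : Field K) (_ : CharZero K) (d t : ℕ)
    (M : Fin n → Matrix (Fin d) (Fin d) K), AlmostRep M t ∧ FarFromGenuine M (n ^ c * t)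

/-- RUNG 3 = T1⁺ (load-bearing): superpolynomial CERTIFIED instability — almost-representations together with a
polynomial-size cube-vanishing non-commutative formula of rank `> n^c · t` under them. -/
def CertifiedInstability : Prop :=
  ∃ s : Polynomial ℕ, ∀ c : ℕ, ∀ᶠ n : ℕ in atTop, ∃ (K : Type) (_ : Field K) (_ : CharZero K) (d t : ℕ)
    (M : Fin n → Matrix (Fin d) (Fin d) K) (𝔉 : NCFormula K (Fin n)),
    AlmostRep M t ∧ CubeVanishing K 𝔉.evalFree ∧ 𝔉.size ≤ s.eval n ∧ n ^ c * t < (𝔉.aeval M).rank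

/-- RUNG 3♭ (lead g2 reshape; LOAD-BEARING and crux-EQUIVALENT by `rankDefectRepresentations_iff_tautologyInstability`):
TAUTOLOGY instability — almost-representations together with a polynomial-size propositional TAUTOLOGY whose LTW translation
has rank `> n^c · t` under them. -/
def TautologyInstability : Prop :=
  ∃ s : Polynomial ℕ, ∀ c : ℕ, ∀ᶠ n : ℕ in atTop, ∃ (K : Type) (_ : Field K) (_ : CharZero K) (d t : ℕ)
    (M : Fin n → Matrix (Fin d) (Fin d) K) (T : PropForm (Fin n)),
    AlmostRep M t ∧ T.IsTautology ∧ T.size ≤ s.eval n ∧ n ^ c * t < (ev M (tr K T)).rank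

/-- T2b (load-bearing): CNF-UNIVERSALITY (with extension room) — from an almost-representation `M` on `n` letters
and a cube-vanishing non-commutative FORMULA certificate `𝔉`, for every `N ≥ n + size 𝔉` there are an unsatisfiable
CNF `φ` on `N` variables with `≤ (N+2)^a` clauses/size and an almost-representation `M'` on `N` letters (parameter
`t' ≤ (N+2)^a · t`; typically `M` extended by matrices for auxiliary variables) such that the certified rank of `𝔉` at
`M` is polynomially dominated by the clause-product rank of `φ` at `M'` (plus `t`).  The Boolean-certificate case is
the rung `TseitinTransfer` below; the content here is the passage from char-0 ARITHMETIC formula certificates to CNFs. -/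
def CnfUniversality : Prop :=
  ∃ a : ℕ, ∀ (n N : ℕ) (K : Type) [Field K] [CharZero K] (d t : ℕ) (M : Fin n → Matrix (Fin d) (Fin d) K)
    (𝔉 : NCFormula K (Fin n)), AlmostRep M t → CubeVanishing K 𝔉.evalFree → n + 𝔉.size ≤ N →
    ∃ φ : CNF (Fin N), ¬ φ.Satisfiable ∧ φ.numClauses ≤ (N + 2) ^ a ∧ φ.size ≤ (N + 2) ^ a ∧
      ∃ (d' t' : ℕ) (M' : Fin N → Matrix (Fin d') (Fin d') K), AlmostRep M' t' ∧ t' ≤ (N + 2) ^ a * t ∧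
        (𝔉.aeval M).rank ≤ (N + 2) ^ a * ((ev M' (clauseProduct K φ)).rank + t)

/-- RUNG of T2b (M/L-sized, plausibly PROVABLE): TSEITIN TRANSFER in the rank metric — the same transfer for BOOLEAN
certificates `tr T` (`T` a propositional tautology, LTW's translation `NCIPS.tr`): extend `M` by the truth-value matrices
`1 - tr(T_g)(M)` of the subformulas (almost idempotent and almost central with defect `≤ size² · t` by the derivation
expansion of commutators), take the Tseitin CNF of `T` plus the unit clause "root false"; its clause product at the
extension is `U · tr(T)(M) · V` with `rank (U - 1), rank (V - 1) ≤ poly · t`. -/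
def TseitinTransfer : Prop :=
  ∃ a : ℕ, ∀ (n N : ℕ) (K : Type) [Field K] [CharZero K] (d t : ℕ) (M : Fin n → Matrix (Fin d) (Fin d) K)
    (T : PropForm (Fin n)), T.IsTautology → AlmostRep M t → n + T.size ≤ N →
    ∃ φ : CNF (Fin N), ¬ φ.Satisfiable ∧ φ.numClauses ≤ (N + 2) ^ a ∧ φ.size ≤ (N + 2) ^ a ∧
      ∃ (d' t' : ℕ) (M' : Fin N → Matrix (Fin d') (Fin d') K), AlmostRep M' t' ∧ t' ≤ (N + 2) ^ a * t ∧
        (ev M (tr K T)).rank ≤ (N + 2) ^ a * ((ev M' (clauseProduct K φ)).rank + t)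

/-- The crux read pointwise in `c` (a CNF may depend on `c`); equivalent to the crux by the diagonal lemma. -/
def RDRPointwise : Prop :=
  ∃ p : Polynomial ℕ, ∀ c : ℕ, ∀ᶠ n : ℕ in atTop, ∃ φ : CNF (Fin n),
    (¬ φ.Satisfiable ∧ φ.numClauses ≤ p.eval n ∧ φ.size ≤ p.eval n) ∧
      ∃ (K : Type) (_ : Field K) (_ : CharZero K) (d t : ℕ) (M : Fin n → Matrix (Fin d) (Fin d) K),
        AlmostRep M t ∧ n ^ c * t < (ev M (clauseProduct K φ)).rank

/-- NEGATIVE RUNG N1 — the CUT LEMMA (prover's question in `Lines/dead-RDR-analysis-v2.md`, block/colouring form): rows and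
columns carry cube colours; if for EVERY coordinate `j` the part of `R` on colour pairs differing at `j` has rank `≤ t`,
then `R` is within rank `C (n+1)^a · t` of a matrix supported on equal-colour pairs.  (True ⇒ the two-step-extension
mechanism cannot produce rung 1; false with a superpolynomial gap ⇒ a candidate mechanism for rung 2.) -/
def CutLemma : Prop :=
  ∃ C a : ℕ, ∀ (K : Type) [Field K] (n : ℕ) (ι ι' : Type) [Fintype ι] [Fintype ι']
    (row : ι → Fin n → Bool) (col : ι' → Fin n → Bool) (t : ℕ) (R : Matrix ι ι' K),
    (∀ j : Fin n, (Matrix.of fun x y => if row x j ≠ col y j then R x y else 0).rank ≤ t) →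
      ∃ R' : Matrix ι ι' K, (∀ x y, row x ≠ col y → R' x y = 0) ∧ (R - R').rank ≤ C * (n + 1) ^ a * t

section NewDefs
variable {K : Type} [Field K] {n d : ℕ}

/-- Ordered ("sorted") product `∏_{i ∈ S, i increasing} U_i` of the matrices indexed by `S`. -/
noncomputable def sortedProd (U : Fin n → Matrix (Fin d) (Fin d) K) (S : Finset (Fin n)) :
    Matrix (Fin d) (Fin d) K :=
  (((List.finRange n).filter (· ∈ S)).map U).prod

end NewDefs

/-- NEGATIVE RUNG N0a (TRUE, tool): the SORTING LEMMA — exact involutions with pairwise commutators of rank `≤ t`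
generate, through their sorted products, a UNIFORM `|S|·|T|·t`-almost-homomorphism of `Z_2^n` in the rank metric. -/
def SortingLemma : Prop :=
  ∀ (K : Type) [Field K] (n d t : ℕ) (U : Fin n → Matrix (Fin d) (Fin d) K),
    (∀ i, U i * U i = 1) → (∀ i j, (U i * U j - U j * U i).rank ≤ t) →
    ∀ S T : Finset (Fin n),
      (sortedProd U S * sortedProd U T - sortedProd U (symmDiff S T)).rank ≤ S.card * T.card * t

/-- NEGATIVE RUNG N0b (OPEN; the item's deciding question in Ulam form): UNIFORM rank-stability of `Z_2^n` with a
constant polynomial in `n` (= polylogarithmic in the group order): every map `ρ : 2^{[n]} → K^{d×d}` with `ρ ∅ = 1`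
whose whole multiplication table holds up to rank `δ` is within rank `n^a · δ` of a genuine representation. -/
def UniformStability : Prop :=
  ∃ a : ℕ, ∀ᶠ n : ℕ in atTop, ∀ (K : Type) [Field K] [CharZero K] (d δ : ℕ)
    (ρ : Finset (Fin n) → Matrix (Fin d) (Fin d) K), ρ ∅ = 1 →
    (∀ S T : Finset (Fin n), (ρ S * ρ T - ρ (symmDiff S T)).rank ≤ δ) →
    ∃ π : Finset (Fin n) → Matrix (Fin d) (Fin d) K, π ∅ = 1 ∧
      (∀ S T : Finset (Fin n), π S * π T = π (symmDiff S T)) ∧ ∀ S : Finset (Fin n), (ρ S - π S).rank ≤ n ^ a * δ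

/-- CALIBRATION RUNG (TRUE): LINEAR instability — the known `Θ(n) · t` floor of rung 1: for every `n ≥ 1` a
`t`-almost-representation with `t ≤ C` at coordinatewise rank-distance `≥ n / C - 1` from every genuine one. -/
def LinearInstability : Prop :=
  ∃ C : ℕ, ∀ n : ℕ, 0 < n → ∃ (K : Type) (_ : Field K) (_ : CharZero K) (d t : ℕ)
    (M : Fin n → Matrix (Fin d) (Fin d) K), AlmostRep M t ∧ t ≤ C ∧
    ∀ M' : Fin n → Matrix (Fin d) (Fin d) K, Genuine M' → ∃ i, n ≤ C * ((M i - M' i).rank + 1)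


/-- NEGATIVE RUNG N0c (TRUE, worker-sized L): the WEIGHT DECOMPOSITION — by the Number Operator Lemma (p610916) and the
Cauchy compression lemma (p611619), every tuple of idempotents with pairwise commutator ranks `≤ t` admits an EXACT complete
orthogonal family `Q_0, …, Q_n` ("weight projections") almost commuting with every `ε_i` and with `∑ k Q_k` within polynomial
rank of the number operator `∑ ε_i`.  Proof plan: `W := ker ∏(E − k)` (codim `≤ n³t`, `E`-invariant, `E|_W` semisimple with
spectrum in `{0..n}` since the roots are distinct in characteristic 0); `Q_k :=` projection onto the `k`-eigenspace of `E|_W`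
(junk complement absorbed into `Q_0`); `rank (∑ k Q_k − E) ≤ n³t`; `rank [Q_k, ε_i] ≤ 2 · (n+1) · rank [∑ k Q_k, ε_i]` by
`rank_sub_compression_le`. -/
def WeightDecomposition : Prop :=
  ∀ (K : Type) [Field K] [CharZero K] (n d t : ℕ) (ε : Fin n → Matrix (Fin d) (Fin d) K),
    (∀ i, ε i * ε i = ε i) → (∀ i j, (ε i * ε j - ε j * ε i).rank ≤ t) →
    ∃ Q : Fin (n + 1) → Matrix (Fin d) (Fin d) K,
      (∀ k, Q k * Q k = Q k) ∧ (∀ k l, k ≠ l → Q k * Q l = 0) ∧ (∑ k, Q k = 1) ∧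
      (∀ i k, (Q k * ε i - ε i * Q k).rank ≤ 10 * (n + 1) ^ 4 * t) ∧
      ((∑ k : Fin (n + 1), ((k : ℕ) : K) • Q k) - ∑ i, ε i).rank ≤ 10 * (n + 1) ^ 4 * t

/-- NEGATIVE RUNG N(−1) (TRUE, calibration; lead g6 RESHAPE 3): FINITE rank-stability of the Boolean/commutator presentation for
EVERY fixed `n` — there is a constant `C_n` (depending on `n` only) such that idempotents `E_1,…,E_n` (char 0) with pairwise commutator
ranks `≤ t` are within rank `C_n · t` of a commuting idempotent tuple.  This is the generator form of the rank-stability of `Z_2^n`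
(Bauer–Blachar–Greenfeld, IMRN 2025 = arXiv:2401.04676, Thm 5.1, specialised; so far only CITED on this line).  It makes the ladder's
dichotomy a statement about a finite kernel-checked quantity `C_n := sup dist/t`: rung 1 ⟺ `C_n/n` unbounded, rung 2 ⟺ `C_n`
superpolynomial (i.o.), `stub_uniformStability` ⟹ `C_n ≤ n^a`.  Proof route: induction on `n`; the cells of the already-genuine
`E′_1..E′_n` form an exact complete orthogonal family and the landed two-family step (`…TwoFamilyStability.twoFamily_stable`, p614956)
applied to `(1 − E_{n+1}, E_{n+1})` gives an exact idempotent commuting with every cell; `C_{n+1} = 90·2^n·(n+1)·(1+2C_n)`. -/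
def FiniteStability : Prop :=
  ∀ n : ℕ, ∃ C : ℕ, ∀ (K : Type) [Field K] [CharZero K] (d t : ℕ) (E : Fin n → Matrix (Fin d) (Fin d) K),
    (∀ i, E i * E i = E i) → (∀ i j, (E i * E j - E j * E i).rank ≤ t) →
    ∃ E' : Fin n → Matrix (Fin d) (Fin d) K, (∀ i, E' i * E' i = E' i) ∧ (∀ i j, E' i * E' j = E' j * E' i) ∧
      ∀ i, (E i - E' i).rank ≤ C * t

/-- The cut lemma restricted to fields of characteristic `0` (the crux's setting). -/
def CutLemmaCharZero : Prop :=
  ∃ C a : ℕ, ∀ (K : Type) [Field K] [CharZero K] (n : ℕ) (ι ι' : Type) [Fintype ι] [Fintype ι']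
    (row : ι → Fin n → Bool) (col : ι' → Fin n → Bool) (t : ℕ) (R : Matrix ι ι' K),
    (∀ j : Fin n, (Matrix.of fun x y => if row x j ≠ col y j then R x y else 0).rank ≤ t) →
      ∃ R' : Matrix ι ι' K, (∀ x y, row x ≠ col y → R' x y = 0) ∧ (R - R').rank ≤ C * (n + 1) ^ a * t

/-- ONE-STEP EXTENSION form of rank-stability (lead g6): commuting idempotents written in a common eigenbasis = a colouring
`c` of the basis by `{0,1}^n`; an idempotent `X` whose coordinate cuts (`= ±[E_j, X]`) have rank `≤ t` is within rank
`C (n+1)^a · t` of an IDEMPOTENT commuting with every `E_j` (supported on equal-colour pairs).  EQUIVALENT to `CutLemmaCharZero`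
(`cutLemmaCharZero_iff_extensionStep`, via `Theorems/…CutLemmaExtension`, p620038): N1 is exactly the last step of any
generator-by-generator proof of `stub_uniformStability`. -/
def ExtensionStep : Prop :=
  ∃ C a : ℕ, ∀ (K : Type) [Field K] [CharZero K] (n d : ℕ) (c : Fin d → Fin n → Bool) (t : ℕ)
    (X : Matrix (Fin d) (Fin d) K), X * X = X →
    (∀ j : Fin n, (Matrix.of fun x y => if c x j ≠ c y j then X x y else 0).rank ≤ t) →
      ∃ X' : Matrix (Fin d) (Fin d) K, X' * X' = X' ∧ (∀ x y, c x ≠ c y → X' x y = 0) ∧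
        (X - X').rank ≤ C * (n + 1) ^ a * t

/-! ## Registered stubs (the ONLY sorries of this file)

Lead g2 (2026-08-28): every stub is stated UNFOLDED (no local `def` in its type: `AlmostRep`, `ev`, `Genuine`,
`FarFromGenuine`, `CubeVanishing` and the rung `def`s are spelled out), so that the registered signature can be restated
verbatim in a `Theorems/` file that imports only `Mathlib` + `Literature` (Theorems files cannot import this Cruxes file);
each `stub_X` is definitionally a proof of the corresponding `def X` above, and is used as such below. -/

/-- RUNG 2 stub = `SuperpolyInstability` (T1), unfolded. [open; implied by rung 3, implies rung 1; refuted by ST-poly] -/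
theorem stub_superpolyInstability :
    ∀ c : ℕ, ∀ᶠ n : ℕ in atTop, ∃ (K : Type) (_ : Field K) (_ : CharZero K) (d t : ℕ)
      (M : Fin n → Matrix (Fin d) (Fin d) K),
      (∀ g : MonoidAlgebra K (FreeMonoid (Fin n)), IsAxiom g →
        (MonoidAlgebra.lift K (Matrix (Fin d) (Fin d) K) (FreeMonoid (Fin n)) (FreeMonoid.lift M) g).rank ≤ t) ∧
      ∀ M' : Fin n → Matrix (Fin d) (Fin d) K, ((∀ i, M' i * M' i = M' i) ∧ ∀ i j, M' i * M' j = M' j * M' i) →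
        ∃ i, n ^ c * t < (M i - M' i).rank := by
  sorry

/-- RUNG 1 = `SuperlinearInstability`, unfolded.  [open as a STATEMENT; since lead g15 RESHAPE 10 no longer a registered stub: it is implied by
rung 2 (`stub_superpolyInstability`, `superlinear_of_superpoly`), from which it is derived here] -/
theorem stub_superlinearInstability :
    ∀ C : ℕ, ∀ᶠ n : ℕ in atTop, ∃ (K : Type) (_ : Field K) (_ : CharZero K) (d t : ℕ)
      (M : Fin n → Matrix (Fin d) (Fin d) K),
      (∀ g : MonoidAlgebra K (FreeMonoid (Fin n)), IsAxiom g →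
        (MonoidAlgebra.lift K (Matrix (Fin d) (Fin d) K) (FreeMonoid (Fin n)) (FreeMonoid.lift M) g).rank ≤ t) ∧
      ∀ M' : Fin n → Matrix (Fin d) (Fin d) K, ((∀ i, M' i * M' i = M' i) ∧ ∀ i j, M' i * M' j = M' j * M' i) →
        ∃ i, C * n * t < (M i - M' i).rank := by
  intro C
  filter_upwards [stub_superpolyInstability 2, eventually_ge_atTop C] with n hn hCn
  obtain ⟨K, iF, iC, d, t, M, hM, hfar⟩ := hn
  refine ⟨K, iF, iC, d, t, M, hM, fun M' hM' => ?_⟩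
  obtain ⟨i, hi⟩ := hfar M' hM'
  refine ⟨i, lt_of_le_of_lt (Nat.mul_le_mul_right t ?_) hi⟩
  rw [pow_two]; exact Nat.mul_le_mul_right n hCn

/-- RUNG 3♭ stub = `TautologyInstability` (LOAD-BEARING; crux-equivalent), unfolded.  Replaces the former stubs
`stub_certifiedInstability` + `stub_cnfUniversality` (lead g2 reshape). [open; ≥ crux-hard — it IS the crux] -/
theorem stub_tautologyInstability :
    ∃ s : Polynomial ℕ, ∀ c : ℕ, ∀ᶠ n : ℕ in atTop, ∃ (K : Type) (_ : Field K) (_ : CharZero K) (d t : ℕ)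
      (M : Fin n → Matrix (Fin d) (Fin d) K) (T : PropForm (Fin n)),
      (∀ g : MonoidAlgebra K (FreeMonoid (Fin n)), IsAxiom g →
        (MonoidAlgebra.lift K (Matrix (Fin d) (Fin d) K) (FreeMonoid (Fin n)) (FreeMonoid.lift M) g).rank ≤ t) ∧
      T.IsTautology ∧ T.size ≤ s.eval n ∧
      n ^ c * t < (MonoidAlgebra.lift K (Matrix (Fin d) (Fin d) K) (FreeMonoid (Fin n)) (FreeMonoid.lift M) (tr K T)).rank := by
  sorry

/-- RUNG of T2b = `TseitinTransfer` (Boolean certificates), unfolded — CLOSED: kernel-checked in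
`Theorems/CnfIdealGenLengthRankDefectRepresentationsTseitinTransfer.lean` (p595555, exponent `a = 5`). -/
theorem stub_tseitinTransfer :
    ∃ a : ℕ, ∀ (n N : ℕ) (K : Type) [Field K] [CharZero K] (d t : ℕ) (M : Fin n → Matrix (Fin d) (Fin d) K)
      (T : PropForm (Fin n)), T.IsTautology →
      (∀ g : MonoidAlgebra K (FreeMonoid (Fin n)), IsAxiom g →
        (MonoidAlgebra.lift K (Matrix (Fin d) (Fin d) K) (FreeMonoid (Fin n)) (FreeMonoid.lift M) g).rank ≤ t) → n + T.size ≤ N →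
      ∃ φ : CNF (Fin N), ¬ φ.Satisfiable ∧ φ.numClauses ≤ (N + 2) ^ a ∧ φ.size ≤ (N + 2) ^ a ∧
        ∃ (d' t' : ℕ) (M' : Fin N → Matrix (Fin d') (Fin d') K),
          (∀ g : MonoidAlgebra K (FreeMonoid (Fin N)), IsAxiom g →
            (MonoidAlgebra.lift K (Matrix (Fin d') (Fin d') K) (FreeMonoid (Fin N)) (FreeMonoid.lift M') g).rank
              ≤ t') ∧ t' ≤ (N + 2) ^ a * t ∧
          (MonoidAlgebra.lift K (Matrix (Fin d) (Fin d) K) (FreeMonoid (Fin n)) (FreeMonoid.lift M) (tr K T)).rank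
            ≤ (N + 2) ^ a *
              ((MonoidAlgebra.lift K (Matrix (Fin d') (Fin d') K) (FreeMonoid (Fin N)) (FreeMonoid.lift M')
                (clauseProduct K φ)).rank + t) :=
  Summit.PneNP.PneNP.Theorems.CnfIdealGenLengthRankDefectRepresentationsTseitinTransfer.stub_tseitinTransfer

/-- NEGATIVE RUNG N1 stub = `CutLemma`, unfolded — CLOSED (lead g7, p642852): kernel-checked in
`Theorems/CnfIdealGenLengthRankDefectRepresentationsCutLemma.lean` with `C = 4`, `a = 1` (max-cut decomposition p642504 +
cut domination p641768/p642076; also settles the additive cut conjecture (A)). -/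
theorem stub_cutLemma :
    ∃ C a : ℕ, ∀ (K : Type) [Field K] (n : ℕ) (ι ι' : Type) [Fintype ι] [Fintype ι']
      (row : ι → Fin n → Bool) (col : ι' → Fin n → Bool) (t : ℕ) (R : Matrix ι ι' K),
      (∀ j : Fin n, (Matrix.of fun x y => if row x j ≠ col y j then R x y else 0).rank ≤ t) →
        ∃ R' : Matrix ι ι' K, (∀ x y, row x ≠ col y → R' x y = 0) ∧ (R - R').rank ≤ C * (n + 1) ^ a * t :=
  Summit.PneNP.PneNP.Theorems.CnfIdealGenLengthRankDefectRepresentationsCutLemma.stub_cutLemma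

/-- NEGATIVE RUNG N0a stub = `SortingLemma`, unfolded — CLOSED: kernel-checked in
`Theorems/CnfIdealGenLengthRankDefectRepresentationsSortingLemma.lean` (p606832, lead g5). -/
theorem stub_sortingLemma :
    ∀ (K : Type) [Field K] (n d t : ℕ) (U : Fin n → Matrix (Fin d) (Fin d) K),
      (∀ i, U i * U i = 1) → (∀ i j, (U i * U j - U j * U i).rank ≤ t) →
      ∀ S T : Finset (Fin n),
        ((((List.finRange n).filter (· ∈ S)).map U).prod * (((List.finRange n).filter (· ∈ T)).map U).prod -
            (((List.finRange n).filter (· ∈ symmDiff S T)).map U).prod).rank ≤ S.card * T.card * t :=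
  Summit.PneNP.PneNP.Theorems.CnfIdealGenLengthRankDefectRepresentationsSortingLemma.stub_sortingLemma

/-- NEGATIVE RUNG N0b stub = `UniformStability`, unfolded. [OPEN — its proof REFUTES the crux
(`not_RankDefectRepresentations_of_uniformStability`); its failure with a superpolynomial gap is rung 2 i.o.] -/
theorem stub_uniformStability :
    ∃ a : ℕ, ∀ᶠ n : ℕ in atTop, ∀ (K : Type) [Field K] [CharZero K] (d δ : ℕ)
      (ρ : Finset (Fin n) → Matrix (Fin d) (Fin d) K), ρ ∅ = 1 →
      (∀ S T : Finset (Fin n), (ρ S * ρ T - ρ (symmDiff S T)).rank ≤ δ) →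
      ∃ π : Finset (Fin n) → Matrix (Fin d) (Fin d) K, π ∅ = 1 ∧
        (∀ S T : Finset (Fin n), π S * π T = π (symmDiff S T)) ∧
        ∀ S : Finset (Fin n), (ρ S - π S).rank ≤ n ^ a * δ := by
  sorry

/-- CALIBRATION stub = `LinearInstability`, unfolded — CLOSED: kernel-checked in
`Theorems/CnfIdealGenLengthRankDefectRepresentationsLinearInstability.lean` (p606622, lead g5; `C = 8`). -/
theorem stub_linearInstability :
    ∃ C : ℕ, ∀ n : ℕ, 0 < n → ∃ (K : Type) (_ : Field K) (_ : CharZero K) (d t : ℕ)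
      (M : Fin n → Matrix (Fin d) (Fin d) K),
      (∀ g : MonoidAlgebra K (FreeMonoid (Fin n)), IsAxiom g →
        (MonoidAlgebra.lift K (Matrix (Fin d) (Fin d) K) (FreeMonoid (Fin n)) (FreeMonoid.lift M) g).rank ≤ t) ∧
      t ≤ C ∧
      ∀ M' : Fin n → Matrix (Fin d) (Fin d) K, ((∀ i, M' i * M' i = M' i) ∧ ∀ i j, M' i * M' j = M' j * M' i) →
        ∃ i, n ≤ C * ((M i - M' i).rank + 1) :=
  Summit.PneNP.PneNP.Theorems.CnfIdealGenLengthRankDefectRepresentationsLinearInstability.stub_linearInstability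

/-- NEGATIVE RUNG N0c stub = `WeightDecomposition`, unfolded — CLOSED: kernel-checked in
`Theorems/CnfIdealGenLengthRankDefectRepresentationsWeightDecomposition.lean` (p613302, lead g5; tools p610916, p611619). -/
theorem stub_weightDecomposition :
    ∀ (K : Type) [Field K] [CharZero K] (n d t : ℕ) (ε : Fin n → Matrix (Fin d) (Fin d) K),
      (∀ i, ε i * ε i = ε i) → (∀ i j, (ε i * ε j - ε j * ε i).rank ≤ t) →
      ∃ Q : Fin (n + 1) → Matrix (Fin d) (Fin d) K,
        (∀ k, Q k * Q k = Q k) ∧ (∀ k l, k ≠ l → Q k * Q l = 0) ∧ (∑ k, Q k = 1) ∧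
        (∀ i k, (Q k * ε i - ε i * Q k).rank ≤ 10 * (n + 1) ^ 4 * t) ∧
        ((∑ k : Fin (n + 1), ((k : ℕ) : K) • Q k) - ∑ i, ε i).rank ≤ 10 * (n + 1) ^ 4 * t :=
  Summit.PneNP.PneNP.Theorems.CnfIdealGenLengthRankDefectRepresentationsWeightDecomposition.stub_weightDecomposition

/-- NEGATIVE RUNG N(−1) stub = `FiniteStability`, unfolded (lead g6 RESHAPE 3) — CLOSED: kernel-checked in
`Theorems/CnfIdealGenLengthRankDefectRepresentationsFiniteStability.lean` (p618152, lead g6; `C_{n+1} = 90·2^n·(n+1)·(1+2C_n)`). -/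
theorem stub_finiteStability :
    ∀ n : ℕ, ∃ C : ℕ, ∀ (K : Type) [Field K] [CharZero K] (d t : ℕ) (E : Fin n → Matrix (Fin d) (Fin d) K),
      (∀ i, E i * E i = E i) → (∀ i j, (E i * E j - E j * E i).rank ≤ t) →
      ∃ E' : Fin n → Matrix (Fin d) (Fin d) K, (∀ i, E' i * E' i = E' i) ∧ (∀ i j, E' i * E' j = E' j * E' i) ∧
        ∀ i, (E i - E' i).rank ≤ C * t :=
  Summit.PneNP.PneNP.Theorems.CnfIdealGenLengthRankDefectRepresentationsFiniteStability.stub_finiteStability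

/-- TOOL stub (lead g11 RESHAPE 7) = CORE-LINEAR, the honest open core of the 2D max-cut decomposition: for a CORE of `D` — rows
and columns whose (I-colour, J-colour) lies in a grid `P₀ × Q₀` of at most `c` first-family and at most `c` second-family classes — some
matrix of rank `≤ C·c` (`C` ABSOLUTE) agrees with `D` at the core's visible entries, whenever all double cuts of `D` are `≤ c`.  By the
kernel REDUCTION `Theorems/…CoreReduction.doubleMaxCut_of_cores` (p680652, lead g11: one maximal anchor + the sub-anchor strip lemma
p679859 in four symmetric forms + four one-family pieces + a 16-cell analysis) it implies the 2D max-cut decomposition with the ABSOLUTE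
constant `λ = 100 + 4C`, hence `stub_doubleMaxCutDecomposition` below (now a theorem of this file).  Known: trivial `8·min(#P₀,#Q₀)·c ≤ 8c²`;
Theorem A (p678858) `c + 160c²`; every anchor recursion inside a core pays `O(c)` per node on `O(c)` nodes (memo `Lines/rank-dehn-ladder-g11.md`
§§5, 8, 9).  [OPEN; lead g15 RESHAPE 9: no longer a REGISTERED stub (its content is `stub_merge`'s, g14 §1) — kept as the
named strong form `CoreLinear`, with `doubleMaxCut_of_coreLinear` / `merge_of_coreLinear` now taking it as a hypothesis] -/
def CoreLinear : Prop :=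
    ∃ C : ℕ, ∀ (K : Type) [Field K] (n n' : ℕ) (ι ι' : Type) [Fintype ι] [Fintype ι'] [DecidableEq ι] [DecidableEq ι']
      (row : ι → Fin n ⊕ Fin n' → Bool) (col : ι' → Fin n ⊕ Fin n' → Bool) (D : Matrix ι ι' K) (c : ℕ)
      (P₀ : Finset (Fin n → Bool)) (Q₀ : Finset (Fin n' → Bool)),
      (∀ B B', Summit.PneNP.PneNP.Theorems.CnfIdealGenLengthRankDefectRepresentationsTwoFamilyCutDomination.doubleCut
          row col B B' D ≤ c) →
      P₀.card ≤ c → Q₀.card ≤ c →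
      ∃ L : Matrix ι ι' K, L.rank ≤ C * c ∧
        ∀ x y,
          Summit.PneNP.PneNP.Theorems.CnfIdealGenLengthRankDefectRepresentationsTwoFamilyCutDomination.colourI (row x) ≠
            Summit.PneNP.PneNP.Theorems.CnfIdealGenLengthRankDefectRepresentationsTwoFamilyCutDomination.colourI (col y) →
          Summit.PneNP.PneNP.Theorems.CnfIdealGenLengthRankDefectRepresentationsTwoFamilyCutDomination.colourJ (row x) ≠
            Summit.PneNP.PneNP.Theorems.CnfIdealGenLengthRankDefectRepresentationsTwoFamilyCutDomination.colourJ (col y) →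
          Summit.PneNP.PneNP.Theorems.CnfIdealGenLengthRankDefectRepresentationsTwoFamilyCutDomination.colourI (row x) ∈ P₀ →
          Summit.PneNP.PneNP.Theorems.CnfIdealGenLengthRankDefectRepresentationsTwoFamilyCutDomination.colourJ (row x) ∈ Q₀ →
          Summit.PneNP.PneNP.Theorems.CnfIdealGenLengthRankDefectRepresentationsTwoFamilyCutDomination.colourI (col y) ∈ P₀ →
          Summit.PneNP.PneNP.Theorems.CnfIdealGenLengthRankDefectRepresentationsTwoFamilyCutDomination.colourJ (col y) ∈ Q₀ →
          L x y = D x y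

/-- TOOL (lead g9 RESHAPE 5; since lead g11 RESHAPE 7 a THEOREM of this file) = the 2D MAX-CUT DECOMPOSITION with a constant polynomial in
the number of coordinates: if every double bipartition cut of a matrix coloured by `{0,1}^n × {0,1}^{n'}` has rank `≤ c`, then
`D = S_I + S_J + L` with `S_I` supported on "first-family colours agree", `S_J` on "second-family colours agree" and
`rank L ≤ L (n+n'+1)^e · c`.  `def DoubleMaxCutDecomposition` is in `Theorems/…TwoFamilyCutDomination` (p653152); one family with the
absolute constant 4 is p642504; the `n' = 1` slice with the absolute constant 8 is p657204; the class-independent QUADRATIC bound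
`c + 160c²` is Theorem A (p678858).  PROVED HERE from `stub_coreLinear` via the reduction `doubleMaxCut_of_cores` (p680652), with the
ABSOLUTE constant `λ = 100 + 4C` (`e = 0`).  (Since RESHAPE 9: conditional on `CoreLinear`.) -/
theorem doubleMaxCut_of_coreLinear (hCL : CoreLinear) :
    ∃ L e : ℕ, ∀ (K : Type) [Field K] (n n' : ℕ),
      Summit.PneNP.PneNP.Theorems.CnfIdealGenLengthRankDefectRepresentationsTwoFamilyCutDomination.DoubleMaxCutDecomposition
        K n n' (L * (n + n' + 1) ^ e) := by
  obtain ⟨C, hC⟩ := hCL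
  refine ⟨100 + 4 * C, 0, fun K _ n n' => ?_⟩
  intro ι ι' _ _ _ _ row col D c hc
  obtain ⟨SI, SJ, h1, h2, h3⟩ :=
    Summit.PneNP.PneNP.Theorems.CnfIdealGenLengthRankDefectRepresentationsCoreReduction.doubleMaxCut_of_cores
      K n n' ι ι' row col D c (C * c) hc (fun P₀ Q₀ hP hQ => hC K n n' ι ι' row col D c P₀ Q₀ hc hP hQ)
  refine ⟨SI, SJ, h1, h2, h3.trans (le_of_eq ?_)⟩
  ring

/-! ## RESHAPE 14–16 (lead g16): the SHARP one-family theorem (constant 2), the average-currency bookkeeping, and the TWO-FAMILY decomposition with the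
## ABSOLUTE CONSTANT 4 — `stub_merge` and `stub_adjacentSplitting` become THEOREMS (full text: memo `Lines/rank-dehn-ladder-g16.md` §7 and the g16 commits)
Waves 2–4 (W14 staircaseCap, W16 avgAdditive, W17 avgMonotone, W18 oneSidedPair, W19 sharpLocalCut, W20 sharpAverageCut ⟹ `mc(F) ≤ 2·E_B μ(B)`, W15 ratioWitness)
and wave 5 (X1 bandCompletion p717460, X2 bandAveraging p716325) all LANDED; **`mc(D) ≤ 4 · E_{A,A′} Φ(A,A′)`** (`…DoubleMaxCutFour` p715699, `…CloseFour` p715753), so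
`doubleMaxCut_four`, `stub_merge`, `stub_adjacentSplitting`, `coreLinear_of_four`, `stub_doubleMaxCutDecomposition`, `simBound_quasiPoly_of_stubs` below are UNCONDITIONAL.
P ≠ NP is not moved; F-N2 is a FRONTIER formal rung. -/

/-- TOOL stub (lead g16 RESHAPE 14/15; TRUE tool: STAIRCASE CAP — every weak staircase of length `ℓ` inside any instance has `ℓ·#cuts ≤ 4·ΣΦ` (`ℓ ≤ 4ē`): triangular certificates calibrate but cannot refute the constant-4 decomposition).  [CLOSED — stub-worker on the lead's brief W14, p715189 `Theorems/…StaircaseCap`] -/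
theorem stub_staircaseCap :
    ∀ (K : Type) [Field K] (n n' : ℕ) (ι ι' : Type) [Fintype ι] [Fintype ι'] [DecidableEq ι] [DecidableEq ι']
      (row : ι → Fin n ⊕ Fin n' → Bool) (col : ι' → Fin n ⊕ Fin n' → Bool) (D : Matrix ι ι' K)
      (ℓ : ℕ) (s : Fin ℓ → ι) (t : Fin ℓ → ι'),
      (∀ i j : Fin ℓ, j ≤ i →
        Summit.PneNP.PneNP.Theorems.CnfIdealGenLengthRankDefectRepresentationsTwoFamilyCutDomination.colourI (row (s i)) ≠
          Summit.PneNP.PneNP.Theorems.CnfIdealGenLengthRankDefectRepresentationsTwoFamilyCutDomination.colourI (col (t j)) ∧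
        Summit.PneNP.PneNP.Theorems.CnfIdealGenLengthRankDefectRepresentationsTwoFamilyCutDomination.colourJ (row (s i)) ≠
          Summit.PneNP.PneNP.Theorems.CnfIdealGenLengthRankDefectRepresentationsTwoFamilyCutDomination.colourJ (col (t j))) →
      (∀ i : Fin ℓ, D (s i) (t i) ≠ 0) →
      (∀ i j : Fin ℓ, j < i → D (s i) (t j) = 0) →
      ℓ * (2 ^ (2 ^ n) * 2 ^ (2 ^ n')) ≤
        4 * ∑ A : Finset (Fin n → Bool), ∑ A' : Finset (Fin n' → Bool),
          Summit.PneNP.PneNP.Theorems.CnfIdealGenLengthRankDefectRepresentationsTwoFamilyCutDomination.doubleCut row col A A' D :=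
  Summit.PneNP.PneNP.Theorems.CnfIdealGenLengthRankDefectRepresentationsStaircaseCap.stub_staircaseCap

/-- TOOL stub (lead g16 RESHAPE 14/15; TRUE tool: AVERAGE ADDITIVITY over zero-cross halves — `ē(N₀ ⊞ N₁) = ē(N₀) + ē(N₁)` (from W1)).  [CLOSED — stub-worker on the lead's brief W16, (stub-worker) `Theorems/…AvgAdditive`] -/
theorem stub_avgAdditive :
    ∀ (K : Type) [Field K] (n n' : ℕ) (ι ι' : Type) [Fintype ι] [Fintype ι'] [DecidableEq ι] [DecidableEq ι']
      (row : ι → Fin n ⊕ Fin (n' + 1) → Bool) (col : ι' → Fin n ⊕ Fin (n' + 1) → Bool) (D : Matrix ι ι' K),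
      (∀ x y, row x (Sum.inr (Fin.last n')) ≠ col y (Sum.inr (Fin.last n')) → D x y = 0) →
      ∑ B : Finset (Fin n → Bool), ∑ B' : Finset (Fin (n' + 1) → Bool),
          Summit.PneNP.PneNP.Theorems.CnfIdealGenLengthRankDefectRepresentationsTwoFamilyCutDomination.doubleCut row col B B' D =
        2 ^ (2 ^ n') *
          (∑ B : Finset (Fin n → Bool),
              ∑ S ∈ (Finset.univ.filter fun σ : Fin (n' + 1) → Bool => σ (Fin.last n') = false).powerset,
                Summit.PneNP.PneNP.Theorems.CnfIdealGenLengthRankDefectRepresentationsTwoFamilyCutDomination.doubleCut row col B S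
                  (Matrix.of fun x y =>
                    if row x (Sum.inr (Fin.last n')) = false ∧ col y (Sum.inr (Fin.last n')) = false then D x y else 0) +
            ∑ B : Finset (Fin n → Bool),
              ∑ S ∈ (Finset.univ.filter fun σ : Fin (n' + 1) → Bool => σ (Fin.last n') = true).powerset,
                Summit.PneNP.PneNP.Theorems.CnfIdealGenLengthRankDefectRepresentationsTwoFamilyCutDomination.doubleCut row col B S
                  (Matrix.of fun x y =>
                    if row x (Sum.inr (Fin.last n')) = true ∧ col y (Sum.inr (Fin.last n')) = true then D x y else 0)) :=
  Summit.PneNP.PneNP.Theorems.CnfIdealGenLengthRankDefectRepresentationsAvgAdditive.stub_avgAdditive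

/-- TOOL stub (lead g16 RESHAPE 14/15; TRUE tool: AVERAGE MONOTONICITY — `ē(quadrant sub-instance) ≤ ē(D)`).  [CLOSED — stub-worker on the lead's brief W17, p715139 `Theorems/…AvgMonotone`] -/
theorem stub_avgMonotone :
    ∀ (K : Type) [Field K] (n n' : ℕ) (ι ι' : Type) [Fintype ι] [Fintype ι'] [DecidableEq ι] [DecidableEq ι']
      (row : ι → Fin n ⊕ Fin n' → Bool) (col : ι' → Fin n ⊕ Fin n' → Bool) (D : Matrix ι ι' K)
      (B : Finset (Fin n → Bool)) (B' : Finset (Fin n' → Bool)),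
      2 ^ (2 ^ n - B.card) * 2 ^ (2 ^ n' - B'.card) *
          ∑ S ∈ B.powerset, ∑ S' ∈ B'.powerset,
            Summit.PneNP.PneNP.Theorems.CnfIdealGenLengthRankDefectRepresentationsTwoFamilyCutDomination.doubleCut row col S S'
              (Matrix.of fun x y =>
                if Summit.PneNP.PneNP.Theorems.CnfIdealGenLengthRankDefectRepresentationsTwoFamilyCutDomination.colourI (row x) ∈ B ∧
                    Summit.PneNP.PneNP.Theorems.CnfIdealGenLengthRankDefectRepresentationsTwoFamilyCutDomination.colourJ (row x) ∈ B' ∧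
                    Summit.PneNP.PneNP.Theorems.CnfIdealGenLengthRankDefectRepresentationsTwoFamilyCutDomination.colourI (col y) ∈ B ∧
                    Summit.PneNP.PneNP.Theorems.CnfIdealGenLengthRankDefectRepresentationsTwoFamilyCutDomination.colourJ (col y) ∈ B'
                then D x y else 0) ≤
        ∑ A : Finset (Fin n → Bool), ∑ A' : Finset (Fin n' → Bool),
          Summit.PneNP.PneNP.Theorems.CnfIdealGenLengthRankDefectRepresentationsTwoFamilyCutDomination.doubleCut row col A A' D :=
  Summit.PneNP.PneNP.Theorems.CnfIdealGenLengthRankDefectRepresentationsAvgMonotone.stub_avgMonotone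

/-- TOOL stub (lead g16 RESHAPE 14/15; TRUE tool: one-sided decomposition, column AND row versions with the JOINT error bound `rank E + rank E′ ≤ rank Q + rank S + Σδ`).  [CLOSED — stub-worker on the lead's brief W18, p715251 `Theorems/…OneSidedPair`] -/
theorem stub_oneSidedPair :
    ∀ (K : Type) [Field K] (ι ι' Q : Type) [Fintype ι] [Fintype ι'] [DecidableEq ι] [DecidableEq ι'] [DecidableEq Q]
      (row : ι → Q) (col : ι' → Q) (R : Matrix ι ι' K) (B : Finset Q) (δ : Q → ℤ),
      (∀ i ∈ B,
        (((Matrix.of fun x y => if row x ∈ B.erase i ∧ col y ∉ B.erase i then R x y else 0).rank : ℤ) +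
          ((Matrix.of fun x y => if row x ∉ B.erase i ∧ col y ∈ B.erase i then R x y else 0).rank : ℤ)) ≤
        ((Matrix.of fun x y => if row x ∈ B ∧ col y ∉ B then R x y else 0).rank : ℤ) +
          ((Matrix.of fun x y => if row x ∉ B ∧ col y ∈ B then R x y else 0).rank : ℤ) + δ i) →
      ∃ (Pc Pr E E' : Matrix ι ι' K) (Z : Matrix ι' ι' K) (Zr : Matrix ι ι K),
        (∀ x y, ¬ (row x = col y ∧ col y ∈ B) → Pc x y = 0) ∧
        (∀ x y, ¬ (row x = col y ∧ col y ∈ B) → Pr x y = 0) ∧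
        (Matrix.of fun x y => if row x ∈ B ∧ col y ∈ B then R x y else 0) - Pc =
          (Matrix.of fun x y => if row x ∈ B ∧ col y ∉ B then R x y else 0) * Z + E ∧
        (Matrix.of fun x y => if row x ∈ B ∧ col y ∈ B then R x y else 0) - Pr =
          Zr * (Matrix.of fun x y => if row x ∉ B ∧ col y ∈ B then R x y else 0) + E' ∧
        (E.rank : ℤ) + (E'.rank : ℤ) ≤
          ((Matrix.of fun x y => if row x ∈ B ∧ col y ∉ B then R x y else 0).rank : ℤ) +
            ((Matrix.of fun x y => if row x ∉ B ∧ col y ∈ B then R x y else 0).rank : ℤ) + ∑ i ∈ B, δ i :=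
  Summit.PneNP.PneNP.Theorems.CnfIdealGenLengthRankDefectRepresentationsOneSidedPair.stub_oneSidedPair

/-- TOOL stub (lead g16 RESHAPE 14/15; TRUE tool: the SHARP local cut inequality `2·rank (R − R′_B) ≤ 4μ(B) + Σ_i (μ(B△i) − μ(B))`).  [CLOSED — stub-worker on the lead's brief W19, (stub-worker) `Theorems/…SharpLocalCut`] -/
theorem stub_sharpLocalCut :
    (∀ (K : Type) [Field K] (ι ι' Q : Type) [Fintype ι] [Fintype ι'] [DecidableEq ι] [DecidableEq ι'] [DecidableEq Q]
      (row : ι → Q) (col : ι' → Q) (R : Matrix ι ι' K) (B : Finset Q) (δ : Q → ℤ),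
      (∀ i ∈ B,
        (((Matrix.of fun x y => if row x ∈ B.erase i ∧ col y ∉ B.erase i then R x y else 0).rank : ℤ) +
          ((Matrix.of fun x y => if row x ∉ B.erase i ∧ col y ∈ B.erase i then R x y else 0).rank : ℤ)) ≤
        ((Matrix.of fun x y => if row x ∈ B ∧ col y ∉ B then R x y else 0).rank : ℤ) +
          ((Matrix.of fun x y => if row x ∉ B ∧ col y ∈ B then R x y else 0).rank : ℤ) + δ i) →
      ∃ (Pc Pr E E' : Matrix ι ι' K) (Z : Matrix ι' ι' K) (Zr : Matrix ι ι K),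
        (∀ x y, ¬ (row x = col y ∧ col y ∈ B) → Pc x y = 0) ∧
        (∀ x y, ¬ (row x = col y ∧ col y ∈ B) → Pr x y = 0) ∧
        (Matrix.of fun x y => if row x ∈ B ∧ col y ∈ B then R x y else 0) - Pc =
          (Matrix.of fun x y => if row x ∈ B ∧ col y ∉ B then R x y else 0) * Z + E ∧
        (Matrix.of fun x y => if row x ∈ B ∧ col y ∈ B then R x y else 0) - Pr =
          Zr * (Matrix.of fun x y => if row x ∉ B ∧ col y ∈ B then R x y else 0) + E' ∧
        (E.rank : ℤ) + (E'.rank : ℤ) ≤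
          ((Matrix.of fun x y => if row x ∈ B ∧ col y ∉ B then R x y else 0).rank : ℤ) +
            ((Matrix.of fun x y => if row x ∉ B ∧ col y ∈ B then R x y else 0).rank : ℤ) + ∑ i ∈ B, δ i) →
    ∀ (K : Type) [Field K] (ι ι' Q : Type) [Fintype ι] [Fintype ι'] [DecidableEq ι] [DecidableEq ι'] [Fintype Q] [DecidableEq Q]
      (row : ι → Q) (col : ι' → Q) (R : Matrix ι ι' K) (B : Finset Q),
      ∃ R' : Matrix ι ι' K, (∀ x y, row x ≠ col y → R' x y = 0) ∧
        2 * ((R - R').rank : ℤ) ≤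
          4 * (((Matrix.of fun x y => if row x ∈ B ∧ col y ∉ B then R x y else 0).rank : ℤ) +
              ((Matrix.of fun x y => if row x ∉ B ∧ col y ∈ B then R x y else 0).rank : ℤ)) +
          ∑ i : Q, ((((Matrix.of fun x y => if row x ∈ symmDiff B {i} ∧ col y ∉ symmDiff B {i} then R x y else 0).rank : ℤ) +
              ((Matrix.of fun x y => if row x ∉ symmDiff B {i} ∧ col y ∈ symmDiff B {i} then R x y else 0).rank : ℤ)) -
            (((Matrix.of fun x y => if row x ∈ B ∧ col y ∉ B then R x y else 0).rank : ℤ) +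
              ((Matrix.of fun x y => if row x ∉ B ∧ col y ∈ B then R x y else 0).rank : ℤ))) :=
  Summit.PneNP.PneNP.Theorems.CnfIdealGenLengthRankDefectRepresentationsSharpLocalCut.stub_sharpLocalCut

/-- TOOL stub (lead g16 RESHAPE 14/15; TRUE tool: the SHARP one-family average-cut decomposition `mc(F) ≤ 2·E_B μ(B)` (Theorem 2 with constant 2; sharp)).  [CLOSED — stub-worker on the lead's brief W20, p715138 `Theorems/…SharpAverageCut`] -/
theorem stub_sharpAverageCut :
    (∀ (K : Type) [Field K] (ι ι' Q : Type) [Fintype ι] [Fintype ι'] [DecidableEq ι] [DecidableEq ι'] [Fintype Q] [DecidableEq Q]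
      (row : ι → Q) (col : ι' → Q) (R : Matrix ι ι' K) (B : Finset Q),
      ∃ R' : Matrix ι ι' K, (∀ x y, row x ≠ col y → R' x y = 0) ∧
        2 * ((R - R').rank : ℤ) ≤
          4 * (((Matrix.of fun x y => if row x ∈ B ∧ col y ∉ B then R x y else 0).rank : ℤ) +
              ((Matrix.of fun x y => if row x ∉ B ∧ col y ∈ B then R x y else 0).rank : ℤ)) +
          ∑ i : Q, ((((Matrix.of fun x y => if row x ∈ symmDiff B {i} ∧ col y ∉ symmDiff B {i} then R x y else 0).rank : ℤ) +
              ((Matrix.of fun x y => if row x ∉ symmDiff B {i} ∧ col y ∈ symmDiff B {i} then R x y else 0).rank : ℤ)) -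
            (((Matrix.of fun x y => if row x ∈ B ∧ col y ∉ B then R x y else 0).rank : ℤ) +
              ((Matrix.of fun x y => if row x ∉ B ∧ col y ∈ B then R x y else 0).rank : ℤ)))) →
    ∀ (K : Type) [Field K] (ι ι' Q : Type) [Fintype ι] [Fintype ι'] [DecidableEq ι] [DecidableEq ι'] [Fintype Q] [DecidableEq Q]
      (row : ι → Q) (col : ι' → Q) (R : Matrix ι ι' K),
      ∃ R' : Matrix ι ι' K, (∀ x y, row x ≠ col y → R' x y = 0) ∧
        2 ^ Fintype.card Q * (R - R').rank ≤
          2 * ∑ B : Finset Q, ((Matrix.of fun x y => if row x ∈ B ∧ col y ∉ B then R x y else 0).rank +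
              (Matrix.of fun x y => if row x ∉ B ∧ col y ∈ B then R x y else 0).rank) :=
  Summit.PneNP.PneNP.Theorems.CnfIdealGenLengthRankDefectRepresentationsSharpAverageCut.stub_sharpAverageCut

/-- TOOL stub (lead g16 RESHAPE 14/15; kernel certificate: an explicit 9×9 instance with all rectangles of rank ≤ 2 and every completion of rank 9 (ratio `mc/c₀ = 4.5`)).  [CLOSED — stub-worker on the lead's brief W15, p715720 `Theorems/…RatioWitness`] -/
theorem stub_ratioWitness :
    ∃ (row col : Fin 9 → Fin 2 ⊕ Fin 3 → Bool),
      (∀ (K : Type) [Field K] (B : Finset (Fin 2 → Bool)) (B' : Finset (Fin 3 → Bool)) (s t : Bool),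
        (Summit.PneNP.PneNP.Theorems.CnfIdealGenLengthRankDefectRepresentationsQuadrantCapture.rect row col B B' s t
          (1 : Matrix (Fin 9) (Fin 9) K)).rank ≤ 2) ∧
      (∀ (K : Type) [Field K] (L : Matrix (Fin 9) (Fin 9) K),
        (∀ i j, Summit.PneNP.PneNP.Theorems.CnfIdealGenLengthRankDefectRepresentationsTwoFamilyCutDomination.colourI (row i) ≠
            Summit.PneNP.PneNP.Theorems.CnfIdealGenLengthRankDefectRepresentationsTwoFamilyCutDomination.colourI (col j) →
          Summit.PneNP.PneNP.Theorems.CnfIdealGenLengthRankDefectRepresentationsTwoFamilyCutDomination.colourJ (row i) ≠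
            Summit.PneNP.PneNP.Theorems.CnfIdealGenLengthRankDefectRepresentationsTwoFamilyCutDomination.colourJ (col j) →
          L i j = (1 : Matrix (Fin 9) (Fin 9) K) i j) →
        L.rank = 9) :=
  Summit.PneNP.PneNP.Theorems.CnfIdealGenLengthRankDefectRepresentationsRatioWitness.stub_ratioWitness

/-- TOOL stub (lead g16 RESHAPE 16; TRUE, worker X1) = BAND COMPLETION at an arbitrary double cut (generic two-colouring form): on the row band
`{rI ∈ A, rJ ∈ A′}` one matrix agrees with `D` on every visible cell and has rank `≤ rank R(A,A′)` + (private dimensions of the first-family strips in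
`R(A∖i,A′)`) + (second-family strips in `R(A,A′∖j)`) + (class pairs in `R(A∖i,A′∖j)`).  [CLOSED — stub-worker on the lead's brief X1, p717460 `Theorems/…BandCompletion`] -/
theorem stub_bandCompletion :
    ∀ (K : Type) [Field K] (ι ι' X Y : Type) [Fintype ι] [Fintype ι'] [DecidableEq ι] [DecidableEq ι'] [DecidableEq X] [DecidableEq Y]
      (rI : ι → X) (rJ : ι → Y) (cI : ι' → X) (cJ : ι' → Y) (D : Matrix ι ι' K) (A : Finset X) (A' : Finset Y),
      ∃ L : Matrix ι ι' K,
        (∀ x y, ¬ (rI x ∈ A ∧ rJ x ∈ A') → L x y = 0) ∧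
        (∀ x y, rI x ∈ A → rJ x ∈ A' → rI x ≠ cI y → rJ x ≠ cJ y → L x y = D x y) ∧
        (L.rank : ℤ) ≤
          ((Matrix.of fun x y => if (rI x ∈ A ∧ rJ x ∈ A') ∧ (cI y ∉ A ∧ cJ y ∉ A') then D x y else 0).rank : ℤ) +
          ∑ i ∈ A,
            (((Matrix.of fun x y => if (rI x ∈ A.erase i ∧ rJ x ∈ A') ∧ (cI y ∉ A.erase i ∧ cJ y ∉ A') then D x y else 0).rank : ℤ) -
             ((Matrix.of fun x y => if (rI x ∈ A.erase i ∧ rJ x ∈ A') ∧ (cI y ∉ A ∧ cJ y ∉ A') then D x y else 0).rank : ℤ)) +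
          ∑ j ∈ A',
            (((Matrix.of fun x y => if (rI x ∈ A ∧ rJ x ∈ A'.erase j) ∧ (cI y ∉ A ∧ cJ y ∉ A'.erase j) then D x y else 0).rank : ℤ) -
             ((Matrix.of fun x y => if (rI x ∈ A ∧ rJ x ∈ A'.erase j) ∧ (cI y ∉ A ∧ cJ y ∉ A') then D x y else 0).rank : ℤ)) +
          ∑ i ∈ A, ∑ j ∈ A',
            (((Matrix.of fun x y => if (rI x ∈ A.erase i ∧ rJ x ∈ A'.erase j) ∧ (cI y ∉ A.erase i ∧ cJ y ∉ A'.erase j)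
                then D x y else 0).rank : ℤ) -
             ((Matrix.of fun x y => if (rI x ∈ A.erase i ∧ rJ x ∈ A'.erase j) ∧ (cI y ∉ A.erase i ∧ cJ y ∉ A'.erase j) ∧
                  ¬ (cI y = i ∧ cJ y = j) then D x y else 0).rank : ℤ)) :=
  Summit.PneNP.PneNP.Theorems.CnfIdealGenLengthRankDefectRepresentationsBandCompletion.stub_bandCompletion

/-- TOOL stub (lead g16 RESHAPE 16; TRUE, worker X2) = BAND AVERAGING: summed over all double cuts, the three error families of X1 total at most
`3 · Σ rank R(A,A′)` (re-indexing `A ↦ A∖i` + private dimensions over a column partition).  [CLOSED — stub-worker on the lead's brief X2, p716325 `Theorems/…BandAveraging`] -/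
theorem stub_bandAveraging :
    ∀ (K : Type) [Field K] (ι ι' X Y : Type) [Fintype ι] [Fintype ι'] [DecidableEq ι] [DecidableEq ι'] [Fintype X] [DecidableEq X]
      [Fintype Y] [DecidableEq Y] (rI : ι → X) (rJ : ι → Y) (cI : ι' → X) (cJ : ι' → Y) (D : Matrix ι ι' K),
      ∑ A : Finset X, ∑ A' : Finset Y,
        (∑ i ∈ A,
            (((Matrix.of fun x y => if (rI x ∈ A.erase i ∧ rJ x ∈ A') ∧ (cI y ∉ A.erase i ∧ cJ y ∉ A') then D x y else 0).rank : ℤ) -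
             ((Matrix.of fun x y => if (rI x ∈ A.erase i ∧ rJ x ∈ A') ∧ (cI y ∉ A ∧ cJ y ∉ A') then D x y else 0).rank : ℤ)) +
          ∑ j ∈ A',
            (((Matrix.of fun x y => if (rI x ∈ A ∧ rJ x ∈ A'.erase j) ∧ (cI y ∉ A ∧ cJ y ∉ A'.erase j) then D x y else 0).rank : ℤ) -
             ((Matrix.of fun x y => if (rI x ∈ A ∧ rJ x ∈ A'.erase j) ∧ (cI y ∉ A ∧ cJ y ∉ A') then D x y else 0).rank : ℤ)) +
          ∑ i ∈ A, ∑ j ∈ A',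
            (((Matrix.of fun x y => if (rI x ∈ A.erase i ∧ rJ x ∈ A'.erase j) ∧ (cI y ∉ A.erase i ∧ cJ y ∉ A'.erase j)
                then D x y else 0).rank : ℤ) -
             ((Matrix.of fun x y => if (rI x ∈ A.erase i ∧ rJ x ∈ A'.erase j) ∧ (cI y ∉ A.erase i ∧ cJ y ∉ A'.erase j) ∧
                  ¬ (cI y = i ∧ cJ y = j) then D x y else 0).rank : ℤ))) ≤
        3 * ∑ A : Finset X, ∑ A' : Finset Y,
          ((Matrix.of fun x y => if (rI x ∈ A ∧ rJ x ∈ A') ∧ (cI y ∉ A ∧ cJ y ∉ A') then D x y else 0).rank : ℤ) :=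
  Summit.PneNP.PneNP.Theorems.CnfIdealGenLengthRankDefectRepresentationsBandAveraging.stub_bandAveraging

/-- **THE TWO-FAMILY MAX-CUT DECOMPOSITION WITH THE ABSOLUTE CONSTANT 4** (lead g16): from X1 and X2 by the assembly `Theorems/…DoubleMaxCutFour` (p715699). -/
theorem doubleMaxCut_four (K : Type) [Field K] (n n' : ℕ) :
    Summit.PneNP.PneNP.Theorems.CnfIdealGenLengthRankDefectRepresentationsTwoFamilyCutDomination.DoubleMaxCutDecomposition K n n' 4 :=
  Summit.PneNP.PneNP.Theorems.CnfIdealGenLengthRankDefectRepresentationsDoubleMaxCutFour.doubleMaxCut_four stub_bandCompletion stub_bandAveraging n n'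

/-- **CORE-LINEAR holds with `C = 4`** (the named strong form of leads g11–g15): immediate from the constant-4 decomposition (the completion serves every core). -/
theorem coreLinear_of_four : CoreLinear := by
  refine ⟨4, ?_⟩
  intro K _ n n' ι ι' _ _ _ _ row col D c P₀ Q₀ hc _ _
  classical
  obtain ⟨SI, SJ, hSI, hSJ, hL⟩ := doubleMaxCut_four K n n' ι ι' row col D c hc
  refine ⟨D - SI - SJ, hL, ?_⟩
  intro x y hI hJ _ _ _ _
  have h1 : SI x y = 0 := hSI x y (by
    by_contra hcon; push Not at hcon; exact hI (funext fun k => hcon k))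
  have h2 : SJ x y = 0 := hSJ x y (by
    by_contra hcon; push Not at hcon; exact hJ (funext fun k => hcon k))
  simp [Matrix.sub_apply, h1, h2]

/-- TOOL stub (lead g14 RESHAPE 8) = MERGE, the one-coordinate step of the 2D max-cut decomposition: for a two-family instance with `n`
first-family and `n'+1` second-family coordinates whose CROSS data at the last second-family coordinate vanish, all of whose double cuts are
`≤ c`, and each of whose two halves `{σ_last = b}` agrees on its visible cells with a matrix of rank `≤ m`, the whole decomposes as
`S_I + S_J + L` with `rank L ≤ m + λ₁ c`, `λ₁ = L₁ (n+n'+2)^e` polynomial in the number of coordinates (`def MergeBound`,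
`Theorems/…MergeReduction`, p702065).  EQUIVALENT to `stub_doubleMaxCutDecomposition` (`doubleMaxCutDecomposition_poly_of_merge` /
`merge_of_doubleMaxCut`, kernel); implied by `stub_coreLinear` (`merge_of_coreLinear` below).  [OPEN — registered; the lead's stub; M/L] -/
theorem stub_merge :
    ∃ L₁ e : ℕ, ∀ (K : Type) [Field K] (n n' : ℕ),
      Summit.PneNP.PneNP.Theorems.CnfIdealGenLengthRankDefectRepresentationsMergeReduction.MergeBound K n n' (L₁ * (n + n' + 2) ^ e) :=
  Summit.PneNP.PneNP.Theorems.CnfIdealGenLengthRankDefectRepresentationsCloseFour.merge_of_four (fun K _ n n' => doubleMaxCut_four K n n')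

/-- TOOL (lead g9 RESHAPE 5; a THEOREM of this file since lead g11 RESHAPE 7, re-derived by lead g14 RESHAPE 8 from `stub_merge`) = the 2D
MAX-CUT DECOMPOSITION with a constant polynomial in the number of coordinates (`def DoubleMaxCutDecomposition`, p653152).  From `stub_merge` by
the one-coordinate halving induction `doubleMaxCutDecomposition_poly_of_merge` (p702065, `e ↦ e + 1`); the absolute-constant route from
`stub_coreLinear` is `doubleMaxCut_of_coreLinear` above. -/
theorem stub_doubleMaxCutDecomposition :
    ∃ L e : ℕ, ∀ (K : Type) [Field K] (n n' : ℕ),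
      Summit.PneNP.PneNP.Theorems.CnfIdealGenLengthRankDefectRepresentationsTwoFamilyCutDomination.DoubleMaxCutDecomposition
        K n n' (L * (n + n' + 1) ^ e) := by
  obtain ⟨L₁, e, h⟩ := stub_merge
  exact Summit.PneNP.PneNP.Theorems.CnfIdealGenLengthRankDefectRepresentationsMergeReduction.doubleMaxCutDecomposition_poly_of_merge h

/-- CORE-LINEAR ⟹ MERGE (with `e = 0` up to the bookkeeping of `doubleMaxCut_of_coreLinear`): the strong form implies the lead's stub. -/
theorem merge_of_coreLinear (hCL : CoreLinear) :
    ∃ L₁ e : ℕ, ∀ (K : Type) [Field K] (n n' : ℕ),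
      Summit.PneNP.PneNP.Theorems.CnfIdealGenLengthRankDefectRepresentationsMergeReduction.MergeBound K n n' (L₁ * (n + n' + 2) ^ e) := by
  obtain ⟨L, e, h⟩ := doubleMaxCut_of_coreLinear hCL
  refine ⟨L, e, fun K _ n n' => ?_⟩
  have h1 := h K n (n' + 1)
  rw [show n + (n' + 1) + 1 = n + n' + 2 by ring] at h1
  exact Summit.PneNP.PneNP.Theorems.CnfIdealGenLengthRankDefectRepresentationsMergeReduction.merge_of_doubleMaxCut h1

/-- TOOL stub (lead g14 RESHAPE 8) = QUADRANT CAPTURE (TRUE on paper, worker-sized; memo `Lines/rank-dehn-ladder-g14.md` §2): at a MAXIMISER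
`(B, B′)` of the double cut, ONE matrix of rank `≤ 17c` agrees with `D` on every visible cell that is separated by `B` (first family) OR by
`B′` (second family) — so only the four QUADRANT sub-instances `(B^{±} × B′^{±})` remain.  Proof: the `B′`-masked matrix `maskJ row col B′ D` is
an honest first-family instance whose bipartition-cut function is `A ↦ doubleCut A B′`, maximised at `B`, so g7's `exists_blockDiagonal_of_maxCut`
(p642852) puts it within rank `4c` of a first-family block-diagonal matrix (`L₁`); symmetrically the `B`-masked matrix (second-family cut function
`A′ ↦ doubleCut B A′`, maximised at `B′`) gives `L₂`; then `N := L₁ ∘ 1[B′-separated] + L₂ ∘ 1[B-separated] − D ∘ 1[both]` has rank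
`≤ 8c + 8c + c`.  First step of every balanced recursion / four-way MERGE scheme.  [CLOSED — lead g14, p703363
`Theorems/…QuadrantCapture` (`doubleCut_eq_sum_four`, `rank_add_of_disjoint`, `cutJ_maskI_eq_doubleCut`)] -/
theorem stub_quadrantCapture :
    ∀ (K : Type) [Field K] (n n' : ℕ) (ι ι' : Type) [Fintype ι] [Fintype ι'] [DecidableEq ι] [DecidableEq ι']
      (row : ι → Fin n ⊕ Fin n' → Bool) (col : ι' → Fin n ⊕ Fin n' → Bool) (D : Matrix ι ι' K) (c : ℕ)
      (B : Finset (Fin n → Bool)) (B' : Finset (Fin n' → Bool)),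
      (∀ A A', Summit.PneNP.PneNP.Theorems.CnfIdealGenLengthRankDefectRepresentationsTwoFamilyCutDomination.doubleCut row col A A' D ≤
        Summit.PneNP.PneNP.Theorems.CnfIdealGenLengthRankDefectRepresentationsTwoFamilyCutDomination.doubleCut row col B B' D) →
      Summit.PneNP.PneNP.Theorems.CnfIdealGenLengthRankDefectRepresentationsTwoFamilyCutDomination.doubleCut row col B B' D ≤ c →
      ∃ N : Matrix ι ι' K, N.rank ≤ 17 * c ∧
        ∀ x y,
          Summit.PneNP.PneNP.Theorems.CnfIdealGenLengthRankDefectRepresentationsTwoFamilyCutDomination.colourI (row x) ≠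
            Summit.PneNP.PneNP.Theorems.CnfIdealGenLengthRankDefectRepresentationsTwoFamilyCutDomination.colourI (col y) →
          Summit.PneNP.PneNP.Theorems.CnfIdealGenLengthRankDefectRepresentationsTwoFamilyCutDomination.colourJ (row x) ≠
            Summit.PneNP.PneNP.Theorems.CnfIdealGenLengthRankDefectRepresentationsTwoFamilyCutDomination.colourJ (col y) →
          ((Summit.PneNP.PneNP.Theorems.CnfIdealGenLengthRankDefectRepresentationsTwoFamilyCutDomination.colourI (row x) ∈ B) ≠
              (Summit.PneNP.PneNP.Theorems.CnfIdealGenLengthRankDefectRepresentationsTwoFamilyCutDomination.colourI (col y) ∈ B) ∨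
            (Summit.PneNP.PneNP.Theorems.CnfIdealGenLengthRankDefectRepresentationsTwoFamilyCutDomination.colourJ (row x) ∈ B') ≠
              (Summit.PneNP.PneNP.Theorems.CnfIdealGenLengthRankDefectRepresentationsTwoFamilyCutDomination.colourJ (col y) ∈ B')) →
          N x y = D x y :=
  Summit.PneNP.PneNP.Theorems.CnfIdealGenLengthRankDefectRepresentationsQuadrantCapture.stub_quadrantCapture

/-- QUADRANT CAPTURE always applies: a maximiser of the double cut exists (finitely many pairs), so every instance with double cuts `≤ c`
agrees outside the four quadrants of SOME pair `(B, B′)` with a matrix of rank `≤ 17c` (from `stub_quadrantCapture`). -/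
theorem quadrant_reduction_of_stub (K : Type) [Field K] (n n' : ℕ) (ι ι' : Type) [Fintype ι] [Fintype ι'] [DecidableEq ι]
    [DecidableEq ι'] (row : ι → Fin n ⊕ Fin n' → Bool) (col : ι' → Fin n ⊕ Fin n' → Bool) (D : Matrix ι ι' K) (c : ℕ)
    (hc : ∀ A A', Summit.PneNP.PneNP.Theorems.CnfIdealGenLengthRankDefectRepresentationsTwoFamilyCutDomination.doubleCut
      row col A A' D ≤ c) :
    ∃ (B : Finset (Fin n → Bool)) (B' : Finset (Fin n' → Bool)) (N : Matrix ι ι' K), N.rank ≤ 17 * c ∧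
      ∀ x y,
        Summit.PneNP.PneNP.Theorems.CnfIdealGenLengthRankDefectRepresentationsTwoFamilyCutDomination.colourI (row x) ≠
          Summit.PneNP.PneNP.Theorems.CnfIdealGenLengthRankDefectRepresentationsTwoFamilyCutDomination.colourI (col y) →
        Summit.PneNP.PneNP.Theorems.CnfIdealGenLengthRankDefectRepresentationsTwoFamilyCutDomination.colourJ (row x) ≠
          Summit.PneNP.PneNP.Theorems.CnfIdealGenLengthRankDefectRepresentationsTwoFamilyCutDomination.colourJ (col y) →
        ((Summit.PneNP.PneNP.Theorems.CnfIdealGenLengthRankDefectRepresentationsTwoFamilyCutDomination.colourI (row x) ∈ B) ≠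
            (Summit.PneNP.PneNP.Theorems.CnfIdealGenLengthRankDefectRepresentationsTwoFamilyCutDomination.colourI (col y) ∈ B) ∨
          (Summit.PneNP.PneNP.Theorems.CnfIdealGenLengthRankDefectRepresentationsTwoFamilyCutDomination.colourJ (row x) ∈ B') ≠
            (Summit.PneNP.PneNP.Theorems.CnfIdealGenLengthRankDefectRepresentationsTwoFamilyCutDomination.colourJ (col y) ∈ B')) →
        N x y = D x y := by
  classical
  let μ : Finset (Fin n → Bool) × Finset (Fin n' → Bool) → ℕ := fun P =>
    Summit.PneNP.PneNP.Theorems.CnfIdealGenLengthRankDefectRepresentationsTwoFamilyCutDomination.doubleCut row col P.1 P.2 D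
  obtain ⟨P, -, hP⟩ := Finset.exists_max_image (Finset.univ : Finset (Finset (Fin n → Bool) × Finset (Fin n' → Bool))) μ
    Finset.univ_nonempty
  obtain ⟨N, hN, hND⟩ := stub_quadrantCapture K n n' ι ι' row col D c P.1 P.2
    (fun A A' => hP (A, A') (Finset.mem_univ _)) (hc P.1 P.2)
  exact ⟨P.1, P.2, N, hN, hND⟩

/-- TOOL stub (lead g15 RESHAPE 9) = HALVES BUDGET ADDITIVITY (TRUE, worker-sized; memo `Lines/rank-dehn-ladder-g15.md` §2).  In the MERGE
setting (`n'+1` second-family coordinates, ZERO cross data at the last coordinate) every double cut of `D` is the SUM of the corresponding double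
cuts of the two halves `{σ_last = b}` (each half as the matrix of cells whose row AND column last bits are `b`, the second-family set restricted to
the colours with last bit `b`): the `B′`-mask of each half only sees the colours of its own half, and the two masked halves have disjoint row
supports and disjoint column supports, so ranks add (`Summit.PneNP.PneNP.Theorems.CnfIdealGenLengthRankDefectRepresentationsQuadrantCapture.rank_add_of_disjoint`).  This is the exact "budget splitting pointwise in the
first-family argument `B`" of g14 §7(b): for every `B`, the two halves' second-family profiles at `B` add up inside the budget.  Consumed by
`halves_profile_split` below and by every MERGE / adjacent-splitting argument.  [CLOSED — stub-worker bench-…-halvesBudget, p708144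
`Theorems/…HalvesBudget`] -/
theorem stub_halvesBudget :
    ∀ (K : Type) [Field K] (n n' : ℕ) (ι ι' : Type) [Fintype ι] [Fintype ι'] [DecidableEq ι] [DecidableEq ι']
      (row : ι → Fin n ⊕ Fin (n' + 1) → Bool) (col : ι' → Fin n ⊕ Fin (n' + 1) → Bool) (D : Matrix ι ι' K),
      (∀ x y, row x (Sum.inr (Fin.last n')) ≠ col y (Sum.inr (Fin.last n')) → D x y = 0) →
      ∀ (B : Finset (Fin n → Bool)) (B' : Finset (Fin (n' + 1) → Bool)),
        Summit.PneNP.PneNP.Theorems.CnfIdealGenLengthRankDefectRepresentationsTwoFamilyCutDomination.doubleCut row col B B' D =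
          Summit.PneNP.PneNP.Theorems.CnfIdealGenLengthRankDefectRepresentationsTwoFamilyCutDomination.doubleCut row col B
              (B'.filter fun σ => σ (Fin.last n') = false)
              (Matrix.of fun x y =>
                if row x (Sum.inr (Fin.last n')) = false ∧ col y (Sum.inr (Fin.last n')) = false then D x y else 0) +
          Summit.PneNP.PneNP.Theorems.CnfIdealGenLengthRankDefectRepresentationsTwoFamilyCutDomination.doubleCut row col B
              (B'.filter fun σ => σ (Fin.last n') = true)
              (Matrix.of fun x y =>
                if row x (Sum.inr (Fin.last n')) = true ∧ col y (Sum.inr (Fin.last n')) = true then D x y else 0) :=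
  Summit.PneNP.PneNP.Theorems.CnfIdealGenLengthRankDefectRepresentationsHalvesBudget.stub_halvesBudget

/-- TOOL stub (lead g15 RESHAPE 9) = SHARP ANTIPODAL DOMINATION, constant ONE (TRUE, worker-sized; memo `Lines/rank-dehn-ladder-g15.md` §3;
sharpens lead g14's `Theorems/…AntipodalDomination` (p705259), which has the constant `4`).  Fix a double cut `(B, B′)` and ANY sub-rectangle
`(S₁ ⊆ B, S′₁ ⊆ B′)` of the quadrant `B × B′` (rows of types `S₁ × S′₁`, columns of types `(B ∖ S₁) × (B′ ∖ S′₁)`), of rank `a`.  Then ONE matrix `W`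
of rank `≤ a` makes every internal rectangle of the ANTIPODAL quadrant `Bᶜ × B′ᶜ` of `D − W` have rank `≤ c₀ − a`, where `c₀` bounds the ranks of
the (first) rectangles `rect B B′ true true D` of `D`.  Proof: take an invertible `a × a` minor `A = D[X₀,Y₀]` of the sub-rectangle
(`Summit.HodgeConjecture.HodgeConjecture.Theorems.HodgeLocusCensusRankReduction.exists_submatrix_det_ne_zero`) and `W := D[·,Y₀] A⁻¹ D[X₀,·]`; for
`S₂ ⊆ Bᶜ, S′₂ ⊆ B′ᶜ` the block matrix `[[A, E],[F, G]]` (rows `X₀ ∪` rows of types `S₂ × S′₂`, columns `Y₀ ∪` columns of types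
`(Bᶜ∖S₂) × (B′ᶜ∖S′₂)`) is a submatrix of the rectangle `rect (S₁ ∪ S₂) (S′₁ ∪ S′₂) true true D`, hence of rank `≤ c₀`, and `A` invertible gives
`rank (G − F A⁻¹ E) = rank [[A,E],[F,G]] − a` (`Matrix.fromBlocks_eq_of_invertible₁₁` + block-diagonal rank).  So after paying `rank W ≤ a ≤ c₀`
the two antipodal quadrants' rectangle budgets split EXACTLY (`a + (c₀ − a)`).  Consumed by `antipodal_split_of_stub` below; first input of
the quadrant recursion (memo §4).  [CLOSED — lead g15, p708234 `Theorems/…SharpAntipodal` (tools `rank_padded_eq`, `rank_fromBlocks_diagonal`,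
`rank_fromBlocks_of_invertible₁₁`)] -/
theorem stub_sharpAntipodal :
    ∀ (K : Type) [Field K] (n n' : ℕ) (ι ι' : Type) [Fintype ι] [Fintype ι'] [DecidableEq ι] [DecidableEq ι']
      (row : ι → Fin n ⊕ Fin n' → Bool) (col : ι' → Fin n ⊕ Fin n' → Bool) (D : Matrix ι ι' K) (c₀ : ℕ),
      (∀ B B', (Summit.PneNP.PneNP.Theorems.CnfIdealGenLengthRankDefectRepresentationsQuadrantCapture.rect row col B B' true true D).rank ≤ c₀) →
      ∀ (B S₁ : Finset (Fin n → Bool)) (B' S'₁ : Finset (Fin n' → Bool)), S₁ ⊆ B → S'₁ ⊆ B' →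
        ∃ W : Matrix ι ι' K,
          W.rank ≤ (Matrix.of fun x y =>
              if Summit.PneNP.PneNP.Theorems.CnfIdealGenLengthRankDefectRepresentationsTwoFamilyCutDomination.colourI (row x) ∈ S₁ ∧
                  Summit.PneNP.PneNP.Theorems.CnfIdealGenLengthRankDefectRepresentationsTwoFamilyCutDomination.colourJ (row x) ∈ S'₁ ∧
                  Summit.PneNP.PneNP.Theorems.CnfIdealGenLengthRankDefectRepresentationsTwoFamilyCutDomination.colourI (col y) ∈ B \ S₁ ∧
                  Summit.PneNP.PneNP.Theorems.CnfIdealGenLengthRankDefectRepresentationsTwoFamilyCutDomination.colourJ (col y) ∈ B' \ S'₁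
              then D x y else 0).rank ∧
          ∀ (S₂ : Finset (Fin n → Bool)) (S'₂ : Finset (Fin n' → Bool)), S₂ ⊆ Bᶜ → S'₂ ⊆ B'ᶜ →
            (Matrix.of fun x y =>
                if Summit.PneNP.PneNP.Theorems.CnfIdealGenLengthRankDefectRepresentationsTwoFamilyCutDomination.colourI (row x) ∈ S₂ ∧
                    Summit.PneNP.PneNP.Theorems.CnfIdealGenLengthRankDefectRepresentationsTwoFamilyCutDomination.colourJ (row x) ∈ S'₂ ∧
                    Summit.PneNP.PneNP.Theorems.CnfIdealGenLengthRankDefectRepresentationsTwoFamilyCutDomination.colourI (col y) ∈ Bᶜ \ S₂ ∧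
                    Summit.PneNP.PneNP.Theorems.CnfIdealGenLengthRankDefectRepresentationsTwoFamilyCutDomination.colourJ (col y) ∈ B'ᶜ \ S'₂
                then (D - W) x y else 0).rank +
              (Matrix.of fun x y =>
                if Summit.PneNP.PneNP.Theorems.CnfIdealGenLengthRankDefectRepresentationsTwoFamilyCutDomination.colourI (row x) ∈ S₁ ∧
                    Summit.PneNP.PneNP.Theorems.CnfIdealGenLengthRankDefectRepresentationsTwoFamilyCutDomination.colourJ (row x) ∈ S'₁ ∧
                    Summit.PneNP.PneNP.Theorems.CnfIdealGenLengthRankDefectRepresentationsTwoFamilyCutDomination.colourI (col y) ∈ B \ S₁ ∧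
                    Summit.PneNP.PneNP.Theorems.CnfIdealGenLengthRankDefectRepresentationsTwoFamilyCutDomination.colourJ (col y) ∈ B' \ S'₁
                then D x y else 0).rank ≤ c₀ :=
  Summit.PneNP.PneNP.Theorems.CnfIdealGenLengthRankDefectRepresentationsSharpAntipodal.stub_sharpAntipodal

/-- TOOL stub (lead g15 RESHAPE 10; the LEAD's, OPEN) = ADJACENT SPLITTING (AS), the BUDGET form of MERGE (memo `Lines/rank-dehn-ladder-g15.md` §4).
For a two-family instance with `n'+1` second-family coordinates and all double cuts `≤ c` there is a matrix `G` VANISHING ON THE CROSS CELLS of the last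
second-family coordinate, of rank `≤ C·c` with `C = C₀ (n+n'+2)^e` polynomial in the number of coordinates, such that the two HALVES `{σ_last = b}` of
`D − G` (as instances with `n'` second-family coordinates, `…MergeReduction.rowHalf/colHalf`) have double-cut budgets `c₀, c₁` with `c₀ + c₁ ≤ c` —
the budgets SPLIT EXACTLY after a cheap surgery.  CORE-LINEAR ⟹ AS (take `G` = the two completions); AS ⟹ the registered 2D decomposition with
`λ = (4 + C)·n'` (`stub_splitReduction`, TRUE, worker W4; composition `doubleMaxCut_of_adjacentSplitting` below).  Antipodal quadrant pairs split
exactly by `stub_sharpAntipodal` (p708234); AS is what remains for adjacent pairs / halves.  [OPEN — registered; the lead's stub; its failure mode is an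
"alternating tower" of halves whose first-family profiles peak at different cuts, memo §4] -/
theorem stub_adjacentSplitting :
    ∃ C₀ e : ℕ, ∀ (K : Type) [Field K] (n n' : ℕ),
      (∀ (ι ι' : Type) [Fintype ι] [Fintype ι'] [DecidableEq ι] [DecidableEq ι']
          (row : ι → Fin n ⊕ Fin (n' + 1) → Bool) (col : ι' → Fin n ⊕ Fin (n' + 1) → Bool) (D : Matrix ι ι' K) (c : ℕ),
          (∀ B B', Summit.PneNP.PneNP.Theorems.CnfIdealGenLengthRankDefectRepresentationsTwoFamilyCutDomination.doubleCut row col B B' D ≤ c) →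
          ∃ G : Matrix ι ι' K,
            (∀ x y, row x (Sum.inr (Fin.last n')) ≠ col y (Sum.inr (Fin.last n')) → G x y = 0) ∧
            G.rank ≤ (C₀ * (n + n' + 2) ^ e) * c ∧
            ∃ c₀ c₁ : ℕ, c₀ + c₁ ≤ c ∧
              (∀ B B', Summit.PneNP.PneNP.Theorems.CnfIdealGenLengthRankDefectRepresentationsTwoFamilyCutDomination.doubleCut
                  (Summit.PneNP.PneNP.Theorems.CnfIdealGenLengthRankDefectRepresentationsMergeReduction.rowHalf row false)
                  (Summit.PneNP.PneNP.Theorems.CnfIdealGenLengthRankDefectRepresentationsMergeReduction.colHalf col false) B B'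
                  ((D - G).submatrix Subtype.val Subtype.val) ≤ c₀) ∧
              (∀ B B', Summit.PneNP.PneNP.Theorems.CnfIdealGenLengthRankDefectRepresentationsTwoFamilyCutDomination.doubleCut
                  (Summit.PneNP.PneNP.Theorems.CnfIdealGenLengthRankDefectRepresentationsMergeReduction.rowHalf row true)
                  (Summit.PneNP.PneNP.Theorems.CnfIdealGenLengthRankDefectRepresentationsMergeReduction.colHalf col true) B B'
                  ((D - G).submatrix Subtype.val Subtype.val) ≤ c₁)) :=
  Summit.PneNP.PneNP.Theorems.CnfIdealGenLengthRankDefectRepresentationsCloseFour.adjacentSplitting_of_four (fun K _ n n' => doubleMaxCut_four K n n')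

/-- TOOL stub (lead g15 RESHAPE 10; TRUE, worker W4) = the SPLIT REDUCTION: adjacent splitting with a constant polynomial in the number of coordinates
implies the registered 2D max-cut decomposition with a polynomial constant.  Proof = the un-crossing induction of
`…MergeReduction.doubleMaxCut_of_merge_le` (p702065) with step (3) replaced: subtract `G`, apply the induction hypothesis to the two halves of `D − G`
(budgets `c₀ + c₁ ≤ c`), extend the half decompositions by zero (`exists_halfCompletion`-style, keeping `S_I, S_J, L` separately), and collect
`L = (X − R′) + G + L₀ + L₁`: `M(n''+1) = M(n'') + 4 + C`, so `λ(n') ≤ (4 + C₀ (n+n'+1)^e)·n' ≤ (4 + C₀)(n+n'+1)^(e+1)`.  [CLOSED — stub-worker on lead g15 brief W4, p709975 `Theorems/…SplitReduction`] -/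
theorem stub_splitReduction :
    ∀ C₀ e : ℕ, (∀ (K : Type) [Field K] (n n' : ℕ),
      (∀ (ι ι' : Type) [Fintype ι] [Fintype ι'] [DecidableEq ι] [DecidableEq ι']
          (row : ι → Fin n ⊕ Fin (n' + 1) → Bool) (col : ι' → Fin n ⊕ Fin (n' + 1) → Bool) (D : Matrix ι ι' K) (c : ℕ),
          (∀ B B', Summit.PneNP.PneNP.Theorems.CnfIdealGenLengthRankDefectRepresentationsTwoFamilyCutDomination.doubleCut row col B B' D ≤ c) →
          ∃ G : Matrix ι ι' K,
            (∀ x y, row x (Sum.inr (Fin.last n')) ≠ col y (Sum.inr (Fin.last n')) → G x y = 0) ∧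
            G.rank ≤ (C₀ * (n + n' + 2) ^ e) * c ∧
            ∃ c₀ c₁ : ℕ, c₀ + c₁ ≤ c ∧
              (∀ B B', Summit.PneNP.PneNP.Theorems.CnfIdealGenLengthRankDefectRepresentationsTwoFamilyCutDomination.doubleCut
                  (Summit.PneNP.PneNP.Theorems.CnfIdealGenLengthRankDefectRepresentationsMergeReduction.rowHalf row false)
                  (Summit.PneNP.PneNP.Theorems.CnfIdealGenLengthRankDefectRepresentationsMergeReduction.colHalf col false) B B'
                  ((D - G).submatrix Subtype.val Subtype.val) ≤ c₀) ∧
              (∀ B B', Summit.PneNP.PneNP.Theorems.CnfIdealGenLengthRankDefectRepresentationsTwoFamilyCutDomination.doubleCut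
                  (Summit.PneNP.PneNP.Theorems.CnfIdealGenLengthRankDefectRepresentationsMergeReduction.rowHalf row true)
                  (Summit.PneNP.PneNP.Theorems.CnfIdealGenLengthRankDefectRepresentationsMergeReduction.colHalf col true) B B'
                  ((D - G).submatrix Subtype.val Subtype.val) ≤ c₁))) →
      ∃ L e' : ℕ, ∀ (K : Type) [Field K] (n n' : ℕ),
        Summit.PneNP.PneNP.Theorems.CnfIdealGenLengthRankDefectRepresentationsTwoFamilyCutDomination.DoubleMaxCutDecomposition K n n' (L * (n + n' + 1) ^ e') :=
  Summit.PneNP.PneNP.Theorems.CnfIdealGenLengthRankDefectRepresentationsSplitReduction.stub_splitReduction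

/-- The registered 2D max-cut decomposition from ADJACENT SPLITTING (alternative to the MERGE route `stub_doubleMaxCutDecomposition`). -/
theorem doubleMaxCut_of_adjacentSplitting :
    ∃ L e : ℕ, ∀ (K : Type) [Field K] (n n' : ℕ),
      Summit.PneNP.PneNP.Theorems.CnfIdealGenLengthRankDefectRepresentationsTwoFamilyCutDomination.DoubleMaxCutDecomposition K n n' (L * (n + n' + 1) ^ e) := by
  obtain ⟨C₀, e, h⟩ := stub_adjacentSplitting
  exact stub_splitReduction C₀ e h

/-- TOOL stub (lead g15 RESHAPE 10; TRUE, worker W5) = ADJACENT DOMINATION ON AN INTERVAL (memo §4): for a double cut `(B,B′)`, disjoint first-family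
label sets `U, V ⊆ B` and `S′₁ ⊆ B′`, an invertible maximal minor of the sub-rectangle of the quadrant `B × B′` with rows of types `U × S′₁` and columns of
types `V × (B′∖S′₁)` (rank `a`) yields ONE `W` of rank `≤ a` such that EVERY internal rectangle `R¹²(S,T′)` (rows `S × T′`, columns `(B∖S) × (B′ᶜ∖T′)`)
of the ADJACENT quadrant `B × B′ᶜ` of `D − W` with `U ⊆ S ⊆ B∖V` has rank `≤ c₀ − a`.  Same Schur proof as `stub_sharpAntipodal` (p708234): the block
matrix `[[A,E],[F,R¹²(S,T′)]]` is a submatrix of `rect row col S (S′₁ ∪ T′) true true D`.  It records exactly how far Schur domination reaches for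
adjacent pairs: one anchor serves the interval `[U, B∖V]` of first-family sets, not all of them.  [CLOSED — stub-worker on lead g15 brief W5, p709899 `Theorems/…AdjacentInterval`] -/
theorem stub_adjacentInterval :
    ∀ (K : Type) [Field K] (n n' : ℕ) (ι ι' : Type) [Fintype ι] [Fintype ι'] [DecidableEq ι] [DecidableEq ι']
      (row : ι → Fin n ⊕ Fin n' → Bool) (col : ι' → Fin n ⊕ Fin n' → Bool) (D : Matrix ι ι' K) (c₀ : ℕ),
      (∀ B B', (Summit.PneNP.PneNP.Theorems.CnfIdealGenLengthRankDefectRepresentationsQuadrantCapture.rect row col B B' true true D).rank ≤ c₀) →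
      ∀ (B U V : Finset (Fin n → Bool)) (B' S'₁ : Finset (Fin n' → Bool)), U ⊆ B → V ⊆ B → Disjoint U V → S'₁ ⊆ B' →
        ∃ W : Matrix ι ι' K,
          W.rank ≤ (Matrix.of fun x y =>
              if Summit.PneNP.PneNP.Theorems.CnfIdealGenLengthRankDefectRepresentationsTwoFamilyCutDomination.colourI (row x) ∈ U ∧
                  Summit.PneNP.PneNP.Theorems.CnfIdealGenLengthRankDefectRepresentationsTwoFamilyCutDomination.colourJ (row x) ∈ S'₁ ∧
                  Summit.PneNP.PneNP.Theorems.CnfIdealGenLengthRankDefectRepresentationsTwoFamilyCutDomination.colourI (col y) ∈ V ∧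
                  Summit.PneNP.PneNP.Theorems.CnfIdealGenLengthRankDefectRepresentationsTwoFamilyCutDomination.colourJ (col y) ∈ B' \ S'₁
              then D x y else 0).rank ∧
          ∀ (S : Finset (Fin n → Bool)) (T' : Finset (Fin n' → Bool)), U ⊆ S → S ⊆ B \ V → T' ⊆ B'ᶜ →
            (Matrix.of fun x y =>
                if Summit.PneNP.PneNP.Theorems.CnfIdealGenLengthRankDefectRepresentationsTwoFamilyCutDomination.colourI (row x) ∈ S ∧
                    Summit.PneNP.PneNP.Theorems.CnfIdealGenLengthRankDefectRepresentationsTwoFamilyCutDomination.colourJ (row x) ∈ T' ∧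
                    Summit.PneNP.PneNP.Theorems.CnfIdealGenLengthRankDefectRepresentationsTwoFamilyCutDomination.colourI (col y) ∈ B \ S ∧
                    Summit.PneNP.PneNP.Theorems.CnfIdealGenLengthRankDefectRepresentationsTwoFamilyCutDomination.colourJ (col y) ∈ B'ᶜ \ T'
                then (D - W) x y else 0).rank +
              (Matrix.of fun x y =>
                if Summit.PneNP.PneNP.Theorems.CnfIdealGenLengthRankDefectRepresentationsTwoFamilyCutDomination.colourI (row x) ∈ U ∧
                    Summit.PneNP.PneNP.Theorems.CnfIdealGenLengthRankDefectRepresentationsTwoFamilyCutDomination.colourJ (row x) ∈ S'₁ ∧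
                    Summit.PneNP.PneNP.Theorems.CnfIdealGenLengthRankDefectRepresentationsTwoFamilyCutDomination.colourI (col y) ∈ V ∧
                    Summit.PneNP.PneNP.Theorems.CnfIdealGenLengthRankDefectRepresentationsTwoFamilyCutDomination.colourJ (col y) ∈ B' \ S'₁
                then D x y else 0).rank ≤ c₀ :=
  Summit.PneNP.PneNP.Theorems.CnfIdealGenLengthRankDefectRepresentationsAdjacentInterval.stub_adjacentInterval

/-- ADJACENT DOMINATION under the double-cut budget (from `stub_adjacentInterval`): the first rectangle is one summand of the double cut. -/
theorem adjacent_interval_of_stub (K : Type) [Field K] (n n' : ℕ) (ι ι' : Type) [Fintype ι] [Fintype ι'] [DecidableEq ι] [DecidableEq ι']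
    (row : ι → Fin n ⊕ Fin n' → Bool) (col : ι' → Fin n ⊕ Fin n' → Bool) (D : Matrix ι ι' K) (c : ℕ)
    (hc : ∀ B B', Summit.PneNP.PneNP.Theorems.CnfIdealGenLengthRankDefectRepresentationsTwoFamilyCutDomination.doubleCut row col B B' D ≤ c)
    (B U V : Finset (Fin n → Bool)) (B' S'₁ : Finset (Fin n' → Bool)) (hU : U ⊆ B) (hV : V ⊆ B) (hUV : Disjoint U V) (hS' : S'₁ ⊆ B') :
    ∃ W : Matrix ι ι' K,
      W.rank ≤ (Matrix.of fun x y =>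
          if Summit.PneNP.PneNP.Theorems.CnfIdealGenLengthRankDefectRepresentationsTwoFamilyCutDomination.colourI (row x) ∈ U ∧
              Summit.PneNP.PneNP.Theorems.CnfIdealGenLengthRankDefectRepresentationsTwoFamilyCutDomination.colourJ (row x) ∈ S'₁ ∧
              Summit.PneNP.PneNP.Theorems.CnfIdealGenLengthRankDefectRepresentationsTwoFamilyCutDomination.colourI (col y) ∈ V ∧
              Summit.PneNP.PneNP.Theorems.CnfIdealGenLengthRankDefectRepresentationsTwoFamilyCutDomination.colourJ (col y) ∈ B' \ S'₁
          then D x y else 0).rank ∧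
      ∀ (S : Finset (Fin n → Bool)) (T' : Finset (Fin n' → Bool)), U ⊆ S → S ⊆ B \ V → T' ⊆ B'ᶜ →
        (Matrix.of fun x y =>
            if Summit.PneNP.PneNP.Theorems.CnfIdealGenLengthRankDefectRepresentationsTwoFamilyCutDomination.colourI (row x) ∈ S ∧
                Summit.PneNP.PneNP.Theorems.CnfIdealGenLengthRankDefectRepresentationsTwoFamilyCutDomination.colourJ (row x) ∈ T' ∧
                Summit.PneNP.PneNP.Theorems.CnfIdealGenLengthRankDefectRepresentationsTwoFamilyCutDomination.colourI (col y) ∈ B \ S ∧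
                Summit.PneNP.PneNP.Theorems.CnfIdealGenLengthRankDefectRepresentationsTwoFamilyCutDomination.colourJ (col y) ∈ B'ᶜ \ T'
            then (D - W) x y else 0).rank +
          (Matrix.of fun x y =>
            if Summit.PneNP.PneNP.Theorems.CnfIdealGenLengthRankDefectRepresentationsTwoFamilyCutDomination.colourI (row x) ∈ U ∧
                Summit.PneNP.PneNP.Theorems.CnfIdealGenLengthRankDefectRepresentationsTwoFamilyCutDomination.colourJ (row x) ∈ S'₁ ∧
                Summit.PneNP.PneNP.Theorems.CnfIdealGenLengthRankDefectRepresentationsTwoFamilyCutDomination.colourI (col y) ∈ V ∧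
                Summit.PneNP.PneNP.Theorems.CnfIdealGenLengthRankDefectRepresentationsTwoFamilyCutDomination.colourJ (col y) ∈ B' \ S'₁
            then D x y else 0).rank ≤ c := by
  refine stub_adjacentInterval K n n' ι ι' row col D c (fun A A' => ?_) B U V B' S'₁ hU hV hUV hS'
  have h4 := Summit.PneNP.PneNP.Theorems.CnfIdealGenLengthRankDefectRepresentationsQuadrantCapture.doubleCut_eq_sum_four row col A A' D
  have := hc A A'
  omega

/-- TOOL stub (lead g15 RESHAPE 10b; TRUE, worker W6) = the TWO-HALVES DISCOUNT (memo `Lines/rank-dehn-ladder-g15.md` §7): in the MERGE setting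
(zero cross data at the last second-family coordinate, all double cuts `≤ c`) the two halves cannot BOTH carry (nearly) the full budget:
`65·(Φ₀ + Φ₁) ≤ 129·c` for every double cut `Φ₀` of half `0` and every double cut `Φ₁` of half `1` (so `max + max ≤ (2 − 1/65)·c`).  Proof (paper, §7):
let the maxima `m_b` be attained at `(B_b, B′_b)` and `δ_b := c − m_b`; by `stub_halvesBudget` the other half has profile `≤ δ_b` at `B_b`, so Theorem 2
(`exists_blockDiagonal_of_cuts_le` with the SECOND-family colouring, applied to half `1−b` masked to the `B_b`-separated cells, whose bipartition cuts are
double cuts `≤ δ_b`) makes half `1−b` an exact first-family direct sum across `B_b` at rank cost `4δ_b` (double cuts move by `≤ 16δ_b`,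
`doubleCut_le_four_mul_rank` + subadditivity); for an exact direct sum across `B_b` the profile is invariant under complementing the cut inside one side, so at
`B̃ := (B₀ ∩ B₁) ∪ (B₀ᶜ ∩ B₁ᶜ)` BOTH modified halves show their maxima: `(m₀ − 16δ₁) + (m₁ − 16δ₀) ≤ c + 16(δ₀ + δ₁)`, i.e. `33(m₀+m₁) ≤ 65c`; the registered
constant `65/129` leaves a factor-2 margin in the bookkeeping.  Consequence (memo §7): the halving recursion branches with factor `129/65 < 2`, giving
`mc ≤ O(c · k′^(log₂(129/65))) = O(c · k′^0.989)` — the first bound uniform in `c` that beats the trivial exponent `1` in the number of classes.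
[CLOSED — stub-worker on lead g15 brief W6, p710348 `Theorems/…HalvesDiscount`; the recursion consequence in this docstring is RETRACTED (memo g15 §7c: the un-crossed instance has budget 2c, where the discount is vacuous)] -/
theorem stub_halvesDiscount :
    ∀ (K : Type) [Field K] (n n' : ℕ) (ι ι' : Type) [Fintype ι] [Fintype ι'] [DecidableEq ι] [DecidableEq ι']
      (row : ι → Fin n ⊕ Fin (n' + 1) → Bool) (col : ι' → Fin n ⊕ Fin (n' + 1) → Bool) (D : Matrix ι ι' K) (c : ℕ),
      (∀ B B', Summit.PneNP.PneNP.Theorems.CnfIdealGenLengthRankDefectRepresentationsTwoFamilyCutDomination.doubleCut row col B B' D ≤ c) →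
      (∀ x y, row x (Sum.inr (Fin.last n')) ≠ col y (Sum.inr (Fin.last n')) → D x y = 0) →
      ∀ (B₀ B₁ : Finset (Fin n → Bool)) (B'₀ B'₁ : Finset (Fin (n' + 1) → Bool)),
        65 * (Summit.PneNP.PneNP.Theorems.CnfIdealGenLengthRankDefectRepresentationsTwoFamilyCutDomination.doubleCut row col B₀ B'₀
              (Matrix.of fun x y =>
                if row x (Sum.inr (Fin.last n')) = false ∧ col y (Sum.inr (Fin.last n')) = false then D x y else 0) +
            Summit.PneNP.PneNP.Theorems.CnfIdealGenLengthRankDefectRepresentationsTwoFamilyCutDomination.doubleCut row col B₁ B'₁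
              (Matrix.of fun x y =>
                if row x (Sum.inr (Fin.last n')) = true ∧ col y (Sum.inr (Fin.last n')) = true then D x y else 0)) ≤ 129 * c :=
  Summit.PneNP.PneNP.Theorems.CnfIdealGenLengthRankDefectRepresentationsHalvesDiscount.stub_halvesDiscount

/-- HALVES PROFILE SPLITTING (from `stub_halvesBudget`): in the MERGE setting, for every first-family set `B` the double cuts of the two halves
at `B` ADD UP inside the budget `c` — the second-family profiles of the halves are complementary pointwise in `B`. -/
theorem halves_profile_split (K : Type) [Field K] (n n' : ℕ) (ι ι' : Type) [Fintype ι] [Fintype ι'] [DecidableEq ι] [DecidableEq ι']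
    (row : ι → Fin n ⊕ Fin (n' + 1) → Bool) (col : ι' → Fin n ⊕ Fin (n' + 1) → Bool) (D : Matrix ι ι' K) (c : ℕ)
    (hc : ∀ B B', Summit.PneNP.PneNP.Theorems.CnfIdealGenLengthRankDefectRepresentationsTwoFamilyCutDomination.doubleCut row col B B' D ≤ c)
    (hcross : ∀ x y, row x (Sum.inr (Fin.last n')) ≠ col y (Sum.inr (Fin.last n')) → D x y = 0)
    (B : Finset (Fin n → Bool)) (B'₀ B'₁ : Finset (Fin (n' + 1) → Bool))
    (h₀ : ∀ σ ∈ B'₀, σ (Fin.last n') = false) (h₁ : ∀ σ ∈ B'₁, σ (Fin.last n') = true) :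
    Summit.PneNP.PneNP.Theorems.CnfIdealGenLengthRankDefectRepresentationsTwoFamilyCutDomination.doubleCut row col B B'₀
        (Matrix.of fun x y =>
          if row x (Sum.inr (Fin.last n')) = false ∧ col y (Sum.inr (Fin.last n')) = false then D x y else 0) +
      Summit.PneNP.PneNP.Theorems.CnfIdealGenLengthRankDefectRepresentationsTwoFamilyCutDomination.doubleCut row col B B'₁
        (Matrix.of fun x y =>
          if row x (Sum.inr (Fin.last n')) = true ∧ col y (Sum.inr (Fin.last n')) = true then D x y else 0) ≤ c := by
  classical
  have h := stub_halvesBudget K n n' ι ι' row col D hcross B (B'₀ ∪ B'₁)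
  have e₀ : (B'₀ ∪ B'₁).filter (fun σ => σ (Fin.last n') = false) = B'₀ := by
    ext σ
    simp only [Finset.mem_filter, Finset.mem_union]
    constructor
    · rintro ⟨h | h, hσ⟩
      · exact h
      · exact absurd hσ (by simp [h₁ σ h])
    · intro h; exact ⟨Or.inl h, h₀ σ h⟩
  have e₁ : (B'₀ ∪ B'₁).filter (fun σ => σ (Fin.last n') = true) = B'₁ := by
    ext σ
    simp only [Finset.mem_filter, Finset.mem_union]
    constructor
    · rintro ⟨h | h, hσ⟩
      · exact absurd hσ (by simp [h₀ σ h])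
      · exact h
    · intro h; exact ⟨Or.inr h, h₁ σ h⟩
  rw [e₀, e₁] at h
  rw [← h]
  exact hc B _

/-- ANTIPODAL BUDGET SPLITTING (from `stub_sharpAntipodal`): under the double-cut budget `c`, at every double cut `(B,B′)` and for every
sub-rectangle of the quadrant `B × B′`, ONE matrix of rank at most that sub-rectangle's rank makes the antipodal quadrant's internal rectangle
budget complementary to it (the first rectangle of a double cut is one of its four summands, `Summit.PneNP.PneNP.Theorems.CnfIdealGenLengthRankDefectRepresentationsQuadrantCapture.doubleCut_eq_sum_four`). -/
theorem antipodal_split_of_stub (K : Type) [Field K] (n n' : ℕ) (ι ι' : Type) [Fintype ι] [Fintype ι'] [DecidableEq ι] [DecidableEq ι']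
    (row : ι → Fin n ⊕ Fin n' → Bool) (col : ι' → Fin n ⊕ Fin n' → Bool) (D : Matrix ι ι' K) (c : ℕ)
    (hc : ∀ B B', Summit.PneNP.PneNP.Theorems.CnfIdealGenLengthRankDefectRepresentationsTwoFamilyCutDomination.doubleCut row col B B' D ≤ c)
    (B S₁ : Finset (Fin n → Bool)) (B' S'₁ : Finset (Fin n' → Bool)) (hS : S₁ ⊆ B) (hS' : S'₁ ⊆ B') :
    ∃ W : Matrix ι ι' K,
      W.rank ≤ (Matrix.of fun x y =>
          if Summit.PneNP.PneNP.Theorems.CnfIdealGenLengthRankDefectRepresentationsTwoFamilyCutDomination.colourI (row x) ∈ S₁ ∧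
              Summit.PneNP.PneNP.Theorems.CnfIdealGenLengthRankDefectRepresentationsTwoFamilyCutDomination.colourJ (row x) ∈ S'₁ ∧
              Summit.PneNP.PneNP.Theorems.CnfIdealGenLengthRankDefectRepresentationsTwoFamilyCutDomination.colourI (col y) ∈ B \ S₁ ∧
              Summit.PneNP.PneNP.Theorems.CnfIdealGenLengthRankDefectRepresentationsTwoFamilyCutDomination.colourJ (col y) ∈ B' \ S'₁
          then D x y else 0).rank ∧
      ∀ (S₂ : Finset (Fin n → Bool)) (S'₂ : Finset (Fin n' → Bool)), S₂ ⊆ Bᶜ → S'₂ ⊆ B'ᶜ →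
        (Matrix.of fun x y =>
            if Summit.PneNP.PneNP.Theorems.CnfIdealGenLengthRankDefectRepresentationsTwoFamilyCutDomination.colourI (row x) ∈ S₂ ∧
                Summit.PneNP.PneNP.Theorems.CnfIdealGenLengthRankDefectRepresentationsTwoFamilyCutDomination.colourJ (row x) ∈ S'₂ ∧
                Summit.PneNP.PneNP.Theorems.CnfIdealGenLengthRankDefectRepresentationsTwoFamilyCutDomination.colourI (col y) ∈ Bᶜ \ S₂ ∧
                Summit.PneNP.PneNP.Theorems.CnfIdealGenLengthRankDefectRepresentationsTwoFamilyCutDomination.colourJ (col y) ∈ B'ᶜ \ S'₂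
            then (D - W) x y else 0).rank +
          (Matrix.of fun x y =>
            if Summit.PneNP.PneNP.Theorems.CnfIdealGenLengthRankDefectRepresentationsTwoFamilyCutDomination.colourI (row x) ∈ S₁ ∧
                Summit.PneNP.PneNP.Theorems.CnfIdealGenLengthRankDefectRepresentationsTwoFamilyCutDomination.colourJ (row x) ∈ S'₁ ∧
                Summit.PneNP.PneNP.Theorems.CnfIdealGenLengthRankDefectRepresentationsTwoFamilyCutDomination.colourI (col y) ∈ B \ S₁ ∧
                Summit.PneNP.PneNP.Theorems.CnfIdealGenLengthRankDefectRepresentationsTwoFamilyCutDomination.colourJ (col y) ∈ B' \ S'₁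
            then D x y else 0).rank ≤ c := by
  refine stub_sharpAntipodal K n n' ι ι' row col D c (fun A A' => ?_) B S₁ B' S'₁ hS hS'
  have h4 := Summit.PneNP.PneNP.Theorems.CnfIdealGenLengthRankDefectRepresentationsQuadrantCapture.doubleCut_eq_sum_four row col A A' D
  have := hc A A'
  omega


/-! ## RESHAPE 13 (lead g16, 2026-08-29): the AVERAGE-CUT lane — Theorem 2 holds with the AVERAGE bipartition cut in place of the maximum
(full text: memo `Lines/rank-dehn-ladder-g16.md` §1–§3 and the g16 commits of this file).  LOCAL CUT INEQUALITY (W12) `rank (R − R'_B) ≤ 4 μ(B) + Σ_i (μ(B △ {i}) − μ(B))`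
for EVERY colour set `B`; the slack cancels on average: `mc(R) ≤ 4 · E_B[μ(B)]` (W13); the average double cut `ē(D)` is exactly additive over zero-cross halves (W16)
and monotone under sub-instances (W17); AVERAGE QUADRANT CAPTURE at `17·ē(D)` (lead, p713701).  RESHAPE 11/12 of lead g15 (W8 `stub_profileFlip` p711683, W9
`stub_trivialHalving` p711716, W10 `stub_columnSaturation` p711912; W4/W5/W6 closed by p709975/p709899/p710348) are recorded here as well.  All RESHAPE-13 stubs
CLOSED: W11 p713742, W12 p713855, W13 p713772, averageCapture p713701.  Calibration: a weak staircase with `c₀ = 2`, `mc = 9` (ratio 4.5, W15 p715720).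
P ≠ NP is not moved; F-N2 is a FRONTIER formal rung. -/

/-- TOOL stub (lead g16 RESHAPE 13; TRUE, worker W11) = ONE-SIDED DECOMPOSITION WITH SIGNED SLACK.  g7's `oneSided_decomposition`
(`Theorems/…CutLemmaMaxCut`, p642504) assumed the cut `B` maximal against removing single colours; here the single-removal cuts `μ(B ∖ i)` may differ from
`μ(B)` by a signed slack `δ i` (`μ(B ∖ i) ≤ μ(B) + δ i`), and the slack is simply added to the cost: the diagonal super-block `R|_{(row∈B)×(col∈B)}` is
within rank `2·rank Q + rank S + Σ_{i∈B} δ i` of a colour-block-diagonal matrix (`Q = R|_{B×Bᶜ}`, `S = R|_{Bᶜ×B}`).  Proof = p642504's, verbatim, with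
`+ δ i` carried through the step `ha` (`rank (P'_i − Q'_i Z_i) ≤ (rank Q − rank Q_{−i}) + (rank S − rank S_{−i}) + δ i`) and the sum `hsumE`.
[CLOSED — stub-worker on lead g16 brief W11, p713742 `Theorems/…OneSidedSlack`] -/
theorem stub_oneSidedSlack :
    ∀ (K : Type) [Field K] (ι ι' Q : Type) [Fintype ι] [Fintype ι'] [DecidableEq ι] [DecidableEq ι'] [DecidableEq Q]
      (row : ι → Q) (col : ι' → Q) (R : Matrix ι ι' K) (B : Finset Q) (δ : Q → ℤ),
      (∀ i ∈ B,
        (((Matrix.of fun x y => if row x ∈ B.erase i ∧ col y ∉ B.erase i then R x y else 0).rank : ℤ) +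
          ((Matrix.of fun x y => if row x ∉ B.erase i ∧ col y ∈ B.erase i then R x y else 0).rank : ℤ)) ≤
        ((Matrix.of fun x y => if row x ∈ B ∧ col y ∉ B then R x y else 0).rank : ℤ) +
          ((Matrix.of fun x y => if row x ∉ B ∧ col y ∈ B then R x y else 0).rank : ℤ) + δ i) →
      ∃ P'' : Matrix ι ι' K, (∀ x y, ¬ (row x = col y ∧ col y ∈ B) → P'' x y = 0) ∧
        (((Matrix.of fun x y => if row x ∈ B ∧ col y ∈ B then R x y else 0) - P'').rank : ℤ) ≤
          2 * ((Matrix.of fun x y => if row x ∈ B ∧ col y ∉ B then R x y else 0).rank : ℤ) +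
            ((Matrix.of fun x y => if row x ∉ B ∧ col y ∈ B then R x y else 0).rank : ℤ) + ∑ i ∈ B, δ i :=
  Summit.PneNP.PneNP.Theorems.CnfIdealGenLengthRankDefectRepresentationsOneSidedSlack.stub_oneSidedSlack

/-- TOOL stub (lead g16 RESHAPE 13; TRUE, worker W12) = the LOCAL CUT INEQUALITY — Theorem 2 at an ARBITRARY cut: for EVERY set of colours `B`,
`R` is within rank `4 μ(B) + Σ_i (μ(B △ {i}) − μ(B))` (signed!) of a colour-block-diagonal matrix, `μ(B) = rank R|_{B×Bᶜ} + rank R|_{Bᶜ×B}`, the sum over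
ALL colours `i` of the finite colour type.  From W11 (taken as the hypothesis) applied to `B` with `δ i := μ(B △ {i}) − μ(B)` (`B △ {i} = B.erase i` for
`i ∈ B`, equality) and to `Bᶜ` (`Bᶜ.erase i = (B △ {i})ᶜ` for `i ∉ B`; complementing a cut swaps its two blocks, `…LocalCapture.bcut_compl`), assembled as in
`…CutLemma.exists_blockDiagonal_of_maxCut` (p642852): `μ(B) + (2Q + S + Σ_{i∈B} δ) + (2S + Q + Σ_{i∉B} δ) = 4μ(B) + Σ_i δ i`.  [CLOSED — stub-worker on lead g16 brief W12, p713855 `Theorems/…LocalCut`] -/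
theorem stub_localCut :
    (∀ (K : Type) [Field K] (ι ι' Q : Type) [Fintype ι] [Fintype ι'] [DecidableEq ι] [DecidableEq ι'] [DecidableEq Q]
      (row : ι → Q) (col : ι' → Q) (R : Matrix ι ι' K) (B : Finset Q) (δ : Q → ℤ),
      (∀ i ∈ B,
        (((Matrix.of fun x y => if row x ∈ B.erase i ∧ col y ∉ B.erase i then R x y else 0).rank : ℤ) +
          ((Matrix.of fun x y => if row x ∉ B.erase i ∧ col y ∈ B.erase i then R x y else 0).rank : ℤ)) ≤
        ((Matrix.of fun x y => if row x ∈ B ∧ col y ∉ B then R x y else 0).rank : ℤ) +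
          ((Matrix.of fun x y => if row x ∉ B ∧ col y ∈ B then R x y else 0).rank : ℤ) + δ i) →
      ∃ P'' : Matrix ι ι' K, (∀ x y, ¬ (row x = col y ∧ col y ∈ B) → P'' x y = 0) ∧
        (((Matrix.of fun x y => if row x ∈ B ∧ col y ∈ B then R x y else 0) - P'').rank : ℤ) ≤
          2 * ((Matrix.of fun x y => if row x ∈ B ∧ col y ∉ B then R x y else 0).rank : ℤ) +
            ((Matrix.of fun x y => if row x ∉ B ∧ col y ∈ B then R x y else 0).rank : ℤ) + ∑ i ∈ B, δ i) →
    ∀ (K : Type) [Field K] (ι ι' Q : Type) [Fintype ι] [Fintype ι'] [DecidableEq ι] [DecidableEq ι'] [Fintype Q] [DecidableEq Q]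
      (row : ι → Q) (col : ι' → Q) (R : Matrix ι ι' K) (B : Finset Q),
      ∃ R' : Matrix ι ι' K, (∀ x y, row x ≠ col y → R' x y = 0) ∧
        ((R - R').rank : ℤ) ≤
          4 * (((Matrix.of fun x y => if row x ∈ B ∧ col y ∉ B then R x y else 0).rank : ℤ) +
              ((Matrix.of fun x y => if row x ∉ B ∧ col y ∈ B then R x y else 0).rank : ℤ)) +
          ∑ i : Q, ((((Matrix.of fun x y => if row x ∈ symmDiff B {i} ∧ col y ∉ symmDiff B {i} then R x y else 0).rank : ℤ) +
              ((Matrix.of fun x y => if row x ∉ symmDiff B {i} ∧ col y ∈ symmDiff B {i} then R x y else 0).rank : ℤ)) -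
            (((Matrix.of fun x y => if row x ∈ B ∧ col y ∉ B then R x y else 0).rank : ℤ) +
              ((Matrix.of fun x y => if row x ∉ B ∧ col y ∈ B then R x y else 0).rank : ℤ))) :=
  Summit.PneNP.PneNP.Theorems.CnfIdealGenLengthRankDefectRepresentationsLocalCut.stub_localCut

/-- TOOL stub (lead g16 RESHAPE 13; TRUE, worker W13) = the AVERAGE-CUT DECOMPOSITION: `R` is within rank `4 · avg_B μ(B)` of a colour-block-diagonal
matrix, stated as `2^{#Q} · rank (R − R') ≤ 4 · Σ_B μ(B)`.  From the local cut inequality (W12's conclusion, taken as the hypothesis): summing it over all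
`B : Finset Q`, the signed slack terms cancel (`B ↦ B △ {i}` is an involution of `Finset Q`, `Finset.symmDiff_symmDiff_cancel_right`, so
`Σ_B μ(B △ {i}) = Σ_B μ(B)` by `Fintype.sum_equiv`), leaving `Σ_B cost(B) = 4 Σ_B μ(B)`; a `B` of minimal cost has `2^{#Q}·cost ≤ Σ_B cost`
(`Finset.exists_min_image`, `Finset.card_univ`, `Fintype.card_finset`).  [CLOSED — stub-worker on lead g16 brief W13, p713772 `Theorems/…AverageCut`] -/
theorem stub_averageCut :
    (∀ (K : Type) [Field K] (ι ι' Q : Type) [Fintype ι] [Fintype ι'] [DecidableEq ι] [DecidableEq ι'] [Fintype Q] [DecidableEq Q]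
      (row : ι → Q) (col : ι' → Q) (R : Matrix ι ι' K) (B : Finset Q),
      ∃ R' : Matrix ι ι' K, (∀ x y, row x ≠ col y → R' x y = 0) ∧
        ((R - R').rank : ℤ) ≤
          4 * (((Matrix.of fun x y => if row x ∈ B ∧ col y ∉ B then R x y else 0).rank : ℤ) +
              ((Matrix.of fun x y => if row x ∉ B ∧ col y ∈ B then R x y else 0).rank : ℤ)) +
          ∑ i : Q, ((((Matrix.of fun x y => if row x ∈ symmDiff B {i} ∧ col y ∉ symmDiff B {i} then R x y else 0).rank : ℤ) +
              ((Matrix.of fun x y => if row x ∉ symmDiff B {i} ∧ col y ∈ symmDiff B {i} then R x y else 0).rank : ℤ)) -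
            (((Matrix.of fun x y => if row x ∈ B ∧ col y ∉ B then R x y else 0).rank : ℤ) +
              ((Matrix.of fun x y => if row x ∉ B ∧ col y ∈ B then R x y else 0).rank : ℤ)))) →
    ∀ (K : Type) [Field K] (ι ι' Q : Type) [Fintype ι] [Fintype ι'] [DecidableEq ι] [DecidableEq ι'] [Fintype Q] [DecidableEq Q]
      (row : ι → Q) (col : ι' → Q) (R : Matrix ι ι' K),
      ∃ R' : Matrix ι ι' K, (∀ x y, row x ≠ col y → R' x y = 0) ∧
        2 ^ Fintype.card Q * (R - R').rank ≤
          4 * ∑ B : Finset Q, ((Matrix.of fun x y => if row x ∈ B ∧ col y ∉ B then R x y else 0).rank +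
              (Matrix.of fun x y => if row x ∉ B ∧ col y ∈ B then R x y else 0).rank) :=
  Summit.PneNP.PneNP.Theorems.CnfIdealGenLengthRankDefectRepresentationsAverageCut.stub_averageCut

/-- TOOL stub (lead g16 RESHAPE 13; TRUE, the LEAD's) = AVERAGE QUADRANT CAPTURE (2D): for every two-family instance some double cut `(B,B')` and ONE
matrix `N` with `rank N ≤ 17 · avg_{A,A'} Φ(A,A')` (stated as `2^{2^n} 2^{2^{n'}} rank N ≤ 17 Σ_{A,A'} Φ(A,A')`) agreeing with `D` on every visible cell
separated by `B` (first family) or by `B'` (second family).  g14's `stub_quadrantCapture` (p703363) needed a GLOBAL maximiser and paid `17 · max Φ`.  Proof: at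
EVERY `(B,B')` the local cut inequality (hypothesis = W12's conclusion) applied to the `B'`-masked matrix with the first-family colouring (its bipartition cut at
`A` is `Φ(A,B')`, `…LocalCapture.bcut_maskJ`) and to the `B`-masked matrix with the second-family colouring (`bcut_maskI`) gives capture at cost
`17Φ(B,B') + 2Σ_i (Φ(B△i,B') − Φ(B,B')) + 2Σ_j (Φ(B,B'△j) − Φ(B,B'))` (assembly of p703363: `rank_sepMask_le`, `doubleCut_eq_sum_four`); summed over all
`(B,B')` both signed sums vanish.  [CLOSED — lead g16, p713701 `Theorems/…AverageCapture` (constant 9 inside)] -/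
theorem stub_averageCapture :
    (∀ (K : Type) [Field K] (ι ι' Q : Type) [Fintype ι] [Fintype ι'] [DecidableEq ι] [DecidableEq ι'] [Fintype Q] [DecidableEq Q]
      (row : ι → Q) (col : ι' → Q) (R : Matrix ι ι' K) (B : Finset Q),
      ∃ R' : Matrix ι ι' K, (∀ x y, row x ≠ col y → R' x y = 0) ∧
        ((R - R').rank : ℤ) ≤
          4 * (((Matrix.of fun x y => if row x ∈ B ∧ col y ∉ B then R x y else 0).rank : ℤ) +
              ((Matrix.of fun x y => if row x ∉ B ∧ col y ∈ B then R x y else 0).rank : ℤ)) +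
          ∑ i : Q, ((((Matrix.of fun x y => if row x ∈ symmDiff B {i} ∧ col y ∉ symmDiff B {i} then R x y else 0).rank : ℤ) +
              ((Matrix.of fun x y => if row x ∉ symmDiff B {i} ∧ col y ∈ symmDiff B {i} then R x y else 0).rank : ℤ)) -
            (((Matrix.of fun x y => if row x ∈ B ∧ col y ∉ B then R x y else 0).rank : ℤ) +
              ((Matrix.of fun x y => if row x ∉ B ∧ col y ∈ B then R x y else 0).rank : ℤ)))) →
    ∀ (K : Type) [Field K] (n n' : ℕ) (ι ι' : Type) [Fintype ι] [Fintype ι'] [DecidableEq ι] [DecidableEq ι']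
      (row : ι → Fin n ⊕ Fin n' → Bool) (col : ι' → Fin n ⊕ Fin n' → Bool) (D : Matrix ι ι' K),
      ∃ (B : Finset (Fin n → Bool)) (B' : Finset (Fin n' → Bool)) (N : Matrix ι ι' K),
        2 ^ (2 ^ n) * 2 ^ (2 ^ n') * N.rank ≤
          17 * ∑ A : Finset (Fin n → Bool), ∑ A' : Finset (Fin n' → Bool), Summit.PneNP.PneNP.Theorems.CnfIdealGenLengthRankDefectRepresentationsTwoFamilyCutDomination.doubleCut row col A A' D ∧
        ∀ x y,
          Summit.PneNP.PneNP.Theorems.CnfIdealGenLengthRankDefectRepresentationsTwoFamilyCutDomination.colourI (row x) ≠ Summit.PneNP.PneNP.Theorems.CnfIdealGenLengthRankDefectRepresentationsTwoFamilyCutDomination.colourI (col y) →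
          Summit.PneNP.PneNP.Theorems.CnfIdealGenLengthRankDefectRepresentationsTwoFamilyCutDomination.colourJ (row x) ≠ Summit.PneNP.PneNP.Theorems.CnfIdealGenLengthRankDefectRepresentationsTwoFamilyCutDomination.colourJ (col y) →
          ((Summit.PneNP.PneNP.Theorems.CnfIdealGenLengthRankDefectRepresentationsTwoFamilyCutDomination.colourI (row x) ∈ B) ≠ (Summit.PneNP.PneNP.Theorems.CnfIdealGenLengthRankDefectRepresentationsTwoFamilyCutDomination.colourI (col y) ∈ B) ∨
            (Summit.PneNP.PneNP.Theorems.CnfIdealGenLengthRankDefectRepresentationsTwoFamilyCutDomination.colourJ (row x) ∈ B') ≠ (Summit.PneNP.PneNP.Theorems.CnfIdealGenLengthRankDefectRepresentationsTwoFamilyCutDomination.colourJ (col y) ∈ B')) →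
          N x y = D x y :=
  Summit.PneNP.PneNP.Theorems.CnfIdealGenLengthRankDefectRepresentationsAverageCapture.stub_averageCapture

/-- The local cut inequality from the two worker stubs W11, W12. -/
theorem localCut_of_stubs :
    ∀ (K : Type) [Field K] (ι ι' Q : Type) [Fintype ι] [Fintype ι'] [DecidableEq ι] [DecidableEq ι'] [Fintype Q] [DecidableEq Q]
      (row : ι → Q) (col : ι' → Q) (R : Matrix ι ι' K) (B : Finset Q),
      ∃ R' : Matrix ι ι' K, (∀ x y, row x ≠ col y → R' x y = 0) ∧
        ((R - R').rank : ℤ) ≤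
          4 * (((Matrix.of fun x y => if row x ∈ B ∧ col y ∉ B then R x y else 0).rank : ℤ) +
              ((Matrix.of fun x y => if row x ∉ B ∧ col y ∈ B then R x y else 0).rank : ℤ)) +
          ∑ i : Q, ((((Matrix.of fun x y => if row x ∈ symmDiff B {i} ∧ col y ∉ symmDiff B {i} then R x y else 0).rank : ℤ) +
              ((Matrix.of fun x y => if row x ∉ symmDiff B {i} ∧ col y ∈ symmDiff B {i} then R x y else 0).rank : ℤ)) -
            (((Matrix.of fun x y => if row x ∈ B ∧ col y ∉ B then R x y else 0).rank : ℤ) +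
              ((Matrix.of fun x y => if row x ∉ B ∧ col y ∈ B then R x y else 0).rank : ℤ))) :=
  stub_localCut stub_oneSidedSlack

/-- **AVERAGE-CUT DECOMPOSITION** (from W11–W13): every colour-labelled matrix is within rank `4 · avg_B μ(B)` of a colour-block-diagonal one. -/
theorem averageCut_of_stubs :
    ∀ (K : Type) [Field K] (ι ι' Q : Type) [Fintype ι] [Fintype ι'] [DecidableEq ι] [DecidableEq ι'] [Fintype Q] [DecidableEq Q]
      (row : ι → Q) (col : ι' → Q) (R : Matrix ι ι' K),
      ∃ R' : Matrix ι ι' K, (∀ x y, row x ≠ col y → R' x y = 0) ∧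
        2 ^ Fintype.card Q * (R - R').rank ≤
          4 * ∑ B : Finset Q, ((Matrix.of fun x y => if row x ∈ B ∧ col y ∉ B then R x y else 0).rank +
              (Matrix.of fun x y => if row x ∉ B ∧ col y ∈ B then R x y else 0).rank) :=
  stub_averageCut localCut_of_stubs

/-- **AVERAGE QUADRANT CAPTURE** (from W11, W12 and the lead's stub). -/
theorem averageCapture_of_stubs :
    ∀ (K : Type) [Field K] (n n' : ℕ) (ι ι' : Type) [Fintype ι] [Fintype ι'] [DecidableEq ι] [DecidableEq ι']
      (row : ι → Fin n ⊕ Fin n' → Bool) (col : ι' → Fin n ⊕ Fin n' → Bool) (D : Matrix ι ι' K),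
      ∃ (B : Finset (Fin n → Bool)) (B' : Finset (Fin n' → Bool)) (N : Matrix ι ι' K),
        2 ^ (2 ^ n) * 2 ^ (2 ^ n') * N.rank ≤
          17 * ∑ A : Finset (Fin n → Bool), ∑ A' : Finset (Fin n' → Bool), Summit.PneNP.PneNP.Theorems.CnfIdealGenLengthRankDefectRepresentationsTwoFamilyCutDomination.doubleCut row col A A' D ∧
        ∀ x y,
          Summit.PneNP.PneNP.Theorems.CnfIdealGenLengthRankDefectRepresentationsTwoFamilyCutDomination.colourI (row x) ≠ Summit.PneNP.PneNP.Theorems.CnfIdealGenLengthRankDefectRepresentationsTwoFamilyCutDomination.colourI (col y) →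
          Summit.PneNP.PneNP.Theorems.CnfIdealGenLengthRankDefectRepresentationsTwoFamilyCutDomination.colourJ (row x) ≠ Summit.PneNP.PneNP.Theorems.CnfIdealGenLengthRankDefectRepresentationsTwoFamilyCutDomination.colourJ (col y) →
          ((Summit.PneNP.PneNP.Theorems.CnfIdealGenLengthRankDefectRepresentationsTwoFamilyCutDomination.colourI (row x) ∈ B) ≠ (Summit.PneNP.PneNP.Theorems.CnfIdealGenLengthRankDefectRepresentationsTwoFamilyCutDomination.colourI (col y) ∈ B) ∨
            (Summit.PneNP.PneNP.Theorems.CnfIdealGenLengthRankDefectRepresentationsTwoFamilyCutDomination.colourJ (row x) ∈ B') ≠ (Summit.PneNP.PneNP.Theorems.CnfIdealGenLengthRankDefectRepresentationsTwoFamilyCutDomination.colourJ (col y) ∈ B')) →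
          N x y = D x y :=
  stub_averageCapture localCut_of_stubs


/-- TOOL stub (lead g9 RESHAPE 5) = MONOTONICITY OF SIM: a SIM bound for the coordinate type `κ'` gives a SIM bound for every
coordinate type `κ` that embeds into `κ'` (pad the instance with dummy coordinates whose row and column colours are all `false`, so
that their cuts are empty and the data `0` are admissible), and the constant may be enlarged.  `def SimBound` is in
`Theorems/…SimReduction` (p652532). [CLOSED — lead g9, p658480 `Theorems/…SimBoundMono`] -/
theorem stub_simBoundMono :
    ∀ (K : Type) [Field K] (κ κ' : Type) (C C' : ℕ), Nonempty (κ ↪ κ') → C ≤ C' →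
      Summit.PneNP.PneNP.Theorems.CnfIdealGenLengthRankDefectRepresentationsSimReduction.SimBound K κ' C →
      Summit.PneNP.PneNP.Theorems.CnfIdealGenLengthRankDefectRepresentationsSimReduction.SimBound K κ C' :=
  Summit.PneNP.PneNP.Theorems.CnfIdealGenLengthRankDefectRepresentationsSimBoundMono.stub_simBoundMono

/-- TOOL stub (lead g9 RESHAPE 5) = QUASI-POLYNOMIAL SIM FROM THE TWO-FAMILY CUT LEMMA: if the two-family cut lemma holds for every
split `Fin a ⊕ Fin b` with a constant polynomial in `a + b`, then SIM on `2^k` coordinates holds with constant `2^{c (k+1)^2}`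
(`= n^{O(log n)}` for `n = 2^k`): iterate the halving step `simBound_sum` (p652532) along `Fin 2^{k+1} ≃ Fin 2^k ⊕ Fin 2^k`, starting
from `simBound_unit` (`Fin (2^0) = Fin 1`, constant `0`); step `C_{k+1} = 2 C_k + 2 λ_k (4 C_k + 1)` with `λ_k = L (2^{k+1}+1)^e`.
[CLOSED — lead g9, p658299 `Theorems/…SimBoundQuasiPoly`, `c = L + e + 4`] -/
theorem stub_simBoundQuasiPoly :
    (∃ L e : ℕ, ∀ (K : Type) [Field K] (a b : ℕ),
      Summit.PneNP.PneNP.Theorems.CnfIdealGenLengthRankDefectRepresentationsSimReduction.TwoFamilyCutLemma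
        K (Fin a) (Fin b) (L * (a + b + 1) ^ e)) →
    ∃ c : ℕ, ∀ (K : Type) [Field K] (k : ℕ),
      Summit.PneNP.PneNP.Theorems.CnfIdealGenLengthRankDefectRepresentationsSimReduction.SimBound
        K (Fin (2 ^ k)) (2 ^ (c * (k + 1) ^ 2)) :=
  Summit.PneNP.PneNP.Theorems.CnfIdealGenLengthRankDefectRepresentationsSimBoundQuasiPoly.stub_simBoundQuasiPoly

/-- Each unfolded stub is, definitionally, a proof of the corresponding named statement. -/
example : SuperlinearInstability := stub_superlinearInstability
example : SuperpolyInstability := stub_superpolyInstability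
example : TautologyInstability := stub_tautologyInstability
example : TseitinTransfer := stub_tseitinTransfer
example : CutLemma := stub_cutLemma
example : SortingLemma := stub_sortingLemma
example : UniformStability := stub_uniformStability
example : LinearInstability := stub_linearInstability
example : WeightDecomposition := stub_weightDecomposition
example : FiniteStability := stub_finiteStability

/-! ## Tool (folklore, PROVED): the cube-vanishing ideal dies at every commuting idempotent tuple -/

section CubeIdeal

variable {K : Type} [Field K] {n : ℕ}
variable {S : Type} [CommRing S] [Algebra K S]

/-- Point indicator `π_t(e) = ∏_{i∈t} e_i · ∏_{i∉t} (1 - e_i)` (as in `CnfIdealGenLengthRankStability.lean`). -/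
noncomputable def pind (e : Fin n → S) (t : Finset (Fin n)) : S := (∏ i ∈ t, e i) * ∏ i ∈ tᶜ, (1 - e i)

theorem sum_pind_eq_one (e : Fin n → S) : ∑ t : Finset (Fin n), pind e t = 1 := by
  simp only [pind]; exact sum_pointIndicator_eq_one e

theorem pind_mul_e (e : Fin n → S) (he : ∀ i, e i * e i = e i) (t : Finset (Fin n)) (i : Fin n) :
    pind e t * e i = if i ∈ t then pind e t else 0 := by
  have h := pointIndicator_mul_lit e he t (i, false)
  by_cases hi : i ∈ t <;> simpa [pind, Literal.eval, hi] using h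

/-- A word times a point indicator: the indicator if all letters lie in `t`, else `0`. -/
theorem lift_of_mul_pind (e : Fin n → S) (he : ∀ i, e i * e i = e i) (t : Finset (Fin n))
    (w : FreeMonoid (Fin n)) :
    MonoidAlgebra.lift K S (FreeMonoid (Fin n)) (FreeMonoid.lift e) (MonoidAlgebra.of K _ w) * pind e t =
      if ∀ a ∈ FreeMonoid.toList w, a ∈ t then pind e t else 0 := by
  induction w using FreeMonoid.inductionOn' with
  | one => simp
  | mul_of b w ih =>
    rw [map_mul, map_mul, MonoidAlgebra.lift_of _ (FreeMonoid.of b), FreeMonoid.lift_eval_of,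
      FreeMonoid.toList_of_mul, mul_assoc, ih]
    by_cases hw : ∀ a ∈ FreeMonoid.toList w, a ∈ t
    · rw [if_pos hw, mul_comm, pind_mul_e e he]
      by_cases hb : b ∈ t
      · rw [if_pos hb, if_pos]
        intro a ha
        rcases List.mem_cons.mp ha with rfl | ha
        · exact hb
        · exact hw a ha
      · rw [if_neg hb, if_neg]
        exact fun h => hb (h b (List.mem_cons.mpr (Or.inl rfl)))
    · rw [if_neg hw, mul_zero, if_neg]
      exact fun h => hw fun a ha => h a (List.mem_cons_of_mem b ha)

/-- A word at the cube point of `t`: `1` if all letters lie in `t`, else `0`. -/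
theorem boolEval_of_eq (t : Finset (Fin n)) (w : FreeMonoid (Fin n)) :
    boolEval K (fun i => decide (i ∈ t)) (MonoidAlgebra.of K _ w) =
      if ∀ a ∈ FreeMonoid.toList w, a ∈ t then 1 else 0 := by
  induction w using FreeMonoid.inductionOn' with
  | one => rw [map_one, map_one]; simp [FreeMonoid.toList_one]
  | mul_of b w ih =>
    have hb : boolEval K (fun i => decide (i ∈ t)) (MonoidAlgebra.of K _ (FreeMonoid.of b)) =
        if b ∈ t then 1 else 0 := by
      simp only [boolEval, MonoidAlgebra.lift_of, FreeMonoid.lift_eval_of, decide_eq_true_eq]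
    rw [map_mul, map_mul, hb, ih, FreeMonoid.toList_of_mul]
    by_cases hb' : b ∈ t <;> by_cases hw : ∀ a ∈ FreeMonoid.toList w, a ∈ t <;> simp [hb', hw]

/-- **Point-indicator expansion**: `u(e) = Σ_t u(1_t) · π_t(e)` for commuting idempotents `e`. -/
theorem lift_eq_sum_pind (e : Fin n → S) (he : ∀ i, e i * e i = e i) (u : MonoidAlgebra K (FreeMonoid (Fin n))) :
    MonoidAlgebra.lift K S (FreeMonoid (Fin n)) (FreeMonoid.lift e) u =
      ∑ t : Finset (Fin n), boolEval K (fun i => decide (i ∈ t)) u • pind e t := by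
  induction u using MonoidAlgebra.induction_on with
  | hM w =>
    have h1 : MonoidAlgebra.lift K S (FreeMonoid (Fin n)) (FreeMonoid.lift e) (MonoidAlgebra.of K _ w) =
        MonoidAlgebra.lift K S (FreeMonoid (Fin n)) (FreeMonoid.lift e) (MonoidAlgebra.of K _ w) *
          ∑ t : Finset (Fin n), pind e t := by
      rw [sum_pind_eq_one, mul_one]
    rw [h1, Finset.mul_sum]
    refine Finset.sum_congr rfl fun t _ => ?_
    rw [lift_of_mul_pind e he, boolEval_of_eq]
    split_ifs <;> simp
  | hadd x y hx hy =>
    rw [map_add, hx, hy, ← Finset.sum_add_distrib]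
    refine Finset.sum_congr rfl fun t _ => ?_
    rw [map_add, add_smul]
  | hsmul r x hx =>
    rw [map_smul, hx, Finset.smul_sum]
    refine Finset.sum_congr rfl fun t _ => ?_
    rw [map_smul, smul_eq_mul, mul_smul]

/-- In a commutative algebra, a cube-vanishing polynomial dies at every idempotent tuple. -/
theorem lift_eq_zero_of_cubeVanishing (e : Fin n → S) (he : ∀ i, e i * e i = e i)
    (u : MonoidAlgebra K (FreeMonoid (Fin n))) (hu : CubeVanishing K u) :
    MonoidAlgebra.lift K S (FreeMonoid (Fin n)) (FreeMonoid.lift e) u = 0 := by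
  rw [lift_eq_sum_pind e he]
  exact Finset.sum_eq_zero fun t _ => by rw [hu, zero_smul]

end CubeIdeal

/-- **TOOL (folklore, proved).** The cube-vanishing ideal is killed by every commuting idempotent matrix tuple
(generalises the landed `eval_clauseProduct_eq_zero_of_commute` from clause products to the whole ideal): pass to
the commutative subalgebra generated by `M'` and expand in point indicators. -/
theorem eval_eq_zero_of_cubeVanishing {K : Type} [Field K] {n d : ℕ} (M' : Fin n → Matrix (Fin d) (Fin d) K)
    (hM' : Genuine M') (u : MonoidAlgebra K (FreeMonoid (Fin n))) (hu : CubeVanishing K u) : ev M' u = 0 := by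
  have hc : IsMulCommutative (Algebra.adjoin K (Set.range M')) :=
    Algebra.isMulCommutative_adjoin K (by rintro _ ⟨i, rfl⟩ _ ⟨j, rfl⟩; exact hM'.2 i j)
  letI : CommRing (Algebra.adjoin K (Set.range M')) :=
    { (inferInstance : Ring (Algebra.adjoin K (Set.range M'))) with mul_comm := hc.is_comm.comm }
  set e : Fin n → Algebra.adjoin K (Set.range M') :=
    fun i => ⟨M' i, Algebra.subset_adjoin (Set.mem_range_self i)⟩ with he_def
  have he : ∀ i, e i * e i = e i := fun i => Subtype.ext (hM'.1 i)
  have h0 := lift_eq_zero_of_cubeVanishing e he u hu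
  have htr : ∀ v : MonoidAlgebra K (FreeMonoid (Fin n)),
      MonoidAlgebra.lift K (Matrix (Fin d) (Fin d) K) (FreeMonoid (Fin n)) (FreeMonoid.lift M') v =
        (Algebra.adjoin K (Set.range M')).val
          (MonoidAlgebra.lift K (Algebra.adjoin K (Set.range M')) (FreeMonoid (Fin n)) (FreeMonoid.lift e) v) := by
    intro v
    induction v using MonoidAlgebra.induction_on with
    | hM w =>
      rw [MonoidAlgebra.lift_of, MonoidAlgebra.lift_of]
      induction w using FreeMonoid.inductionOn' with
      | one => simp
      | mul_of b w ih =>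
        rw [map_mul, map_mul, map_mul, ih, FreeMonoid.lift_eval_of, FreeMonoid.lift_eval_of]
        rfl
    | hadd x y hx hy => rw [map_add, map_add, map_add, hx, hy]
    | hsmul r x hx => rw [map_smul, map_smul, map_smul, hx]
  show MonoidAlgebra.lift K (Matrix (Fin d) (Fin d) K) (FreeMonoid (Fin n)) (FreeMonoid.lift M') u = 0
  rw [htr u, h0, map_zero]

namespace Registered
/-- Alias keyed by the registered stub name (device of `Cruxes/FoolingMeasure/Lines/duty.lean`: the skeleton audit
admits hypotheses by stub NAME). -/
abbrev stub_tautologyInstability : Prop := TautologyInstability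
/-- Alias keyed by the registered stub name (negative side). -/
abbrev stub_uniformStability : Prop := UniformStability
end Registered

/-! ## Tool: telescoping over the leaves of a formula -/

section Tools

variable {K : Type} [Field K] {n d : ℕ}

/-- **Telescoping.** `rank (𝔉(M) - 𝔉(M')) ≤ size(𝔉) · max_i rank (M_i - M'_i)`: induction over the formula,
`ab - a'b' = a(b - b') + (a - a')b'`. -/
theorem rank_aeval_sub_le (M M' : Fin n → Matrix (Fin d) (Fin d) K) (𝔉 : NCFormula K (Fin n)) {D : ℕ}
    (hD : ∀ i, (M i - M' i).rank ≤ D) : (𝔉.aeval M - 𝔉.aeval M').rank ≤ 𝔉.size * D := by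
  induction 𝔉 with
  | var i => simpa using hD i
  | const c => simp
  | add φ ψ ihφ ihψ =>
    simp only [NCFormula.aeval_add, NCFormula.size_add]
    rw [add_sub_add_comm]
    refine (Literature.Computability.AlgebraicComplexity.rank_add_le _ _).trans ?_
    refine (Nat.add_le_add ihφ ihψ).trans ?_
    rw [Nat.add_mul, Nat.add_mul]
    exact Nat.le_add_right _ _
  | mul φ ψ ihφ ihψ =>
    simp only [NCFormula.aeval_mul, NCFormula.size_mul]
    have hsplit : φ.aeval M * ψ.aeval M - φ.aeval M' * ψ.aeval M' =
        φ.aeval M * (ψ.aeval M - ψ.aeval M') + (φ.aeval M - φ.aeval M') * ψ.aeval M' := by noncomm_ring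
    rw [hsplit]
    refine (Literature.Computability.AlgebraicComplexity.rank_add_le _ _).trans ?_
    refine (Nat.add_le_add ((Matrix.rank_mul_le_right _ _).trans ihψ) ((Matrix.rank_mul_le_left _ _).trans ihφ)).trans ?_
    rw [Nat.add_mul, Nat.add_mul, Nat.add_comm (ψ.size * D)]
    exact Nat.le_add_right _ _

/-- Certified ≤ size · distance: at an almost-representation within distance `D` of a genuine one, every cube-vanishing
formula has rank `≤ size · D`. -/
theorem rank_aeval_le_size_mul_of_near (M M' : Fin n → Matrix (Fin d) (Fin d) K) (hM' : Genuine M')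
    (𝔉 : NCFormula K (Fin n)) (hvan : CubeVanishing K 𝔉.evalFree) {D : ℕ} (hD : ∀ i, (M i - M' i).rank ≤ D) :
    (𝔉.aeval M).rank ≤ 𝔉.size * D := by
  have h0 : 𝔉.aeval M' = 0 := by
    rw [← NCFormula.lift_evalFree]
    exact eval_eq_zero_of_cubeVanishing M' hM' _ hvan
  have h1 := rank_aeval_sub_le M M' 𝔉 hD
  rwa [h0, sub_zero] at h1

end Tools

/-! ## The clause product as a formula (RDR ⇒ T1⁺) -/

section ClauseProductFormula

variable (K : Type) [Field K] {n : ℕ}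

/-- The literal word as a formula: `(i,true) ↦ 1 + (-1)·x_i`, `(i,false) ↦ x_i`. -/
def litFormula (l : Literal (Fin n)) : NCFormula K (Fin n) :=
  if l.2 then .add (.const 1) (.mul (.const (-1)) (.var l.1)) else .var l.1

/-- The clause word as a formula. -/
def clauseWordFormula : Clause (Fin n) → NCFormula K (Fin n)
  | [] => .const 1
  | l :: κ => .mul (litFormula K l) (clauseWordFormula κ)

/-- The clause product as a formula. -/
def clauseProductFormula : CNF (Fin n) → NCFormula K (Fin n)
  | [] => .const 1
  | κ :: φ => .mul (.add (.const 1) (.mul (.const (-1)) (clauseWordFormula K κ))) (clauseProductFormula φ)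

variable {K}

@[simp] theorem litFormula_true (i : Fin n) :
    litFormula K (i, true) = .add (.const 1) (.mul (.const (-1)) (.var i)) := by
  simp [litFormula]

@[simp] theorem litFormula_false (i : Fin n) : litFormula K (i, false) = .var i := by
  simp [litFormula]

theorem evalFree_litFormula (l : Literal (Fin n)) : (litFormula K l).evalFree = litWord K l := by
  rcases l with ⟨i, b⟩
  cases b
  · simp [litWord, X]
  · simp only [litFormula_true, NCFormula.evalFree_add, NCFormula.evalFree_const, NCFormula.evalFree_mul,
      NCFormula.evalFree_var, map_one, map_neg, neg_one_mul]
    simp [litWord, X, sub_eq_add_neg]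

theorem size_litFormula_le (l : Literal (Fin n)) : (litFormula K l).size ≤ 5 := by
  unfold litFormula
  split_ifs <;> simp

theorem evalFree_clauseWordFormula (κ : Clause (Fin n)) : (clauseWordFormula K κ).evalFree = clauseWord K κ := by
  induction κ with
  | nil => simp only [clauseWordFormula, NCFormula.evalFree_const, map_one, clauseWord_nil]
  | cons l κ ih => simp only [clauseWordFormula, NCFormula.evalFree_mul, ih, evalFree_litFormula, clauseWord_cons]

theorem size_clauseWordFormula_le (κ : Clause (Fin n)) : (clauseWordFormula K κ).size ≤ 6 * κ.length + 1 := by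
  induction κ with
  | nil => simp [clauseWordFormula]
  | cons l κ ih =>
    simp only [clauseWordFormula, NCFormula.size_mul, List.length_cons]
    have := size_litFormula_le (K := K) l
    omega

theorem evalFree_clauseProductFormula (φ : CNF (Fin n)) :
    (clauseProductFormula K φ).evalFree = clauseProduct K φ := by
  induction φ with
  | nil => simp only [clauseProductFormula, NCFormula.evalFree_const, map_one, clauseProduct_nil]
  | cons κ φ ih =>
    simp only [clauseProductFormula, NCFormula.evalFree_mul, NCFormula.evalFree_add, NCFormula.evalFree_const,
      map_one, map_neg, neg_one_mul, ih, evalFree_clauseWordFormula, clauseProduct_cons, sub_eq_add_neg]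

theorem size_clauseProductFormula_le (φ : CNF (Fin n)) :
    (clauseProductFormula K φ).size ≤ 6 * (φ.size + φ.numClauses) + 1 := by
  unfold CNF.size CNF.numClauses
  induction φ with
  | nil => simp [clauseProductFormula]
  | cons κ φ ih =>
    simp only [clauseProductFormula, NCFormula.size_mul, NCFormula.size_add, NCFormula.size_const, List.map_cons,
      List.sum_cons, List.length_cons]
    have := size_clauseWordFormula_le (K := K) κ
    omega

/-- Clause products of unsatisfiable CNFs are cube-vanishing (the certificate of RDR is a certificate of T1⁺). -/
theorem cubeVanishing_clauseProduct {φ : CNF (Fin n)} (hφ : ¬ φ.Satisfiable) : CubeVanishing K (clauseProduct K φ) := by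
  intro σ
  rw [boolEval_clauseProduct]
  have : φ.eval σ ≠ true := fun h => hφ ⟨σ, h⟩
  simp [Bool.eq_false_iff.mpr this]

end ClauseProductFormula

/-! ## Proved implications along the ladder -/

/-- RDR ⇒ T1⁺: the clause product formula is the certificate. -/
theorem certifiedInstability_of_rdr (h : Summit.PneNP.PneNP.Theses.CnfIdealGenLength.RankDefectRepresentations) :
    CertifiedInstability := by
  obtain ⟨p, φ, hφ, h⟩ := h
  refine ⟨Polynomial.C 12 * p + 1, fun c => (h c).mono fun n hn => ?_⟩
  obtain ⟨K, iF, iC, d, t, M, hM, hlt⟩ := hn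
  refine ⟨K, iF, iC, d, t, M, clauseProductFormula K (φ n), hM, ?_, ?_, ?_⟩
  · rw [evalFree_clauseProductFormula]; exact cubeVanishing_clauseProduct (hφ n).1
  · refine (size_clauseProductFormula_le (K := K) (φ n)).trans ?_
    have h1 := (hφ n).2.1; have h2 := (hφ n).2.2
    simp only [Polynomial.eval_add, Polynomial.eval_mul, Polynomial.eval_C, Polynomial.eval_one]
    omega
  · rw [← NCFormula.lift_evalFree, evalFree_clauseProductFormula]; exact hlt

/-- T1⁺ ⇒ T1 (modulo the folklore tool stub): a certified almost-representation is far from genuine. -/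
theorem superpolyInstability_of_certified (h : CertifiedInstability) : SuperpolyInstability := by
  obtain ⟨s, hs⟩ := h
  obtain ⟨b, -, hb⟩ := exists_pow_bound s
  intro c
  filter_upwards [hs (b + c), eventually_ge_atTop 2] with n hn hn2
  obtain ⟨K, iF, iC, d, t, M, 𝔉, hM, hvan, hsize, hlt⟩ := hn
  refine ⟨K, iF, iC, d, t, M, hM, fun M' hM' => ?_⟩
  by_contra hcon
  simp only [not_exists, not_lt] at hcon
  have h2 : (𝔉.aeval M).rank ≤ n ^ (b + c) * t :=
    calc (𝔉.aeval M).rank ≤ 𝔉.size * (n ^ c * t) := rank_aeval_le_size_mul_of_near M M' hM' 𝔉 hvan hcon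
      _ ≤ n ^ b * (n ^ c * t) := Nat.mul_le_mul_right _ (hsize.trans (hb n hn2))
      _ = n ^ (b + c) * t := by rw [pow_add, mul_assoc]
  exact absurd hlt (not_lt.mpr h2)

/-- T1 ⇒ RUNG 1. -/
theorem superlinear_of_superpoly (h : SuperpolyInstability) : SuperlinearInstability := by
  intro C
  filter_upwards [h 2, eventually_ge_atTop C] with n hn hCn
  obtain ⟨K, iF, iC, d, t, M, hM, hfar⟩ := hn
  refine ⟨K, iF, iC, d, t, M, hM, hfar.mono ?_⟩
  have : C * n ≤ n ^ 2 := by rw [pow_two]; exact Nat.mul_le_mul_right n hCn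
  exact Nat.mul_le_mul_right t this

/-- KILL PATH: polynomial rank-stability of the presentation ("ST-poly", hypothesis shape of the landed
`not_rankDefectRepresentations_of_polyStable`) refutes RUNG 2, hence RUNG 3 and the line. -/
theorem not_superpolyInstability_of_polyStable
    (hST : ∃ a : ℕ, ∀ᶠ n : ℕ in atTop, ∀ (K : Type) [Field K] [CharZero K] (d t : ℕ)
      (M : Fin n → Matrix (Fin d) (Fin d) K),
      (∀ g : MonoidAlgebra K (FreeMonoid (Fin n)), IsAxiom g →
        (MonoidAlgebra.lift K (Matrix (Fin d) (Fin d) K) (FreeMonoid (Fin n)) (FreeMonoid.lift M) g).rank ≤ t) →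
      ∃ M' : Fin n → Matrix (Fin d) (Fin d) K, (∀ i, M' i * M' i = M' i) ∧ (∀ i j, M' i * M' j = M' j * M' i) ∧
        ∀ i, (M i - M' i).rank ≤ n ^ a * t) :
    ¬ SuperpolyInstability := by
  intro hT1
  obtain ⟨a, ha⟩ := hST
  obtain ⟨n, hST', K, _, _, d, t, M, hM, hfar⟩ := (ha.and (hT1 a)).exists
  obtain ⟨M', hidem, hcomm, hdist⟩ := hST' K d t M hM
  obtain ⟨i, hi⟩ := hfar M' ⟨hidem, hcomm⟩
  exact absurd (hdist i) (not_le.mpr hi)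

/-- KILL PATH, continued: ST-poly refutes RUNG 3. -/
theorem not_certifiedInstability_of_polyStable
    (hST : ∃ a : ℕ, ∀ᶠ n : ℕ in atTop, ∀ (K : Type) [Field K] [CharZero K] (d t : ℕ)
      (M : Fin n → Matrix (Fin d) (Fin d) K),
      (∀ g : MonoidAlgebra K (FreeMonoid (Fin n)), IsAxiom g →
        (MonoidAlgebra.lift K (Matrix (Fin d) (Fin d) K) (FreeMonoid (Fin n)) (FreeMonoid.lift M) g).rank ≤ t) →
      ∃ M' : Fin n → Matrix (Fin d) (Fin d) K, (∀ i, M' i * M' i = M' i) ∧ (∀ i j, M' i * M' j = M' j * M' i) ∧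
        ∀ i, (M i - M' i).rank ≤ n ^ a * t) :
    ¬ CertifiedInstability := fun h =>
  not_superpolyInstability_of_polyStable hST (superpolyInstability_of_certified h)

/-! ## Diagonal bookkeeping: the crux is equivalent to its pointwise-in-`c` form -/

/-- Diagonal extraction: from "for every `c`, eventually `P c n`" a growth function `g → ∞` (eventually above every
`c`) with "eventually, `P c n` for all `c ≤ g n`". -/
theorem exists_diag {P : ℕ → ℕ → Prop} (h : ∀ c, ∀ᶠ n in atTop, P c n) :
    ∃ g : ℕ → ℕ, (∀ c, ∀ᶠ n in atTop, c ≤ g n) ∧ ∀ᶠ n in atTop, ∀ c ≤ g n, P c n := by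
  have hQ : ∀ c, ∀ᶠ n in atTop, ∀ c' ≤ c, P c' n := by
    intro c
    induction c with
    | zero =>
      filter_upwards [h 0] with n hn c' hc'
      rwa [Nat.le_zero.mp hc']
    | succ c ih =>
      filter_upwards [ih, h (c + 1)] with n hn hn1 c' hc'
      by_cases hc : c' ≤ c
      · exact hn c' hc
      · have : c' = c + 1 := by omega
        subst this; exact hn1
  choose N hN using fun c => eventually_atTop.mp (hQ c)
  refine ⟨fun n => Nat.findGreatest (fun c => N c ≤ n) n, fun c => ?_, ?_⟩
  · filter_upwards [eventually_ge_atTop (max c (N c))] with n hn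
    exact Nat.le_findGreatest (le_of_max_le_left hn) (le_of_max_le_right hn)
  · filter_upwards [eventually_ge_atTop (N 0)] with n hn c hc
    have hspec : N (Nat.findGreatest (fun c => N c ≤ n) n) ≤ n :=
      Nat.findGreatest_spec (P := fun c => N c ≤ n) (Nat.zero_le n) hn
    exact hN _ n hspec c hc

/-- The crux is equivalent to its pointwise form (head symbol `Iff` on purpose: the skeleton audit takes the first
theorem concluding the crux by name). -/
theorem rankDefectRepresentations_iff_pointwise :
    Summit.PneNP.PneNP.Theses.CnfIdealGenLength.RankDefectRepresentations ↔ RDRPointwise := by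
  constructor
  · rintro ⟨p, φ, hφ, h⟩
    refine ⟨p, fun c => (h c).mono fun n hn => ⟨φ n, hφ n, ?_⟩⟩
    obtain ⟨K, iF, iC, d, t, M, hM, hlt⟩ := hn
    exact ⟨K, iF, iC, d, t, M, hM, hlt⟩
  · rintro ⟨p, hp⟩
    classical
    obtain ⟨g, hg, hP⟩ := exists_diag hp
    let Q : ℕ → Prop := fun n => ∃ φ : CNF (Fin n),
      (¬ φ.Satisfiable ∧ φ.numClauses ≤ p.eval n ∧ φ.size ≤ p.eval n) ∧
        ∃ (K : Type) (_ : Field K) (_ : CharZero K) (d t : ℕ) (M : Fin n → Matrix (Fin d) (Fin d) K),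
          AlmostRep M t ∧ n ^ g n * t < (ev M (clauseProduct K φ)).rank
    have hQ : ∀ᶠ n in atTop, Q n := hP.mono fun n hn => hn (g n) le_rfl
    let fam : (n : ℕ) → CNF (Fin n) := fun n => if hq : Q n then Classical.choose hq else [[]]
    refine ⟨p + 1, fam, fun n => ?_, fun c => ?_⟩
    · by_cases hq : Q n
      · obtain ⟨⟨h1, h2, h3⟩, -⟩ := Classical.choose_spec hq
        simp only [fam, dif_pos hq, Polynomial.eval_add, Polynomial.eval_one]
        exact ⟨h1, by omega, by omega⟩
      · simp only [fam, dif_neg hq, Polynomial.eval_add, Polynomial.eval_one]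
        refine ⟨CNF.not_satisfiable_of_nil_mem (List.mem_singleton_self _), ?_, ?_⟩
        · simp [CNF.numClauses]
        · simp [CNF.size]
    · filter_upwards [hg c, hQ, eventually_ge_atTop 1] with n hcg hq hn1
      obtain ⟨-, K, iF, iC, d, t, M, hM, hlt⟩ := Classical.choose_spec hq
      simp only [fam, dif_pos hq]
      refine ⟨K, iF, iC, d, t, M, hM, lt_of_le_of_lt ?_ hlt⟩
      exact Nat.mul_le_mul_right t (Nat.pow_le_pow_right hn1 hcg)

/-- Integer `e`-th roots, monotonically: `r N = ⌊N^{1/e}⌋` (`(r N)^e ≤ N < (r N + 1)^e`, `r N → ∞`). -/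
theorem exists_root_fun (e : ℕ) (he : 1 ≤ e) :
    ∃ r : ℕ → ℕ, (∀ N, r N ^ e ≤ N) ∧ (∀ N, N < (r N + 1) ^ e) ∧ ∀ m, ∀ᶠ N in atTop, m ≤ r N := by
  refine ⟨fun N => Nat.findGreatest (fun m => m ^ e ≤ N) N, fun N => ?_, fun N => ?_, fun m => ?_⟩
  · have h0 : (0 : ℕ) ^ e ≤ N := by rw [zero_pow (by omega)]; exact Nat.zero_le _
    exact Nat.findGreatest_spec (P := fun m => m ^ e ≤ N) (Nat.zero_le N) h0
  · by_contra hcon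
    rw [not_lt] at hcon
    have hle : Nat.findGreatest (fun m => m ^ e ≤ N) N + 1 ≤ N :=
      le_trans (Nat.le_self_pow (by omega) _) hcon
    exact Nat.findGreatest_is_greatest (lt_add_one _) hle hcon
  · filter_upwards [eventually_ge_atTop (m ^ e)] with N hN
    exact Nat.le_findGreatest ((Nat.le_self_pow (by omega) m).trans hN) hN

/-! ## The crux from the two load-bearing stubs -/

/-- **The crux from the stubs.** RUNG 3 (certified instability on `n = ⌊N^{1/e}⌋` letters, `n + s(n) + 2 ≤ n^e`)
and CNF-universality (extension room `N ≥ n + size`) give the pointwise crux at index `N` with the CNF polynomial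
`X^{2a}`; exponent bookkeeping: `S1` is invoked at exponent `e · (c + 4a + 2)`.  The diagonal lemma makes one CNF
family of it. -/
theorem RankDefectRepresentations_of_certified
    (h1 : CertifiedInstability) (h2 : CnfUniversality) :
    Summit.PneNP.PneNP.Theses.CnfIdealGenLength.RankDefectRepresentations := by
  rw [rankDefectRepresentations_iff_pointwise]
  obtain ⟨s, hs⟩ := h1
  obtain ⟨a, ha⟩ := h2
  obtain ⟨e, he1, he⟩ := exists_pow_bound (Polynomial.X + s + 2)
  obtain ⟨r, hr1, hr2, hr3⟩ := exists_root_fun e he1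
  refine ⟨Polynomial.X ^ (2 * a), fun c => ?_⟩
  set k := c + 4 * a + 2 with hk
  have hev : ∀ᶠ N : ℕ in atTop, ∃ (K : Type) (_ : Field K) (_ : CharZero K) (d t : ℕ)
      (M : Fin (r N) → Matrix (Fin d) (Fin d) K) (𝔉 : NCFormula K (Fin (r N))),
      AlmostRep M t ∧ CubeVanishing K 𝔉.evalFree ∧ 𝔉.size ≤ s.eval (r N) ∧
        (r N) ^ (e * k) * t < (𝔉.aeval M).rank := by
    obtain ⟨N₀, hN₀⟩ := eventually_atTop.mp (hs (e * k))
    filter_upwards [hr3 N₀] with N hN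
    exact hN₀ (r N) hN
  filter_upwards [hev, hr3 2, eventually_ge_atTop (2 ^ (e * k)), eventually_ge_atTop 2] with N hN hrN hN2k hN2
  obtain ⟨K, iF, iC, d, t, M, 𝔉, hM, hvan, hsize, hlt⟩ := hN
  have hroom : r N + 𝔉.size ≤ N := by
    have h1 : r N + s.eval (r N) + 2 ≤ r N ^ e := by
      have := he (r N) hrN
      simpa [Polynomial.eval_add, Polynomial.eval_X] using this
    have h2 : r N ^ e ≤ N := hr1 N
    omega
  obtain ⟨φ, hunsat, hnum, hsz, d', t', M', hM', ht', hR⟩ := ha (r N) N K d t M 𝔉 hM hvan hroom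
  have hpeval : (Polynomial.X ^ (2 * a) : Polynomial ℕ).eval N = N ^ (2 * a) := by
    simp [Polynomial.eval_pow, Polynomial.eval_X]
  have hB : (N + 2) ^ a ≤ N ^ (2 * a) := by
    rw [pow_mul]
    exact Nat.pow_le_pow_left (by nlinarith) a
  refine ⟨φ, ⟨hunsat, ?_, ?_⟩, K, iF, iC, d', t', M', hM', ?_⟩
  · rw [hpeval]; exact hnum.trans hB
  · rw [hpeval]; exact hsz.trans hB
  by_contra hcon
  rw [not_lt] at hcon
  have hB1 : 1 ≤ (N + 2) ^ a := Nat.one_le_pow _ _ (by omega)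
  have hc1 : 1 ≤ N ^ c := Nat.one_le_pow _ _ (by omega)
  have h1cB : 1 ≤ N ^ c * (N + 2) ^ a := by
    calc (1 : ℕ) = 1 * 1 := rfl
      _ ≤ N ^ c * (N + 2) ^ a := Nat.mul_le_mul hc1 hB1
  have htle : t ≤ N ^ c * ((N + 2) ^ a * t) := by
    calc t = 1 * t := (one_mul t).symm
      _ ≤ (N ^ c * (N + 2) ^ a) * t := Nat.mul_le_mul_right t h1cB
      _ = N ^ c * ((N + 2) ^ a * t) := by ring
  -- upper bound for the certified rank
  have key : (𝔉.aeval M).rank ≤ N ^ (4 * a + c + 1) * t :=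
    calc (𝔉.aeval M).rank ≤ (N + 2) ^ a * ((ev M' (clauseProduct K φ)).rank + t) := hR
      _ ≤ (N + 2) ^ a * (N ^ c * t' + t) := Nat.mul_le_mul_left _ (Nat.add_le_add_right hcon t)
      _ ≤ (N + 2) ^ a * (N ^ c * ((N + 2) ^ a * t) + t) :=
          Nat.mul_le_mul_left _ (Nat.add_le_add_right (Nat.mul_le_mul_left _ ht') t)
      _ ≤ (N + 2) ^ a * (N ^ c * ((N + 2) ^ a * t) + N ^ c * ((N + 2) ^ a * t)) :=
          Nat.mul_le_mul_left _ (Nat.add_le_add_left htle _)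
      _ = 2 * ((N + 2) ^ a * (N + 2) ^ a) * N ^ c * t := by ring
      _ ≤ 2 * (N ^ (2 * a) * N ^ (2 * a)) * N ^ c * t := by gcongr
      _ = 2 * N ^ (4 * a + c) * t := by ring
      _ ≤ N * N ^ (4 * a + c) * t := Nat.mul_le_mul_right t (Nat.mul_le_mul_right _ hN2)
      _ = N ^ (4 * a + c + 1) * t := by ring
  -- lower bound: (r N)^{e k} ≥ N^{4a+c+1}
  have hn1 : 1 ≤ r N := by omega
  have hNk : N ^ k < ((2 * r N) ^ e) ^ k := by
    have h' : N < (2 * r N) ^ e := lt_of_lt_of_le (hr2 N) (Nat.pow_le_pow_left (by omega) e)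
    exact Nat.pow_lt_pow_left h' (by omega)
  have hsplit : ((2 * r N) ^ e) ^ k = 2 ^ (e * k) * (r N) ^ (e * k) := by
    rw [← pow_mul, mul_pow]
  have hNk' : 2 ^ (e * k) * N ^ (4 * a + c + 1) ≤ N ^ k :=
    calc 2 ^ (e * k) * N ^ (4 * a + c + 1) = N ^ (4 * a + c + 1) * 2 ^ (e * k) := mul_comm _ _
      _ ≤ N ^ (4 * a + c + 1) * N := Nat.mul_le_mul_left _ hN2k
      _ = N ^ k := by rw [hk]; ring
  have hnN : N ^ (4 * a + c + 1) < (r N) ^ (e * k) :=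
    Nat.lt_of_mul_lt_mul_left (lt_of_le_of_lt hNk' (hsplit ▸ hNk))
  have : (𝔉.aeval M).rank ≤ (r N) ^ (e * k) * t := key.trans (Nat.mul_le_mul_right t hnN.le)
  exact absurd hlt (not_lt.mpr this)

/-- **The crux from the (single, crux-equivalent) load-bearing stub** (lead g2 reshape): tautology instability gives
the crux by the kernel-checked equivalence `rankDefectRepresentations_iff_tautologyInstability` (whose `⇐` is the landed
Tseitin transfer `stub_tseitinTransfer` plus the exponent bookkeeping of `RankDefectRepresentations_of_certified`). -/
theorem RankDefectRepresentations_of (h : Registered.stub_tautologyInstability) :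
    Summit.PneNP.PneNP.Theses.CnfIdealGenLength.RankDefectRepresentations :=
  Summit.PneNP.PneNP.Theorems.CnfIdealGenLengthRankDefectRepresentationsIffTautologyInstability.rankDefectRepresentations_iff_tautologyInstability.mpr
    h

/-- The crux, closed modulo the registered stubs (for the audit's `closure.modulo` display). -/
theorem RankDefectRepresentations_holds_of_stubs :
    Summit.PneNP.PneNP.Theses.CnfIdealGenLength.RankDefectRepresentations :=
  RankDefectRepresentations_of stub_tautologyInstability

/-- NECESSITY of rung 3♭: the crux implies tautology instability (the `⇒` of the equivalence). -/
theorem tautologyInstability_of_rdr (h : Summit.PneNP.PneNP.Theses.CnfIdealGenLength.RankDefectRepresentations) :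
    TautologyInstability :=
  Summit.PneNP.PneNP.Theorems.CnfIdealGenLengthRankDefectRepresentationsIffTautologyInstability.rankDefectRepresentations_iff_tautologyInstability.mp
    h

/-- Rung 3♭ implies rung 3 (through the crux). -/
theorem certifiedInstability_of_tautologyInstability (h : TautologyInstability) : CertifiedInstability :=
  certifiedInstability_of_rdr (RankDefectRepresentations_of h)

/-- The ladder below the crux, as proved implications (RDR ⇔ rung 3♭ ⇒ rung 3 ⇒ rung 2 ⇒ rung 1). -/
theorem ladder_necessity :
    (Summit.PneNP.PneNP.Theses.CnfIdealGenLength.RankDefectRepresentations ↔ TautologyInstability) ∧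
    (Summit.PneNP.PneNP.Theses.CnfIdealGenLength.RankDefectRepresentations → CertifiedInstability) ∧
    (CertifiedInstability → SuperpolyInstability) ∧ (SuperpolyInstability → SuperlinearInstability) :=
  ⟨⟨tautologyInstability_of_rdr, RankDefectRepresentations_of⟩, certifiedInstability_of_rdr,
    superpolyInstability_of_certified, superlinear_of_superpoly⟩

/-! ## N1 ⟺ one-step extension (lead g6, `Theorems/…CutLemmaExtension`, p620038) -/

/-- The registered cut lemma implies its characteristic-`0` restriction. -/
theorem cutLemmaCharZero_of_cutLemma (h : CutLemma) : CutLemmaCharZero := by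
  obtain ⟨C, a, h⟩ := h
  exact ⟨C, a, fun K _ _ n ι ι' _ _ row col t R hR => h K n ι ι' row col t R hR⟩

/-- **N1 ⟺ EXT.** The cut lemma (char 0) is equivalent to the one-step extension form of rank-stability. -/
theorem cutLemmaCharZero_iff_extensionStep : CutLemmaCharZero ↔ ExtensionStep := by
  constructor
  · intro h
    obtain ⟨C, a, hC⟩ :=
      Summit.PneNP.PneNP.Theorems.CnfIdealGenLengthRankDefectRepresentationsCutLemmaExtension.ext_of_cutLemma h
    exact ⟨55 * C, a, fun K _ _ n d c t X hX hcut => hC K n d c t X hX hcut⟩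
  · intro h
    exact Summit.PneNP.PneNP.Theorems.CnfIdealGenLengthRankDefectRepresentationsCutLemmaExtension.cutLemma_of_ext h

/-- Hence the registered stub `stub_cutLemma` yields the extension step. -/
theorem extensionStep_of_cutLemma (h : CutLemma) : ExtensionStep :=
  cutLemmaCharZero_iff_extensionStep.mp (cutLemmaCharZero_of_cutLemma h)

/-! ## Calibration of the two open negative rungs (lead g6) -/

/-- **N0b with a finite constant** (`Theorems/…UniformStabilityFinite`, p621531): the registered `stub_uniformStability` with
`n^a` replaced by SOME constant `C_n` holds for every `n` — uniform rank-stability of `Z_2^n` (Bauer–Blachar–Greenfeld, Ulam form).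
So N0b is exactly the question whether the optimal `C_n` is polynomially bounded. -/
theorem uniformStability_finite :
    ∀ n : ℕ, ∃ C : ℕ, ∀ (K : Type) [Field K] [CharZero K] (d δ : ℕ)
      (ρ : Finset (Fin n) → Matrix (Fin d) (Fin d) K), ρ ∅ = 1 →
      (∀ S T : Finset (Fin n), (ρ S * ρ T - ρ (symmDiff S T)).rank ≤ δ) →
      ∃ π : Finset (Fin n) → Matrix (Fin d) (Fin d) K, π ∅ = 1 ∧
        (∀ S T : Finset (Fin n), π S * π T = π (symmDiff S T)) ∧
        ∀ S : Finset (Fin n), (ρ S - π S).rank ≤ C * δ :=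
  Summit.PneNP.PneNP.Theorems.CnfIdealGenLengthRankDefectRepresentationsUniformStabilityFinite.uniformStability_finite

/-- **N1 for colour-disjoint blocks with constant `n · 2^{(n+1)/2}`** (`Theorems/…CutLemmaHybridCuts`, p620726; meet-in-the-middle
certificate): the best unconditional constant for the colour-disjoint core (RECT) of `stub_cutLemma`; polynomial is the open question. -/
theorem rect_meet_in_the_middle {K : Type} [Field K] {n : ℕ} {ι ι' : Type} [Fintype ι] [Fintype ι'] [DecidableEq ι]
    [DecidableEq ι'] (row : ι → Fin n → Bool) (col : ι' → Fin n → Bool) (R : Matrix ι ι' K) (t : ℕ)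
    (hdis : ∀ x y, row x ≠ col y)
    (hcut : ∀ j : Fin n, (Matrix.of fun x y => if row x j ≠ col y j then R x y else 0).rank ≤ t) :
    R.rank ≤ n * 2 ^ ((n + 1) / 2) * t :=
  Summit.PneNP.PneNP.Theorems.CnfIdealGenLengthRankDefectRepresentationsCutLemmaHybridCuts.rank_le_of_colourDisjoint
    row col R t hdis hcut

/-- **N1 in the equidistant / bounded-spectrum regime** (`Theorems/…CutLemmaReciprocal`, p629412 + p629676; HADAMARD
CERTIFICATES, lead g6): if `D ⊙ E = 𝟙` with `D = ∑_j 1[cut_j] ∘ W_j` then `rank R ≤ rank E · t · ∑ rank W_j`; with `W_j = 𝟙`,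
`D` = Hamming-distance matrix and `E = 1/D`, so `rank R ≤ rank(1/d) · n · t`: the ADDITIVE conjecture (A) holds for colour-disjoint
blocks whose row–column distances are all equal (below), and `stub_cutLemma`'s RECT core holds with constant `(∑_{i<k}(2n)^i) · n`
when the distances take `k` values (`…CutLemmaReciprocal.rank_le_of_distSpectrum`).  The sharpenings (A+)/(A++) of
`Lines/rank-dehn-ladder-A-problem.md` §7–8 are FALSE (§9: n = 3 parity example); (A) itself stands. -/
theorem rect_equidistant {K : Type} [Field K] {n : ℕ} {ι ι' : Type} [Fintype ι] [Fintype ι']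
    (row : ι → Fin n → Bool) (col : ι' → Fin n → Bool) (e : ℕ) (heK : (e : K) ≠ 0)
    (he : ∀ x y, (Finset.univ.filter fun j : Fin n => row x j ≠ col y j).card = e) (R : Matrix ι ι' K) (t : ℕ)
    (hcut : ∀ j : Fin n, (Matrix.of fun x y => if row x j ≠ col y j then R x y else 0).rank ≤ t) :
    R.rank ≤ n * t :=
  Summit.PneNP.PneNP.Theorems.CnfIdealGenLengthRankDefectRepresentationsCutLemmaReciprocal.rank_le_of_equidistant
    row col e heK he R t hcut

/-- **N1 with constant `r ≤ n` for affinely separated colour classes** (`Theorems/…CutLemmaCharacterCover`, p631863 + p632086, lead g6,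
building on g2's character cuts p590086): if every column colour is `χ_T`-separated from ALL row colours by one of `r` characters — such a
cover exists iff no column colour lies in the `F_2`-affine hull of the row colours, with `r ≤ codim ≤ n` — then `rank R ≤ r · n · t`.  With
`…CutLemmaObstructions` (p631595: the pinching `R ∘ 1[row = col]` is NOT a valid `R'` — `J − I` has cuts of rank 2 and rank `2^n`) this
locates what is open in N1: the affinely ENTANGLED colour pairs (random colourings), where character partitions and hybrid certificates are
both exponential (`Lines/rank-dehn-ladder-A-problem.md` §10). -/
theorem rect_characterCover {K : Type} [Field K] {n : ℕ} {ι ι' : Type} [Fintype ι] [Fintype ι'] [DecidableEq ι] [DecidableEq ι']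
    (row : ι → Fin n → Bool) (col : ι' → Fin n → Bool) (R : Matrix ι ι' K) {r : ℕ} (T : Fin r → Finset (Fin n))
    (hcov : ∀ y : ι', ∃ l : Fin r, ∀ x : ι, Odd ((T l).filter fun j => row x j ≠ col y j).card) (t : ℕ)
    (hcut : ∀ j : Fin n, (Matrix.of fun x y => if row x j ≠ col y j then R x y else 0).rank ≤ t) :
    R.rank ≤ r * (n * t) :=
  Summit.PneNP.PneNP.Theorems.CnfIdealGenLengthRankDefectRepresentationsCutLemmaCharacterCover.rank_le_mul_of_characterCover
    row col R T hcov t hcut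

/-- **ADDITIVE DIST CONJECTURE** (lead g6, `Lines/rank-dehn-ladder-A-problem.md` §12; NOT registered, recorded as the recommended
primary target for N1): for EVERY colouring there is `R'` on the same-colour cells with `rank (R − R') ≤ ∑_j rank (cut_j R)` — additive,
constant one.  Consistent with all evidence (exhaustive n = 3 over F_2/F_3 in RECT form, kit climbs in dist form, `J − I`), and NOT implied
by or implying its RECT shadow (A) cheaply (dist ≥ maxRECT only).  Its natural reading: an operator whose commutators with `n` commuting
involutions have ranks `t_j` is within rank `∑ t_j` of their commutant. -/
def AdditiveDist : Prop :=
  ∀ (K : Type) [Field K] (n : ℕ) (ι ι' : Type) [Fintype ι] [Fintype ι']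
    (row : ι → Fin n → Bool) (col : ι' → Fin n → Bool) (R : Matrix ι ι' K),
    ∃ R' : Matrix ι ι' K, (∀ x y, row x ≠ col y → R' x y = 0) ∧
      (R - R').rank ≤ ∑ j : Fin n, (Matrix.of fun x y => if row x j ≠ col y j then R x y else 0).rank

/-- The additive dist conjecture settles the registered stub `stub_cutLemma` with `C = a = 1`. -/
theorem cutLemma_of_additiveDist (h : AdditiveDist) : CutLemma := by
  refine ⟨1, 1, fun K _ n ι ι' _ _ row col t R ht => ?_⟩
  obtain ⟨R', h1, h2⟩ := h K n ι ι' row col R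
  refine ⟨R', h1, h2.trans ?_⟩
  calc ∑ j : Fin n, (Matrix.of fun x y => if row x j ≠ col y j then R x y else 0).rank
      ≤ ∑ _j : Fin n, t := Finset.sum_le_sum fun j _ => ht j
    _ = n * t := by simp
    _ ≤ 1 * (n + 1) ^ 1 * t := by
        rw [one_mul, pow_one]; exact Nat.mul_le_mul_right _ (Nat.le_succ n)

/-! ## The negative composition: uniform stability refutes the crux -/

section Negative

variable {K : Type} [Field K] {n d : ℕ}

/-- `rank (A - B) ≤ rank A + rank B`. -/
theorem rank_sub_le' (A B : Matrix (Fin d) (Fin d) K) : (A - B).rank ≤ A.rank + B.rank := by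
  rw [sub_eq_add_neg]
  exact (rank_add_le A (-B)).trans (by rw [rank_neg_eq])

/-- The sorted product over the empty set is `1`. -/
theorem sortedProd_empty (U : Fin n → Matrix (Fin d) (Fin d) K) : sortedProd U ∅ = 1 := by
  simp [sortedProd]

/-- Filtering a duplicate-free list containing `i` by membership in `{i}` and multiplying gives `U i`. -/
theorem prod_map_filter_singleton (U : Fin n → Matrix (Fin d) (Fin d) K) (i : Fin n) :
    ∀ l : List (Fin n), l.Nodup → i ∈ l →
      ((l.filter (· ∈ ({i} : Finset (Fin n)))).map U).prod = U i
  | [], _, h => by simp at h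
  | a :: l, hnd, hmem => by
      classical
      rw [List.nodup_cons] at hnd
      by_cases hai : a = i
      · subst hai
        have hnil : l.filter (· ∈ ({a} : Finset (Fin n))) = [] := by
          rw [List.filter_eq_nil_iff]
          intro x hx
          have hxa : x ≠ a := fun h => hnd.1 (h ▸ hx)
          simpa using hxa
        rw [List.filter_cons_of_pos (by simp), List.map_cons, List.prod_cons, hnil]
        simp
      · have him : i ∈ l := by
          rcases List.mem_cons.mp hmem with h | h
          · exact absurd h.symm hai
          · exact h
        rw [List.filter_cons_of_neg (by simpa using hai)]
        exact prod_map_filter_singleton U i l hnd.2 him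

/-- The sorted product over a singleton is the letter itself. -/
theorem sortedProd_singleton (U : Fin n → Matrix (Fin d) (Fin d) K) (i : Fin n) : sortedProd U {i} = U i :=
  prod_map_filter_singleton U i (List.finRange n) (List.nodup_finRange n) (List.mem_finRange i)

end Negative

/-- **Uniform stability + sorting ⟹ polynomial stability of the Boolean/commutator presentation** (the hypothesis
`hST` of the landed `not_rankDefectRepresentations_of_polyStable`, with exponent `a + 3`). Route: exactify the
almost-idempotents (`exists_idempotent_near`, cost `≤ t`, commutators `≤ 5t`), pass to involutions `U_i = 1 - 2E_i`,
read the sorted products as a uniform `5n²t`-almost-homomorphism (sorting lemma), replace it by a genuine `π`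
(uniform stability), and return to idempotents `M'_i = (1 - π{i})/2`. -/
theorem polyStable_of_uniformStability (hU : UniformStability) (hS : SortingLemma) :
    ∃ a : ℕ, ∀ᶠ n : ℕ in atTop, ∀ (K : Type) [Field K] [CharZero K] (d t : ℕ)
      (M : Fin n → Matrix (Fin d) (Fin d) K),
      (∀ g : MonoidAlgebra K (FreeMonoid (Fin n)), IsAxiom g →
        (MonoidAlgebra.lift K (Matrix (Fin d) (Fin d) K) (FreeMonoid (Fin n)) (FreeMonoid.lift M) g).rank ≤ t) →
      ∃ M' : Fin n → Matrix (Fin d) (Fin d) K, (∀ i, M' i * M' i = M' i) ∧ (∀ i j, M' i * M' j = M' j * M' i) ∧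
        ∀ i, (M i - M' i).rank ≤ n ^ a * t := by
  obtain ⟨a, ha⟩ := hU
  refine ⟨a + 3, ?_⟩
  filter_upwards [ha, eventually_ge_atTop 6] with n hn hn6 K _ _ d t M hM
  classical
  -- Step 1: exact idempotents within rank `t`
  have hsq : ∀ i, (M i * M i - M i).rank ≤ t := fun i => by
    have := hM (X K i * X K i - X K i) (Or.inl ⟨i, rfl⟩)
    simpa [X] using this
  have hcm : ∀ i j, (M i * M j - M j * M i).rank ≤ t := fun i j => by
    by_cases hij : i = j
    · subst hij; simp
    · have := hM (X K i * X K j - X K j * X K i) (Or.inr ⟨i, j, hij, rfl⟩)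
      simpa [X] using this
  choose E hE hEM using fun i => exists_idempotent_near (M i)
  have hs : ∀ i, (M i - E i).rank ≤ t := fun i => (hEM i).trans (hsq i)
  have hs' : ∀ i, (E i - M i).rank ≤ t := fun i => by
    rw [← rank_neg_eq]; simpa using hs i
  have hcE : ∀ i j, (E i * E j - E j * E i).rank ≤ 5 * t := by
    intro i j
    have h1 : E i * E j - E j * E i
        = (M i * M j - M j * M i) + ((E i - M i) * E j + M i * (E j - M j))
          - ((E j - M j) * E i + M j * (E i - M i)) := by noncomm_ring
    rw [h1]
    have r0 := rank_sub_le' ((M i * M j - M j * M i) + ((E i - M i) * E j + M i * (E j - M j)))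
      ((E j - M j) * E i + M j * (E i - M i))
    have r1 := rank_add_le (M i * M j - M j * M i) ((E i - M i) * E j + M i * (E j - M j))
    have r2 := rank_add_le ((E i - M i) * E j) (M i * (E j - M j))
    have r3 := rank_add_le ((E j - M j) * E i) (M j * (E i - M i))
    have e1 := (Matrix.rank_mul_le_left (E i - M i) (E j)).trans (hs' i)
    have e2 := (Matrix.rank_mul_le_right (M i) (E j - M j)).trans (hs' j)
    have e3 := (Matrix.rank_mul_le_left (E j - M j) (E i)).trans (hs' j)
    have e4 := (Matrix.rank_mul_le_right (M j) (E i - M i)).trans (hs' i)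
    have e0 := hcm i j
    omega
  -- Step 2: involutions
  let U : Fin n → Matrix (Fin d) (Fin d) K := fun i => 1 - (2 : K) • E i
  have hU : ∀ i, U i * U i = 1 := by
    intro i
    show (1 - (2 : K) • E i) * (1 - (2 : K) • E i) = 1
    have h4 : ((2 : K) • E i) * ((2 : K) • E i) = (4 : K) • E i := by
      rw [smul_mul_smul_comm, hE i]; norm_num
    simp only [sub_mul, mul_sub, one_mul, mul_one, h4]
    module
  have hUc : ∀ i j, (U i * U j - U j * U i).rank ≤ 5 * t := by
    intro i j
    have h1 : U i * U j - U j * U i = (4 : K) • (E i * E j - E j * E i) := by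
      show (1 - (2 : K) • E i) * (1 - (2 : K) • E j) - (1 - (2 : K) • E j) * (1 - (2 : K) • E i) = _
      simp only [sub_mul, mul_sub, smul_mul_smul_comm, one_mul, mul_one, smul_sub]
      module
    rw [h1]
    refine le_trans ?_ (hcE i j)
    exact rank_smul_le _ _
  -- Step 3: the sorted products are a uniform almost-homomorphism
  have hρ0 : sortedProd U ∅ = 1 := sortedProd_empty U
  have hρ : ∀ S T : Finset (Fin n),
      (sortedProd U S * sortedProd U T - sortedProd U (symmDiff S T)).rank ≤ n * n * (5 * t) := by
    intro S T
    refine (hS K n d (5 * t) U hU hUc S T).trans ?_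
    have h1 : S.card ≤ n := by simpa using S.card_le_univ
    have h2 : T.card ≤ n := by simpa using T.card_le_univ
    exact Nat.mul_le_mul_right _ (Nat.mul_le_mul h1 h2)
  -- Step 4: uniform stability
  obtain ⟨π, hπ0, hπ, hdist⟩ := hn K d (n * n * (5 * t)) (sortedProd U) hρ0 hρ
  -- Step 5: back to idempotents
  have h2 : (2 : K) ≠ 0 := two_ne_zero
  have hπsq : ∀ i : Fin n, π {i} * π {i} = 1 := fun i => by
    rw [hπ, symmDiff_self]; simpa using hπ0
  refine ⟨fun i => (2 : K)⁻¹ • (1 - π {i}), fun i => ?_, fun i j => ?_, fun i => ?_⟩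
  · -- idempotent
    have key : (1 - π {i}) * (1 - π {i}) = (2 : K) • (1 - π {i}) := by
      simp only [sub_mul, mul_sub, one_mul, mul_one, hπsq i]
      module
    rw [smul_mul_smul_comm, key, smul_smul]
    congr 1
    rw [mul_assoc, inv_mul_cancel₀ h2, mul_one]
  · -- commuting
    rw [smul_mul_smul_comm, smul_mul_smul_comm]
    congr 1
    simp only [sub_mul, mul_sub, one_mul, mul_one, hπ, symmDiff_comm {j} {i}]
    abel
  · -- rank (M i - M' i) ≤ t + 5 n^{a+2} t ≤ n^{a+3} t
    have hEi : E i = (2 : K)⁻¹ • (1 - U i) := by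
      show E i = (2 : K)⁻¹ • (1 - (1 - (2 : K) • E i))
      rw [sub_sub_cancel, smul_smul, inv_mul_cancel₀ h2, one_smul]
    have hUi : U i = sortedProd U {i} := (sortedProd_singleton U i).symm
    have hdiff : M i - (2 : K)⁻¹ • (1 - π {i}) = (M i - E i) + (2 : K)⁻¹ • (π {i} - sortedProd U {i}) := by
      rw [hEi, ← hUi]; module
    rw [hdiff]
    refine (rank_add_le _ _).trans ?_
    have hr : ((2 : K)⁻¹ • (π {i} - sortedProd U {i})).rank ≤ n ^ a * (n * n * (5 * t)) := by
      refine le_trans (rank_smul_le _ _) ?_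
      rw [← rank_neg_eq, neg_sub]
      exact hdist {i}
    refine (Nat.add_le_add (hs i) hr).trans ?_
    have hle : t + n ^ a * (n * n * (5 * t)) = (1 + 5 * n ^ (a + 2)) * t := by ring
    rw [hle]
    refine Nat.mul_le_mul_right t ?_
    have hn1 : 1 ≤ n ^ (a + 2) := Nat.one_le_pow _ _ (by omega)
    calc 1 + 5 * n ^ (a + 2) ≤ 6 * n ^ (a + 2) := by omega
      _ ≤ n * n ^ (a + 2) := Nat.mul_le_mul_right _ hn6
      _ = n ^ (a + 3) := by ring

/-- **Finite stability for almost-representations** (from `stub_finiteStability` by exactification, constant `1 + 5·C_n`):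
for every `n` there is `C` such that every `t`-almost-representation on `n` letters is within coordinatewise rank `C · t` of a
genuine one.  (So the line's `C_n := sup dist/t` is a finite number for each `n`.) -/
theorem finiteStability_almostRep (h : FiniteStability) (n : ℕ) :
    ∃ C : ℕ, ∀ (K : Type) [Field K] [CharZero K] (d t : ℕ) (M : Fin n → Matrix (Fin d) (Fin d) K),
      AlmostRep M t → ∃ M' : Fin n → Matrix (Fin d) (Fin d) K, Genuine M' ∧ ∀ i, (M i - M' i).rank ≤ C * t := by
  obtain ⟨C, hC⟩ := h n
  refine ⟨1 + 5 * C, fun K _ _ d t M hM => ?_⟩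
  -- Step 1: exact idempotents within rank `t`, commutators `≤ 5t` (as in `polyStable_of_uniformStability`)
  have hsq : ∀ i, (M i * M i - M i).rank ≤ t := fun i => by
    have := hM (X K i * X K i - X K i) (Or.inl ⟨i, rfl⟩)
    simpa [X] using this
  have hcm : ∀ i j, (M i * M j - M j * M i).rank ≤ t := fun i j => by
    by_cases hij : i = j
    · subst hij; simp
    · have := hM (X K i * X K j - X K j * X K i) (Or.inr ⟨i, j, hij, rfl⟩)
      simpa [X] using this
  choose E hE hEM using fun i => exists_idempotent_near (M i)
  have hs : ∀ i, (M i - E i).rank ≤ t := fun i => (hEM i).trans (hsq i)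
  have hs' : ∀ i, (E i - M i).rank ≤ t := fun i => by
    rw [← rank_neg_eq]; simpa using hs i
  have hcE : ∀ i j, (E i * E j - E j * E i).rank ≤ 5 * t := by
    intro i j
    have h1 : E i * E j - E j * E i
        = (M i * M j - M j * M i) + ((E i - M i) * E j + M i * (E j - M j))
          - ((E j - M j) * E i + M j * (E i - M i)) := by noncomm_ring
    rw [h1]
    have r0 := rank_sub_le' ((M i * M j - M j * M i) + ((E i - M i) * E j + M i * (E j - M j)))
      ((E j - M j) * E i + M j * (E i - M i))
    have r1 := rank_add_le (M i * M j - M j * M i) ((E i - M i) * E j + M i * (E j - M j))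
    have r2 := rank_add_le ((E i - M i) * E j) (M i * (E j - M j))
    have r3 := rank_add_le ((E j - M j) * E i) (M j * (E i - M i))
    have e1 := (Matrix.rank_mul_le_left (E i - M i) (E j)).trans (hs' i)
    have e2 := (Matrix.rank_mul_le_right (M i) (E j - M j)).trans (hs' j)
    have e3 := (Matrix.rank_mul_le_left (E j - M j) (E i)).trans (hs' j)
    have e4 := (Matrix.rank_mul_le_right (M j) (E i - M i)).trans (hs' i)
    have e0 := hcm i j
    omega
  -- Step 2: finite stability of the exact tuple
  obtain ⟨E', hE'1, hE'2, hdist⟩ := hC K d (5 * t) E hE hcE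
  refine ⟨E', ⟨hE'1, hE'2⟩, fun i => ?_⟩
  have hsplit : M i - E' i = (M i - E i) + (E i - E' i) := by abel
  rw [hsplit]
  refine (rank_add_le _ _).trans ?_
  refine (Nat.add_le_add (hs i) (hdist i)).trans ?_
  have : t + C * (5 * t) = (1 + 5 * C) * t := by ring
  rw [this]

/-- **Uniform rank-stability of `Z_2^n` (poly constant) REFUTES the crux.** -/
theorem not_RankDefectRepresentations_of_uniformStability (h : Registered.stub_uniformStability) :
    ¬ Summit.PneNP.PneNP.Theses.CnfIdealGenLength.RankDefectRepresentations :=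
  not_rankDefectRepresentations_of_polyStable (polyStable_of_uniformStability h stub_sortingLemma)

/-! ## RESHAPE 5 (lead g9): the depth-2 consequence of the tool stubs — SIM is quasi-polynomially stable -/

section SimQuasiPoly

open Summit.PneNP.PneNP.Theorems.CnfIdealGenLengthRankDefectRepresentationsSimReduction (SimBound TwoFamilyCutLemma)
open Summit.PneNP.PneNP.Theorems.CnfIdealGenLengthRankDefectRepresentationsTwoFamilyCutDomination
  (DoubleMaxCutDecomposition twoFamilyCutLemma_of_decomposition)

/-- The two-family cut lemma is monotone in its constant. -/
theorem twoFamilyCutLemma_mono {K : Type} [Field K] {κ κ' : Type} {lam lam' : ℕ}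
    (h : TwoFamilyCutLemma K κ κ' lam) (hle : lam ≤ lam') : TwoFamilyCutLemma K κ κ' lam' := by
  intro ι ι' _ _ _ _ row col D s hs
  obtain ⟨SI, SJ, h1, h2, h3⟩ := h ι ι' row col D s hs
  exact ⟨SI, SJ, h1, h2, h3.trans (Nat.mul_le_mul_right _ hle)⟩

/-- The 2D max-cut decomposition with a polynomial constant gives the two-family cut lemma with a polynomial constant
(double cut domination, p653152). -/
theorem twoFamilyCutLemma_poly_of_doubleMaxCut
    (hD : ∃ L e : ℕ, ∀ (K : Type) [Field K] (n n' : ℕ), DoubleMaxCutDecomposition K n n' (L * (n + n' + 1) ^ e)) :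
    ∃ L e : ℕ, ∀ (K : Type) [Field K] (a b : ℕ), TwoFamilyCutLemma K (Fin a) (Fin b) (L * (a + b + 1) ^ e) := by
  obtain ⟨L, e, hD⟩ := hD
  refine ⟨L, e + 2, fun K _ a b => ?_⟩
  refine twoFamilyCutLemma_mono (twoFamilyCutLemma_of_decomposition (hD K a b)) ?_
  have ha : a ≤ a + b + 1 := by omega
  have hb : b ≤ a + b + 1 := by omega
  calc L * (a + b + 1) ^ e * a * b ≤ L * (a + b + 1) ^ e * (a + b + 1) * (a + b + 1) := by gcongr
    _ = L * (a + b + 1) ^ (e + 2) := by ring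

/-- **SIM IS QUASI-POLYNOMIALLY STABLE, GIVEN THE TOOL STUBS** (`stub_doubleMaxCutDecomposition`, `stub_simBoundQuasiPoly`,
`stub_simBoundMono`): `SimBound K (Fin n) (2^{c (log₂ n + 2)^2})`, i.e. constant `n^{O(log n)}`. -/
theorem simBound_quasiPoly_of_stubs :
    ∃ c : ℕ, ∀ (K : Type) [Field K] (n : ℕ), SimBound K (Fin n) (2 ^ (c * (Nat.log 2 n + 2) ^ 2)) := by
  obtain ⟨c, hc⟩ := stub_simBoundQuasiPoly (twoFamilyCutLemma_poly_of_doubleMaxCut stub_doubleMaxCutDecomposition)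
  refine ⟨c, fun K _ n => ?_⟩
  have hk : n ≤ 2 ^ (Nat.log 2 n + 1) := (Nat.lt_pow_succ_log_self (by norm_num) n).le
  have emb : Nonempty (Fin n ↪ Fin (2 ^ (Nat.log 2 n + 1))) := ⟨Fin.castLEEmb hk⟩
  have h := stub_simBoundMono K (Fin n) (Fin (2 ^ (Nat.log 2 n + 1))) (2 ^ (c * (Nat.log 2 n + 1 + 1) ^ 2))
    (2 ^ (c * (Nat.log 2 n + 2) ^ 2)) emb (le_of_eq (by ring_nf)) (hc K (Nat.log 2 n + 1))
  exact h

end SimQuasiPoly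



/-! ## RESHAPE 6 (lead g11): the ANCHOR METHOD — a class-independent (quadratic) 2D max-cut decomposition from two tool stubs
(full text: memo `Lines/rank-dehn-ladder-g11.md` and the g11 commits of this file).  A largest INVERTIBLE co-rectangular minor `(X₀,Y₀)` (size `r ≤ c`) extrapolates
`D` by the Schur complement `F := G · D[X₀,Y₀]⁻¹ · H` at every visible entry off four label strips of `≤ c` classes each (`stub_anchorExtrapolation`, p677763); the
residual is visibly supported on the strips, each a ONE-FAMILY instance completed by g7's 1D theorem (`stub_stripCompletion`, p677961).  Composition (sorry-free
below): `doubleMaxCut_quadratic_of_stubs` — all double cuts `≤ c` ⟹ `D = S_I + S_J + L`, `rank L ≤ c + 160·c²`, for every field and class structure (quadratic in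
`c`; the linear form is g16's constant-4 theorem).  P ≠ NP is not moved; F-N2 is a FRONTIER formal rung. -/

section AnchorMethod

open Summit.PneNP.PneNP.Theorems.CnfIdealGenLengthRankDefectRepresentationsTwoFamilyCutDomination
  (colourI colourJ maskJ doubleCut)

/-- TOOL stub (lead g11 RESHAPE 6) = ANCHOR EXTRAPOLATION: if all double bipartition cuts of `D` are `≤ c`, there are a matrix `F`
of rank `≤ c` and four label sets `PI, PI′` (first family) and `QJ, QJ′` (second family), each of size `≤ c`, such that `F` agrees
with `D` at every VISIBLE entry `(x,y)` (I-colours differ and J-colours differ) whose row has I-colour `∉ PI` and J-colour `∉ QJ` and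
whose column has I-colour `∉ PI′` and J-colour `∉ QJ′`.  (`F = G·M⁻¹·H` for a maximal invertible co-rectangular minor `M = D[X₀,Y₀]`;
`PI, QJ` = labels of `Y₀`, `PI′, QJ′` = labels of `X₀`; proof = maximality + Schur complement `Matrix.det_fromBlocks₁₁`.) [CLOSED — lead g11,
p677763 `Theorems/…AnchorExtrapolation`] -/
theorem stub_anchorExtrapolation :
    ∀ (K : Type) [Field K] (n n' : ℕ) (ι ι' : Type) [Fintype ι] [Fintype ι'] [DecidableEq ι] [DecidableEq ι']
      (row : ι → Fin n ⊕ Fin n' → Bool) (col : ι' → Fin n ⊕ Fin n' → Bool) (D : Matrix ι ι' K) (c : ℕ),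
      (∀ B B', doubleCut row col B B' D ≤ c) →
      ∃ (F : Matrix ι ι' K) (PI PI' : Finset (Fin n → Bool)) (QJ QJ' : Finset (Fin n' → Bool)),
        F.rank ≤ c ∧ PI.card ≤ c ∧ PI'.card ≤ c ∧ QJ.card ≤ c ∧ QJ'.card ≤ c ∧
        ∀ x y, colourI (row x) ≠ colourI (col y) → colourJ (row x) ≠ colourJ (col y) →
          colourI (row x) ∉ PI → colourJ (row x) ∉ QJ → colourI (col y) ∉ PI' → colourJ (col y) ∉ QJ' →
          F x y = D x y :=
  Summit.PneNP.PneNP.Theorems.CnfIdealGenLengthRankDefectRepresentationsAnchorExtrapolation.stub_anchorExtrapolation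

/-- TOOL stub (lead g11 RESHAPE 6) = STRIP COMPLETION: if all double bipartition cuts of `E` are `≤ c` and `E` VANISHES at every
visible entry off four label strips (`PI, QJ` for rows, `PI′, QJ′` for columns, each of `≤ m` classes), then some `L` of rank
`≤ 32·m·c` agrees with `E` at every visible entry.  (Each of the `≤ 4m` strips — rows of one I-class in `PI`; rows of one J-class in
`QJ` outside the `PI`-rows; columns of one I-class in `PI′` / one J-class in `QJ′` outside those, restricted to rows off the row strips —
is a one-family instance whose two bipartition-cut blocks are diagonal-masked double-cut blocks (`rank ≤ c` each), so
`exists_blockDiagonal_of_cuts_le` gives a piece of rank `≤ 8c` equal, on visible entries, to `E` masked to that strip; the pieces sum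
to `E` on visible entries.) [CLOSED — lead g11, p677961 `Theorems/…StripCompletion`] -/
theorem stub_stripCompletion :
    ∀ (K : Type) [Field K] (n n' : ℕ) (ι ι' : Type) [Fintype ι] [Fintype ι'] [DecidableEq ι] [DecidableEq ι']
      (row : ι → Fin n ⊕ Fin n' → Bool) (col : ι' → Fin n ⊕ Fin n' → Bool) (E : Matrix ι ι' K) (c m : ℕ)
      (PI PI' : Finset (Fin n → Bool)) (QJ QJ' : Finset (Fin n' → Bool)),
      (∀ B B', doubleCut row col B B' E ≤ c) →
      PI.card ≤ m → PI'.card ≤ m → QJ.card ≤ m → QJ'.card ≤ m →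
      (∀ x y, colourI (row x) ≠ colourI (col y) → colourJ (row x) ≠ colourJ (col y) →
          colourI (row x) ∉ PI → colourJ (row x) ∉ QJ → colourI (col y) ∉ PI' → colourJ (col y) ∉ QJ' →
          E x y = 0) →
      ∃ L : Matrix ι ι' K, L.rank ≤ 32 * m * c ∧
        ∀ x y, colourI (row x) ≠ colourI (col y) → colourJ (row x) ≠ colourJ (col y) → L x y = E x y :=
  Summit.PneNP.PneNP.Theorems.CnfIdealGenLengthRankDefectRepresentationsStripCompletion.stub_stripCompletion

variable {K : Type} [Field K] {n n' : ℕ} {ι ι' : Type} [Fintype ι] [Fintype ι'] [DecidableEq ι] [DecidableEq ι']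

/-- Visibility in the first family: some I-coordinate differs iff the I-colours differ. -/
theorem exists_ne_inl_iff (r : Fin n ⊕ Fin n' → Bool) (s : Fin n ⊕ Fin n' → Bool) :
    (∃ k, r (Sum.inl k) ≠ s (Sum.inl k)) ↔ colourI r ≠ colourI s := by
  constructor
  · rintro ⟨k, hk⟩ h
    exact hk (congrFun h k)
  · intro h
    by_contra hne
    push Not at hne
    exact h (funext fun k => hne k)

/-- Visibility in the second family: some J-coordinate differs iff the J-colours differ. -/
theorem exists_ne_inr_iff (r : Fin n ⊕ Fin n' → Bool) (s : Fin n ⊕ Fin n' → Bool) :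
    (∃ k, r (Sum.inr k) ≠ s (Sum.inr k)) ↔ colourJ r ≠ colourJ s := by
  constructor
  · rintro ⟨k, hk⟩ h
    exact hk (congrFun h k)
  · intro h
    by_contra hne
    push Not at hne
    exact h (funext fun k => hne k)

omit [DecidableEq ι'] in
/-- The two summands of a double cut are subadditive in the matrix: `doubleCut (D - F) ≤ doubleCut D + doubleCut F`. -/
theorem doubleCut_sub_le (row : ι → Fin n ⊕ Fin n' → Bool) (col : ι' → Fin n ⊕ Fin n' → Bool)
    (B : Finset (Fin n → Bool)) (B' : Finset (Fin n' → Bool)) (D F : Matrix ι ι' K) :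
    doubleCut row col B B' (D - F) ≤ doubleCut row col B B' D + doubleCut row col B B' F := by
  classical
  have hJ : maskJ row col B' (D - F) = maskJ row col B' D - maskJ row col B' F := by
    ext x y; simp only [maskJ, Matrix.of_apply, Matrix.sub_apply]; split_ifs <;> simp
  unfold doubleCut
  set MD1 : Matrix ι ι' K :=
    Matrix.of fun x y => if colourI (row x) ∈ B ∧ colourI (col y) ∉ B then maskJ row col B' D x y else 0 with hMD1
  set MF1 : Matrix ι ι' K :=
    Matrix.of fun x y => if colourI (row x) ∈ B ∧ colourI (col y) ∉ B then maskJ row col B' F x y else 0 with hMF1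
  set MD2 : Matrix ι ι' K :=
    Matrix.of fun x y => if colourI (row x) ∉ B ∧ colourI (col y) ∈ B then maskJ row col B' D x y else 0 with hMD2
  set MF2 : Matrix ι ι' K :=
    Matrix.of fun x y => if colourI (row x) ∉ B ∧ colourI (col y) ∈ B then maskJ row col B' F x y else 0 with hMF2
  have h1 : (Matrix.of fun x y =>
        if colourI (row x) ∈ B ∧ colourI (col y) ∉ B then maskJ row col B' (D - F) x y else 0) = MD1 - MF1 := by
    ext x y; simp only [hMD1, hMF1, hJ, Matrix.of_apply, Matrix.sub_apply]; split_ifs <;> simp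
  have h2 : (Matrix.of fun x y =>
        if colourI (row x) ∉ B ∧ colourI (col y) ∈ B then maskJ row col B' (D - F) x y else 0) = MD2 - MF2 := by
    ext x y; simp only [hMD2, hMF2, hJ, Matrix.of_apply, Matrix.sub_apply]; split_ifs <;> simp
  rw [h1, h2]
  have e1 := Summit.PneNP.PneNP.Theorems.CnfIdealGenLengthRankDefectRepresentationsMergeLowerBound.rank_sub_le' MD1 MF1
  have e2 := Summit.PneNP.PneNP.Theorems.CnfIdealGenLengthRankDefectRepresentationsMergeLowerBound.rank_sub_le' MD2 MF2
  omega

/-- A 0/1-row-and-column masking of a matrix is a sandwich between two diagonal matrices, so its rank does not exceed that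
of the matrix. -/
theorem rank_mask_le' (pr : ι → Prop) (pc : ι' → Prop) [DecidablePred pr] [DecidablePred pc] (M : Matrix ι ι' K) :
    (Matrix.of fun x y => if pr x ∧ pc y then M x y else 0).rank ≤ M.rank := by
  classical
  have h : (Matrix.of fun x y => if pr x ∧ pc y then M x y else 0) =
      Matrix.diagonal (fun x => if pr x then (1 : K) else 0) * M * Matrix.diagonal (fun y => if pc y then (1 : K) else 0) := by
    ext x y
    simp only [Matrix.of_apply, Matrix.diagonal_mul, Matrix.mul_diagonal]
    by_cases h1 : pr x <;> by_cases h2 : pc y <;> simp [h1, h2]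
  rw [h]
  exact (Matrix.rank_mul_le_left _ _).trans (Matrix.rank_mul_le_right _ _)

/-- Each summand of a double cut of `F` is a sum of two maskings of `F`, so `doubleCut F ≤ 4 · rank F`. -/
theorem doubleCut_le_four_mul_rank (row : ι → Fin n ⊕ Fin n' → Bool) (col : ι' → Fin n ⊕ Fin n' → Bool)
    (B : Finset (Fin n → Bool)) (B' : Finset (Fin n' → Bool)) (F : Matrix ι ι' K) :
    doubleCut row col B B' F ≤ 4 * F.rank := by
  classical
  unfold doubleCut
  have split : ∀ (pr : ι → Prop) (pc : ι' → Prop) [DecidablePred pr] [DecidablePred pc],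
      (Matrix.of fun x y => if pr x ∧ pc y then maskJ row col B' F x y else 0).rank ≤ 2 * F.rank := by
    intro pr pc _ _
    have e : (Matrix.of fun x y => if pr x ∧ pc y then maskJ row col B' F x y else 0) =
        (Matrix.of fun x y => if (pr x ∧ colourJ (row x) ∈ B') ∧ (pc y ∧ colourJ (col y) ∉ B') then F x y else 0) +
        (Matrix.of fun x y => if (pr x ∧ colourJ (row x) ∉ B') ∧ (pc y ∧ colourJ (col y) ∈ B') then F x y else 0) := by
      ext x y
      simp only [maskJ, Matrix.of_apply, Matrix.add_apply]
      by_cases h1 : pr x <;> by_cases h2 : pc y <;> by_cases h3 : colourJ (row x) ∈ B' <;>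
        by_cases h4 : colourJ (col y) ∈ B' <;> simp [h1, h2, h3, h4]
    rw [e, two_mul]
    exact (Summit.PneNP.PneNP.Theorems.CnfIdealGenLengthRankDefectRepresentationsMergeLowerBound.rank_add_le' _ _).trans (Nat.add_le_add (rank_mask_le' _ _ F) (rank_mask_le' _ _ F))
  have a1 := split (fun x => colourI (row x) ∈ B) (fun y => colourI (col y) ∉ B)
  have a2 := split (fun x => colourI (row x) ∉ B) (fun y => colourI (col y) ∈ B)
  omega

/-- **THE 2D MAX-CUT DECOMPOSITION WITH A CLASS-INDEPENDENT (QUADRATIC) CONSTANT, GIVEN THE TWO TOOL STUBS**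
(`stub_anchorExtrapolation`, `stub_stripCompletion`): all double bipartition cuts `≤ c` ⟹ `D = S_I + S_J + L` with
`rank L ≤ c + 160 c²`, for every field and every class structure. -/
theorem doubleMaxCut_quadratic_of_stubs (K : Type) [Field K] (n n' : ℕ) (ι ι' : Type) [Fintype ι] [Fintype ι']
    [DecidableEq ι] [DecidableEq ι']
    (row : ι → Fin n ⊕ Fin n' → Bool) (col : ι' → Fin n ⊕ Fin n' → Bool) (D : Matrix ι ι' K) (c : ℕ)
    (hc : ∀ B B', doubleCut row col B B' D ≤ c) :
    ∃ SI SJ : Matrix ι ι' K,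
      (∀ x y, (∃ k, row x (Sum.inl k) ≠ col y (Sum.inl k)) → SI x y = 0) ∧
      (∀ x y, (∃ k', row x (Sum.inr k') ≠ col y (Sum.inr k')) → SJ x y = 0) ∧
      (D - SI - SJ).rank ≤ c + 160 * c ^ 2 := by
  classical
  obtain ⟨F, PI, PI', QJ, QJ', hF, hPI, hPI', hQJ, hQJ', hagree⟩ :=
    stub_anchorExtrapolation K n n' ι ι' row col D c hc
  -- the residual has double cuts ≤ 5c and vanishes at the visible entries off the strips
  have hE : ∀ B B', doubleCut row col B B' (D - F) ≤ 5 * c := by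
    intro B B'
    have h1 := doubleCut_sub_le row col B B' D F
    have h2 := doubleCut_le_four_mul_rank row col B B' F
    have h3 := hc B B'
    have h4 : 4 * F.rank ≤ 4 * c := Nat.mul_le_mul_left 4 hF
    omega
  have hvan : ∀ x y, colourI (row x) ≠ colourI (col y) → colourJ (row x) ≠ colourJ (col y) →
      colourI (row x) ∉ PI → colourJ (row x) ∉ QJ → colourI (col y) ∉ PI' → colourJ (col y) ∉ QJ' →
      (D - F) x y = 0 := by
    intro x y h1 h2 h3 h4 h5 h6
    rw [Matrix.sub_apply, hagree x y h1 h2 h3 h4 h5 h6, sub_self]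
  obtain ⟨L, hL, hLagree⟩ :=
    stub_stripCompletion K n n' ι ι' row col (D - F) (5 * c) c PI PI' QJ QJ' hE hPI hPI' hQJ hQJ' hvan
  -- the leftover `N := D - F - L` vanishes at every visible entry; split it into an I-agree and a J-agree part
  set N : Matrix ι ι' K := D - F - L with hN
  refine ⟨Matrix.of fun x y => if colourI (row x) = colourI (col y) then N x y else 0,
    Matrix.of fun x y => if colourI (row x) ≠ colourI (col y) then N x y else 0, ?_, ?_, ?_⟩
  · intro x y hk
    have h : colourI (row x) ≠ colourI (col y) := (exists_ne_inl_iff (row x) (col y)).1 hk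
    simp [h]
  · intro x y hk
    have hJ : colourJ (row x) ≠ colourJ (col y) := (exists_ne_inr_iff (row x) (col y)).1 hk
    by_cases hI : colourI (row x) = colourI (col y)
    · simp [hI]
    · have : N x y = 0 := by
        rw [hN, Matrix.sub_apply, hLagree x y hI hJ, sub_self]
      simp [this]
  · have hdec : D - (Matrix.of fun x y => if colourI (row x) = colourI (col y) then N x y else 0) -
        (Matrix.of fun x y => if colourI (row x) ≠ colourI (col y) then N x y else 0) = F + L := by
      ext x y
      simp only [hN, Matrix.sub_apply, Matrix.add_apply, Matrix.of_apply]
      by_cases h : colourI (row x) = colourI (col y)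
      · rw [if_pos h, if_neg (fun hne => hne h)]; ring
      · rw [if_neg h, if_pos h]; ring
    rw [hdec]
    calc (F + L).rank ≤ F.rank + L.rank := Summit.PneNP.PneNP.Theorems.CnfIdealGenLengthRankDefectRepresentationsMergeLowerBound.rank_add_le' F L
      _ ≤ c + 32 * c * (5 * c) := Nat.add_le_add hF hL
      _ = c + 160 * c ^ 2 := by ring

end AnchorMethod

/-! ## RESHAPE 17 (lead g17, 2026-08-29): the Σ-CURRENCY lane towards POLYNOMIAL SIM

After g16 the SIM gluing problem (`…SimReduction.SimBound`, the depth-2 core of N0b) is quasi-polynomially stable (`simBound_quasiPoly`,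
p719105) and — new, `Theorems/…SimLowerBound` p722109 (lead g17) — AT BEST LINEARLY stable in its own currency: `SimBound K (Fin n) C → n ≤ 2C+1`
(one-sided witness: one column per coordinate pair).  The halving recursion compounds in every currency (each half's error is charged against
every coordinate of the other half), so polynomial SIM needs a one-shot argument.  The currency in which an ABSOLUTE constant is still
consistent with everything known is the SUM currency:

  **Σ-SIM (`SigmaSim`).**  `∃ z, Σ_k rank (cut k (z − y_k)) ≤ λ(n) · Σ_{k,l} rank (cut k (cut l (y_k − y_l)))`.

The lower-bound witness forces only `λ ≥ 1/2` (double sum counts each pair twice); one-sided instances (all rows one colour) achieve it by the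
selection rule `z := y_{min Diff}` (`stub_oneSidedSim`, TRUE); selection rules are exponentially bad in general (the `cut_n J` instance of the
g17 notes), so Σ-SIM is a COMPLETION statement like g16's.  Registered here:
* `stub_sigmaSim` (OPEN — the lead's): Σ-SIM with `λ(n) = (n+1)^c` (polynomial).  PROVED below: `simBound_poly_of_sigmaSim` — it gives
  POLYNOMIAL SIM, `SimBound K (Fin n) ((n+1)^(c+2))`.  The absolute form `SigmaSimAbs lam` is recorded as the natural strengthening for the
  disprover (smallest open case: `n = 3`, is `λ = 1` — i.e. total error ≤ t₁₂+t₁₃+t₂₃ — attainable?).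
* `stub_oneSidedSim` (TRUE, worker-sized): constant row colouring ⇒ for every `k`, `rank (cut k (z − y_k)) ≤ Σ_l rank (cut k (cut l (y_k − y_l)))`
  for the selection `z`; with `…SimLowerBound` this pins ONE-SIDED SIM at `Θ(n)` exactly and Σ-one-sided at `λ = 1`.
* `stub_sigmaSimThree` (TRUE, worker-sized): `n = 3`: the sequential scheme `z := y₀ + EQ₀ y₁ + EQ₀EQ₁ y₂` costs
  `≤ 3·t₀₁ + 3·t₀₂ + t₁₂` (errors `0`, `e₀₁`, `e₀₂ + EQ₀ e₁₂` and the cocycle mask bound below).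
Tool PROVED here (no stub): the COCYCLE MASK BOUND `rank (cut m (cut k (cut l (y_k − y_l)))) ≤ 2·rank (cut k (cut m (y_k − y_m))) +
2·rank (cut m (cut l (y_m − y_l)))` (`rank_tripleCut_le`) — masking a pairwise defect INTO a third cut costs only the two adjacent defects,
hence masking it OUT of a third cut (`EQ_m`) costs `≤ t_kl + 2t_km + 2t_ml` (`rank_eqMask_le`).
Open registered stubs: superpoly/tautologyInstability, uniformStability (crux-sized), sigmaSim (the lead's); TRUE worker stubs oneSidedSim,
sigmaSimThree.  P ≠ NP is not moved; F-N2 is a FRONTIER formal rung. -/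

section SigmaSim

open Summit.PneNP.PneNP.Theorems.CnfIdealGenLengthRankDefectRepresentationsSimReduction (cut cut_sub cut_comm rank_cut_le SimBound)

/-- **Σ-SIM with constant function `lam`**: every SIM instance on `Fin n` is glued with TOTAL error at most `lam n` times the TOTAL pairwise
defect (double sum over ordered pairs, diagonal terms vanish). -/
def SigmaSimWith (lam : ℕ → ℕ) : Prop :=
  ∀ (K : Type) [Field K] (n : ℕ) (ι ι' : Type) [Fintype ι] [Fintype ι'] [DecidableEq ι] [DecidableEq ι']
    (row : ι → Fin n → Bool) (col : ι' → Fin n → Bool) (y : Fin n → Matrix ι ι' K),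
    (∀ k, cut row col k (y k) = y k) →
    ∃ z : Matrix ι ι' K, ∑ k, (cut row col k (z - y k)).rank ≤
      lam n * ∑ k, ∑ l, (cut row col k (cut row col l (y k - y l))).rank

/-- Σ-SIM with a POLYNOMIAL constant (the registered stub `stub_sigmaSim`). -/
def SigmaSim : Prop := ∃ c : ℕ, SigmaSimWith fun n => (n + 1) ^ c

/-- Σ-SIM with an ABSOLUTE constant `lam` (the natural strengthening; the disprover's target — smallest open case `n = 3`, `lam = 1`). -/
def SigmaSimAbs (lam : ℕ) : Prop := SigmaSimWith fun _ => lam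

/-- NEW registered stub (lead g17, OPEN — the lead's): **Σ-SIM with a polynomial constant**, unfolded. -/
theorem stub_sigmaSim :
    ∃ c : ℕ, ∀ (K : Type) [Field K] (n : ℕ) (ι ι' : Type) [Fintype ι] [Fintype ι'] [DecidableEq ι] [DecidableEq ι']
      (row : ι → Fin n → Bool) (col : ι' → Fin n → Bool) (y : Fin n → Matrix ι ι' K),
      (∀ k, Summit.PneNP.PneNP.Theorems.CnfIdealGenLengthRankDefectRepresentationsSimReduction.cut row col k (y k) = y k) →
      ∃ z : Matrix ι ι' K,
        ∑ k, (Summit.PneNP.PneNP.Theorems.CnfIdealGenLengthRankDefectRepresentationsSimReduction.cut row col k (z - y k)).rank ≤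
          (n + 1) ^ c * ∑ k, ∑ l, (Summit.PneNP.PneNP.Theorems.CnfIdealGenLengthRankDefectRepresentationsSimReduction.cut row col k
            (Summit.PneNP.PneNP.Theorems.CnfIdealGenLengthRankDefectRepresentationsSimReduction.cut row col l (y k - y l))).rank := by
  sorry

/-- Registered stub (lead g17, TRUE) — CLOSED by bench W21, p723862 `Theorems/…OneSidedSim`: **one-sided SIM** — with a CONSTANT row colouring the selection rule glues with
per-coordinate error at most the sum of that coordinate's pairwise defects (hence `C ≤ n − 1` in the `SimBound` currency and `λ = 1` in the
Σ-currency; tight by `…SimLowerBound`). -/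
theorem stub_oneSidedSim :
    ∀ (K : Type) [Field K] (n : ℕ) (ι ι' : Type) [Fintype ι] [Fintype ι'] [DecidableEq ι] [DecidableEq ι']
      (r : Fin n → Bool) (col : ι' → Fin n → Bool) (y : Fin n → Matrix ι ι' K),
      (∀ k, Summit.PneNP.PneNP.Theorems.CnfIdealGenLengthRankDefectRepresentationsSimReduction.cut (fun _ => r) col k (y k) = y k) →
      ∃ z : Matrix ι ι' K, ∀ k,
        (Summit.PneNP.PneNP.Theorems.CnfIdealGenLengthRankDefectRepresentationsSimReduction.cut (fun _ => r) col k (z - y k)).rank ≤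
          ∑ l, (Summit.PneNP.PneNP.Theorems.CnfIdealGenLengthRankDefectRepresentationsSimReduction.cut (fun _ => r) col k
            (Summit.PneNP.PneNP.Theorems.CnfIdealGenLengthRankDefectRepresentationsSimReduction.cut (fun _ => r) col l (y k - y l))).rank :=
  Summit.PneNP.PneNP.Theorems.CnfIdealGenLengthRankDefectRepresentationsOneSidedSim.stub_oneSidedSim

/-- Registered stub (lead g17, TRUE) — CLOSED by bench W22, p723784 `Theorems/…SigmaSimThree`: **Σ-SIM for three coordinates** by the sequential scheme
`z := y₀ + EQ₀ y₁ + EQ₀ EQ₁ y₂` (`EQ_k M := M − cut k M`): total error `≤ 3 t₀₁ + 3 t₀₂ + t₁₂`. -/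
theorem stub_sigmaSimThree :
    ∀ (K : Type) [Field K] (ι ι' : Type) [Fintype ι] [Fintype ι'] [DecidableEq ι] [DecidableEq ι']
      (row : ι → Fin 3 → Bool) (col : ι' → Fin 3 → Bool) (y : Fin 3 → Matrix ι ι' K),
      (∀ k, Summit.PneNP.PneNP.Theorems.CnfIdealGenLengthRankDefectRepresentationsSimReduction.cut row col k (y k) = y k) →
      ∃ z : Matrix ι ι' K,
        ∑ k, (Summit.PneNP.PneNP.Theorems.CnfIdealGenLengthRankDefectRepresentationsSimReduction.cut row col k (z - y k)).rank ≤
          3 * (Summit.PneNP.PneNP.Theorems.CnfIdealGenLengthRankDefectRepresentationsSimReduction.cut row col 0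
                (Summit.PneNP.PneNP.Theorems.CnfIdealGenLengthRankDefectRepresentationsSimReduction.cut row col 1 (y 0 - y 1))).rank +
          3 * (Summit.PneNP.PneNP.Theorems.CnfIdealGenLengthRankDefectRepresentationsSimReduction.cut row col 0
                (Summit.PneNP.PneNP.Theorems.CnfIdealGenLengthRankDefectRepresentationsSimReduction.cut row col 2 (y 0 - y 2))).rank +
          (Summit.PneNP.PneNP.Theorems.CnfIdealGenLengthRankDefectRepresentationsSimReduction.cut row col 1
                (Summit.PneNP.PneNP.Theorems.CnfIdealGenLengthRankDefectRepresentationsSimReduction.cut row col 2 (y 1 - y 2))).rank :=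
  Summit.PneNP.PneNP.Theorems.CnfIdealGenLengthRankDefectRepresentationsSigmaSimThree.stub_sigmaSimThree

/-- Registered stub (lead g17 RESHAPE 17b) — CLOSED by bench W23, p724983 `Theorems/…ObliviousNoGo` (11 min): **NO COLOUR-OBLIVIOUS LINEAR GLUING RULE IS POLYNOMIAL.**
A colour-oblivious linear rule glues `z(x,y') := Σ_{m ∈ σ△τ} α_m(σ,τ) · y_m(x,y')` with weights depending only on the row colour `σ` and the column colour
`τ`, `Σ_{m∈σ△τ} α_m(σ,τ) = 1`; its error `cut_k (z − y_k)` is `Σ_m (β_m ∘ C_k) ∘ (y_m − y_k)` with `β_m := α_m ∘ 1[σ_m ≠ τ_m]` (a matrix on colour space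
supported on the `m`-cut pattern, `Σ_m β_m = J − I`), so its cost is governed by the pattern ranks `rank (β_m ∘ 1[σ_k ≠ τ_k])`, `k ≠ m` (and on generic
rank-one data `y_m = cut_m J_m` the rule costs at least that much while `T = O(n²)`).  THIS STUB: those pattern ranks cannot all be `≤ r` unless
`2^n ≤ 16 n² r + 2` — every such rule (every priority order, tournament, average, signed combination, with weights as clever as one likes) is EXPONENTIAL.
Proof (memo `Lines/rank-dehn-ladder-g17.md` §3): the tree's cut lemma (`…CutLemma.exists_blockDiagonal_of_maxCut` + cut domination) on `β_m` with the colour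
coordinates `j ≠ m` splits `β_m = S_m + L_m`, `S_m` supported on `{σ△τ ⊆ {m}}`, `rank L_m ≤ 4 n r`; `L_m` is DIAGONAL on each half `{σ_m = τ_m = b}`, so
`#{σ : L_m(σ,σ) ≠ 0} ≤ 2 rank L_m`; `Σ_m L_m = J − Λ − H` with `H` supported on Hamming-distance-1 pairs and `Λ` diagonal with `Λ_σσ ≠ 0` off
`≤ 2Σ_m rank L_m` colours; within a parity class of `{0,1}^n` the matrix `Λ + H` is diagonal, so `rank (Λ + H) ≥ (2^n − 2Σ_m rank L_m)/2`, while
`rank (Σ_m L_m) ≥ rank (Λ + H) − 1`. -/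
theorem stub_obliviousNoGo :
    ∀ (K : Type) [Field K] (n r : ℕ) (β : Fin n → Matrix (Fin n → Bool) (Fin n → Bool) K),
      (∀ m σ τ, σ m = τ m → β m σ τ = 0) →
      (∀ σ τ, σ ≠ τ → ∑ m, β m σ τ = 1) →
      (∀ m k, m ≠ k → (Matrix.of fun σ τ => if σ k ≠ τ k then β m σ τ else 0).rank ≤ r) →
      2 ^ n ≤ 16 * n ^ 2 * r + 2 :=
  Summit.PneNP.PneNP.Theorems.CnfIdealGenLengthRankDefectRepresentationsObliviousNoGo.stub_obliviousNoGo

/-- Registered stub (lead g17 RESHAPE 17c) — CLOSED by bench W24, p726175 `Theorems/…TwoStepLink`: **THE TWO-STEP LINK — a SIM glue is a genuine representation near a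
two-step almost-representation** (g8 §6, so far only on paper).  For diagonal 0/1 tuples `P_i` (colouring `α` of the `A`-basis) and `Q_i` (colouring `β` of the
`B`-basis) and off-diagonal blocks `X_i` supported on the cells where the two colours differ, the block-triangular matrices `E_i = [[P_i, X_i],[0, Q_i]]` are
idempotents whose commutators are `[[0, P_iX_j + X_iQ_j − P_jX_i − X_jQ_i],[0,0]]`; conjugating the diagonal tuple by `[[1, −Z],[0, 1]]` gives the GENUINE tuple
`E'_i = [[P_i, P_iZ − ZQ_i],[0,Q_i]]`, and `E_i − E'_i = [[0, X_i − (P_iZ − ZQ_i)],[0,0]]`, whose rank is the rank of the `i`-cut error of the glue `Z` against the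
(sign-twisted) data.  So `dist(E) ≤` the SIM cost of the best glue: polynomial SIM ⟹ polynomial rank-stability of the depth-2 class WITHIN ITS SHAPE. -/
theorem stub_twoStepLink :
    ∀ (K : Type) [Field K] (n : ℕ) (ιA ιB : Type) [Fintype ιA] [Fintype ιB] [DecidableEq ιA] [DecidableEq ιB]
      (α : ιA → Fin n → Bool) (β : ιB → Fin n → Bool) (X : Fin n → Matrix ιA ιB K) (Z : Matrix ιA ιB K),
      (∀ i a b, α a i = β b i → X i a b = 0) →
      ∃ E' : Fin n → Matrix (ιA ⊕ ιB) (ιA ⊕ ιB) K,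
        (∀ i, E' i * E' i = E' i) ∧ (∀ i j, E' i * E' j = E' j * E' i) ∧
        ∀ i, (Matrix.fromBlocks (Matrix.diagonal fun a => if α a i then (1 : K) else 0) (X i) 0
                (Matrix.diagonal fun b => if β b i then (1 : K) else 0) - E' i).rank ≤
          (Matrix.of fun a b => if α a i ≠ β b i then X i a b - (if α a i then Z a b else -Z a b) else 0).rank :=
  Summit.PneNP.PneNP.Theorems.CnfIdealGenLengthRankDefectRepresentationsTwoStepLink.stub_twoStepLink

/-- Registered stub (lead g17 RESHAPE 17c) — CLOSED by bench W25, p726204 `Theorems/…DefectShallow`: **PAIRWISE DEFECTS ARE SHALLOW UP TO RANK `O(n·t)`.**  By the cocycle identity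
`cut_j e_kl = cut_l e_kj + cut_k e_jl` every coordinate cut (`j ∉ {k,l}`) of the defect `e_kl = cut_k cut_l (y_k − y_l)` has rank `≤ 4t`, so the tree's cut lemma
(`…CutLemma`, constants `4(n+1)`) puts `e_kl` within rank `64 (n+1) t` of a matrix supported on the HAMMING-2 cells of its own type (all colours other than
`k, l` agree, `k` and `l` differ).  (Selection glues such "pure pair" cocycles at cost ≤ their total rank; what is left of a defect is LOW RANK but spread.) -/
theorem stub_defectShallow :
    ∀ (K : Type) [Field K] (n : ℕ) (ι ι' : Type) [Fintype ι] [Fintype ι'] [DecidableEq ι] [DecidableEq ι']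
      (row : ι → Fin n → Bool) (col : ι' → Fin n → Bool) (y : Fin n → Matrix ι ι' K) (t : ℕ) (k l : Fin n),
      (∀ i j, (Summit.PneNP.PneNP.Theorems.CnfIdealGenLengthRankDefectRepresentationsSimReduction.cut row col i (Summit.PneNP.PneNP.Theorems.CnfIdealGenLengthRankDefectRepresentationsSimReduction.cut row col j (y i - y j))).rank ≤ t) →
      ∃ S : Matrix ι ι' K,
        (∀ x x', (row x k = col x' k ∨ row x l = col x' l ∨ ∃ j, j ≠ k ∧ j ≠ l ∧ row x j ≠ col x' j) → S x x' = 0) ∧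
        (Summit.PneNP.PneNP.Theorems.CnfIdealGenLengthRankDefectRepresentationsSimReduction.cut row col k (Summit.PneNP.PneNP.Theorems.CnfIdealGenLengthRankDefectRepresentationsSimReduction.cut row col l (y k - y l)) - S).rank ≤ 64 * (n + 1) * t :=
  Summit.PneNP.PneNP.Theorems.CnfIdealGenLengthRankDefectRepresentationsDefectShallow.stub_defectShallow

/-- `stub_sigmaSim` is literally `SigmaSim`. -/
theorem sigmaSim_of_stub : SigmaSim := stub_sigmaSim

/-- **THE SIM CONSTANT IS AT LEAST LINEAR** (lead g17, `Theorems/…SimLowerBound`, p722109): `SimBound K (Fin n) C → n ≤ 2C + 1`. -/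
theorem simBound_linear_lower (K : Type) [Field K] (n C : ℕ) (h : SimBound K (Fin n) C) : n ≤ 2 * C + 1 :=
  Summit.PneNP.PneNP.Theorems.CnfIdealGenLengthRankDefectRepresentationsSimLowerBound.simBound_linear_lower K n C h

variable {K : Type} [Field K]

/-- Cuts are idempotent. -/
theorem cut_cut_self {ι ι' κ : Type} (row : ι → κ → Bool) (col : ι' → κ → Bool) (k : κ) (M : Matrix ι ι' K) :
    cut row col k (cut row col k M) = cut row col k M := by
  ext x y; simp only [cut, Matrix.of_apply]; split_ifs <;> rfl

/-- Cuts are additive. -/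
theorem cut_add {ι ι' κ : Type} (row : ι → κ → Bool) (col : ι' → κ → Bool) (k : κ) (M N : Matrix ι ι' K) :
    cut row col k (M + N) = cut row col k M + cut row col k N := by
  ext x y; simp only [cut, Matrix.of_apply, Matrix.add_apply]; split_ifs <;> simp

/-- **COCYCLE MASK BOUND (into a third cut).**  `cut m (cut k (cut l (y_k − y_l))) = cut l (cut k cut m (y_k − y_m)) + cut k (cut m cut l (y_m − y_l))`,
so its rank is at most twice the sum of the two adjacent defects. -/
theorem rank_tripleCut_le {ι ι' κ : Type} [Fintype ι] [Fintype ι'] [DecidableEq ι] [DecidableEq ι']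
    (row : ι → κ → Bool) (col : ι' → κ → Bool) (y : κ → Matrix ι ι' K) (k l m : κ) :
    (cut row col m (cut row col k (cut row col l (y k - y l)))).rank ≤
      2 * (cut row col k (cut row col m (y k - y m))).rank + 2 * (cut row col m (cut row col l (y m - y l))).rank := by
  have hsplit : y k - y l = (y k - y m) + (y m - y l) := by abel
  have e : cut row col m (cut row col k (cut row col l (y k - y l))) =
      cut row col l (cut row col k (cut row col m (y k - y m))) + cut row col k (cut row col m (cut row col l (y m - y l))) := by
    rw [hsplit, cut_add, cut_add, cut_add]
    congr 1
    · rw [cut_comm row col k l, cut_comm row col m l, cut_comm row col m k]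
    · rw [cut_comm row col m k]
  rw [e]
  refine (Summit.PneNP.PneNP.Theorems.CnfIdealGenLengthRankDefectRepresentationsMergeLowerBound.rank_add_le' _ _).trans ?_
  exact Nat.add_le_add (rank_cut_le row col l _) (rank_cut_le row col k _)

/-- **COCYCLE MASK BOUND (out of a third cut).**  Removing the `m`-cut part of the `(k,l)` defect costs at most the two adjacent defects:
`rank (e_kl − cut m e_kl) ≤ t_kl + 2 t_km + 2 t_ml`. -/
theorem rank_eqMask_le {ι ι' κ : Type} [Fintype ι] [Fintype ι'] [DecidableEq ι] [DecidableEq ι']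
    (row : ι → κ → Bool) (col : ι' → κ → Bool) (y : κ → Matrix ι ι' K) (k l m : κ) :
    (cut row col k (cut row col l (y k - y l)) - cut row col m (cut row col k (cut row col l (y k - y l)))).rank ≤
      (cut row col k (cut row col l (y k - y l))).rank +
        2 * (cut row col k (cut row col m (y k - y m))).rank + 2 * (cut row col m (cut row col l (y m - y l))).rank := by
  refine (Summit.PneNP.PneNP.Theorems.CnfIdealGenLengthRankDefectRepresentationsMergeLowerBound.rank_sub_le' _ _).trans ?_
  rw [add_assoc]
  exact Nat.add_le_add le_rfl (rank_tripleCut_le row col y k l m)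

/-- **POLYNOMIAL SIM FROM Σ-SIM.**  Σ-SIM with constant `(n+1)^c` gives `SimBound K (Fin n) ((n+1)^(c+2))`: under the `SimBound` hypothesis every
pairwise defect is `≤ t`, so the double sum is `≤ n² t ≤ (n+1)² t`, and each single error is at most the total error. -/
theorem simBound_poly_of_sigmaSim (h : SigmaSim) :
    ∃ c : ℕ, ∀ (K : Type) [Field K] (n : ℕ), SimBound K (Fin n) ((n + 1) ^ (c + 2)) := by
  obtain ⟨c, hc⟩ := h
  refine ⟨c, fun K _ n => ?_⟩
  intro ι ι' _ _ _ _ row col y t hsupp hcons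
  obtain ⟨z, hz⟩ := hc K n ι ι' row col y hsupp
  refine ⟨z, fun k => ?_⟩
  have h1 : (cut row col k (z - y k)).rank ≤ ∑ k, (cut row col k (z - y k)).rank :=
    Finset.single_le_sum (f := fun k => (cut row col k (z - y k)).rank) (fun _ _ => Nat.zero_le _) (Finset.mem_univ k)
  have h2 : ∑ k : Fin n, ∑ l : Fin n, (cut row col k (cut row col l (y k - y l))).rank ≤ ∑ _k : Fin n, ∑ _l : Fin n, t :=
    Finset.sum_le_sum fun k _ => Finset.sum_le_sum fun l _ => hcons k l
  rw [Finset.sum_const, Finset.sum_const, Finset.card_univ, Fintype.card_fin, smul_eq_mul, smul_eq_mul] at h2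
  calc (cut row col k (z - y k)).rank ≤ ∑ k, (cut row col k (z - y k)).rank := h1
    _ ≤ (n + 1) ^ c * ∑ k, ∑ l, (cut row col k (cut row col l (y k - y l))).rank := hz
    _ ≤ (n + 1) ^ c * (n * (n * t)) := Nat.mul_le_mul_left _ h2
    _ ≤ (n + 1) ^ c * ((n + 1) * ((n + 1) * t)) := by gcongr <;> omega
    _ = (n + 1) ^ (c + 2) * t := by ring

/-- **POLYNOMIAL SIM, GIVEN THE REGISTERED STUB `stub_sigmaSim`.** -/
theorem simBound_poly_of_stub : ∃ c : ℕ, ∀ (K : Type) [Field K] (n : ℕ), SimBound K (Fin n) ((n + 1) ^ (c + 2)) :=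
  simBound_poly_of_sigmaSim sigmaSim_of_stub

end SigmaSim

end Summit.PneNP.PneNP.Cruxes.RankDefectRepresentations.RankDehnLadder
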